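import Summits.ABC.ABC.Theses.IneffectiveSubspace
import Summits.ABC.ABC.Theorems.TowerFourSubLiouville.Negative.UniformSavingCeiling
import Summits.ABC.ABC.Theorems.TowerFourSubLiouville.Negative.NoCoprimeSharp
import Summits.ABC.ABC.Theorems.TowerFourSubLiouville.Negative.LogLoss
import Summits.ABC.ABC.Theorems.TowerFourSubLiouville.Negative.PolynomialEnemyFloor
import Summits.ABC.ABC.Theorems.TowerFourSubLiouville.Negative.TorusEnemyFloor
import Summits.ABC.ABC.Theorems.TowerFourSubLiouville.Negative.FixedFormsDirichlet
import Summits.ABC.ABC.Theorems.IneffectiveSubspaceUniformSadicTowerFourFourthPowerDivisorRoth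
import Summits.ABC.ABC.Theorems.TowerFourSubLiouville.Negative.HallLangTransfer
import Summits.ABC.ABC.Theorems.TowerFourSubLiouville.Negative.HallLangTransferCruxFibre
import Summits.ABC.ABC.Theorems.TowerFourSubLiouville.Negative.HallLangTransferPell
import Summits.ABC.ABC.Theorems.TowerFourSubLiouville.Negative.TwoExponentDiagram
import Summits.ABC.ABC.Theorems.TowerFourSubLiouville.Negative.HallLangTransferTridentPell
import Summits.ABC.ABC.Theorems.TowerFourSubLiouville.Negative.TwoExponentSandwich
import Summits.ABC.ABC.Theorems.TowerFourSubLiouville.Negative.TwoExponentThetaZero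
import Summits.ABC.ABC.Theorems.TowerFourSubLiouville.Negative.TorusBezoutCorner
import Summits.ABC.ABC.Theorems.TowerFourSubLiouville.Negative.LiouvilleEndLittleO
import Summits.ABC.ABC.Theorems.TowerFourSubLiouville.Negative.EnemiesRepel
import Summits.ABC.ABC.Theorems.TowerFourSubLiouville.Negative.PolySzpiroFloor
import Summits.ABC.ABC.Theorems.TowerFourSubLiouville.Negative.PolySzpiroSix
import Summits.ABC.ABC.Theorems.TowerFourSubLiouville.Negative.LangWaldschmidtFloor
import Summits.ABC.ABC.Theorems.TowerFourSubLiouville.Negative.AnchoredSliceCorner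
import Summits.ABC.ABC.Theorems.TowerFourSubLiouville.Negative.TwoExponentSandwichSharp
import Summits.ABC.ABC.Theorems.TowerFourSubLiouville.Negative.LangWaldschmidtSandwich
import Summits.ABC.ABC.Theorems.TowerFourSubLiouville.Negative.LangWaldschmidtEpsilon
import Summits.ABC.ABC.Theorems.TowerFourSubLiouville.Negative.StaircaseCorner
import Summits.ABC.ABC.Theorems.TowerFourSubLiouville.Negative.PadeTwistThreeHalves
import Summits.ABC.ABC.Theorems.TowerFourSubLiouville.Negative.DirichletEdgeTwist
import Summits.ABC.ABC.Theorems.TowerFourSubLiouville.Negative.CriticalLineTwoNineteenths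

/-!
# Disproof of `TowerFourSubLiouville` (stmt-ABC-1649) — findings of the standing disprover

Crux (route `IneffectiveSubspace`, rank 4): `∃ A < 2, TowerIneq(4, A)`, where `TowerIneq(4, A)` says: for
every `ε > 0` some `C > 0` has `c < C · Π^{A+ε}` for all positive `x y z : Fin 4 → ℕ` with
`a + b = c`, `gcd(a,b) = 1`, `a = x₁x₂²x₃³x₄⁴`, `b = y₁y₂²y₃³y₄⁴`, `c = z₁z₂²z₃³z₄⁴`, `Π = ∏ xᵢyᵢzᵢ`
(`TowerIneq4` below; `crux_iff` is `Iff.rfl`).  Work file of the standing disprover (seats refuter-cdisprove-stmt-ABC-1649-0 … -g17-0,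
cycles 1–17; v29).  Everything here is `lean check`ed, no `sorry`; the per-cycle `## Cycle k` sections at the END of the file IMPORT
the landed modules and restate their theorems by name.  LANDED in the tree (importable, all `--supports stmt-ABC-1649`, namespace
`Summit.ABC.ABC.Theorems.TowerFourSubLiouville.Negative`; one-page index with proposal ids: `Cruxes/TowerFourSubLiouville/NOTES.md`,
dial table: `DIALS.md`): DialCalibration p72698 · Framing p74157 · NoCoprimeSharp p80795 · LogLoss p80878 · UniformSavingCeiling p106450 ·
PolynomialEnemyFloor p107305 · TorusEnemyFloor p109688 · FixedFormsDirichlet p125878 · TwoExponentDiagram p126734/p126869 · ConstantFree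
p127459 · LogLossSharp p127558 · CoprimeDispensable p127991 · LiouvilleEndLittleO p129100 · EnemiesRepel p129200 · HallLangTransfer p131589 ·
HallLangTransferCruxFibre p131711 · HallLangTransferPell p132424 · HallLangTransferTrident p132837 · HallLangTransferTridentPell p133548 ·
TwoExponentSandwich p137739 · TwoExponentThetaZero p137751 · TorusBezoutCorner p138228 · PolySzpiroFloor p140986 · PolySzpiroSix p141951 ·
LangWaldschmidtFloor p141178 · AnchoredSliceCorner p141423 · TwoExponentSandwichSharp p143568 · LangWaldschmidtSandwich p143831 ·
LangWaldschmidtEpsilon p151827 · AxisBoundary p152685 · StaircaseCorner p153421 · PadeTwistThreeHalves p153437 · DirichletEdgeTwist p154214 ·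
CriticalLineStep p157288 · CriticalLineTwoSevenths p157619 · CriticalLineTwoThirteenths p157983 · PadeTableThree p161229 ·
CriticalLineTwoNineteenths p161550 (cycle 17).
What each cycle added, in one line: 1 sandwich `ABC ⟹ crux` + dial calibration; 2 non-coprime dial `4/3`, log-loss; 3 uniform ceiling `3/2`,
ℙ¹ identity floor; 4 torus floor `1`, width-1 dessin census; 5 per-form dial `2`, two-exponent diagram; 6 constant-free / coprime-free forms;
7 `c = o(Π²)`, gap principle, sporadic census; 8–10 transfer dials of line SketchIdeator5 pinned (`K = 1`, `κ = 2`, trident `5/4`); 11 `ABC`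
half-plane, corner `(2,0)`; 12 PolySzpiro exact at `6`, LW₄ floor `1`, anchored slice; 13 `ABC` side of the diagram final (`θ+φ<2`, sharp),
`ABC ⟹ hLW`; 14 rigorous mod-`p` identity census (§ Cycle 14); 15 `hLW`'s `ε` is NECESSARY — `LW₄(κ)` false for all `κ ≤ 1`; boundary values decided by `q`-adic twists: axis point `(2,0)`, corners `(1,2)`, `(1,3/2)`, `UBQ(3/2)` FALSE (§ Cycle 15); 16 the Padé STEP from the value-`1` corner: FALSE points ON the line
`θ + φ = 2` — `(2/7, 12/7)` exact, a lobe at `(2/13, 24/13)`, the edge point `(2/13, 2)` (§ Cycle 16); 17 the `z = 3` step with the obstruction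
prime DIVIDED OUT: lobe at `(2/19, 36/19)`; the Padé table (₂F₁ pair, recurrence, constant Casoratians); generic enemy-family ⟹ lobe lemma (§ Cycle 17).

STATUS 2026-08-16T21:00Z: the item is OPEN again — an ACTIVE crux of route-ABC-IneffectiveSubspace (reopened by human
ruling; since rev 28 `TowerFourSubLiouville` is a (non-load-bearing) HYPOTHESIS of the route's deciding theorem
`closes`: USTF → PPR → T4SL → DeepRegimeABC → ABC, so a landed `¬crux` would now be a first-class kill path — none exists
short of `¬ABC`, see the sandwich).  Lead c1 declared ALL lines dead (2026-08-16T15:35Z, `Lines/*-dead.md`, `PICKED.md`):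
`fourth-radical-binomial-thue` at its only open stub `stub_genericFormsSaving`, kernel-certified crux-EQUIVALENT
(`Summit.ABC.ABC.Theorems.TowerFourSubLiouville.stub_coreIffCrux`, p87895); `isotypic-demjanenko-manin` at
`stub_quarticThueOffSlice` (same normal form).  The crux is banked three ways: `ABC ⟹ crux` (p74157), `stmt-ABC-14937 ⟹ crux`
(support 15070, proved), Lang–Waldschmidt (m = 4, |bᵢ| ≤ 4, product form) `⟹ crux` (p111401).
MAP OF THE DIALS: the consolidated DIAL TABLE is `Cruxes/TowerFourSubLiouville/DIALS.md` (source of truth since v25; § (13d), § (15d) below); in words —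
crux dial `A`: `< 1` false (Pell), `= 1` needs `ε` (even `log c/(log log c)^B`, `B > 1`, fails, p127558), `ABC ⟹ 1`, crux asks `< 2`, at
`A = 2` true with every constant (`c < Π²`, `c = o(Π²)`: p127459, p129100); crux ⟺ constant-free form ⟺ non-coprime form (p127459, p127991);
non-coprime dial exactly `4/3` under `ABC`.  Core `UBQ η` (⟺ crux, p87895): per form exactly `2` (Roth p85914 / Dirichlet p125878); uniform:
false `≥ 3/2` (p153437; `> 3/2` p106450), `ABC`-true `< 1` (p143568); identity floors `2 + 1/z` (ℙ¹, p107305) / `2` (torus, p109688) = the `ABC` line.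
Two-exponent diagram: FALSE `{θ≥2, φ≥0} ∪ {θ≥1, φ≥3/2} ∪ {θ≥2/7, φ≥12/7} ∪ {θ≥2/13, φ>24/13} ∪ {θ≥2/19, φ>36/19} ∪ {θ>0, φ>2}` (p152685, p153437,
p157619, p157983, p161550, p154214) — the line points `(2,0)`, `(2/7,12/7)` are FALSE, `(0,2)` TRUE; `ABC`-TRUE `{θ + φ < 2}` sharp (p143568).  Sporadic census (j020482, § (7c)):
random-model law, `UBQ 1/2` on `11 ≤ Z ≤ 10⁸`.  Transfer dials of line SketchIdeator5: `UniformLjunggren`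
pinned at `K = 1`, `HallLang1728` at `κ = 2` (p132424), trident at `5/4` (p133548); `PolySzpiro` exact at `6` (p140986, p141951); `LW₄` DECIDED
at `1`: false for every `κ ≤ 1` (p151827; `κ < 1` p141178), `ABC`-true for every `κ > 1` (p143831).

## Verdict of cycle 1: NO KILL IS POSSIBLE SHORT OF `¬ABC` — the crux is sandwiched
`ABC ⟹ TowerIneq(4, 1) ⟹ crux` (take `A = 1`; `rad(abc) = rad(∏ xᵢyᵢzᵢ) ≤ Π`): PROVED below as
`crux_of_abc : ABC → TowerFourSubLiouville` (via `towerIneq4_one_of_abc`, `rad_dvd_towerProd`; the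
all-level version = support item `AbcGivesTower`, stmt-ABC-1652, is attached to that item as a complete
candidate proof).  So any refutation of the crux refutes `ABC`.  What this
file delivers instead is the CALIBRATION of the exponent dial at level 4, as theorems:

* dictionary.  `pm(n) := ∏_p p^⌈e_p(n)/4⌉` is the least `∏ xᵢ` over tower representations of `n`
  (a prime power `p^e` must be split into parts from `{1,2,3,4}`, at least `⌈e/4⌉` of them), so with
  the *tower quality* `tq(a,b,c) := log c / log(pm(a)pm(b)pm(c))` of a coprime `a + b = c`:
  `TowerIneq(4,A)` (all `ε`) ⟺ `limsup tq ≤ A`.  Trivially `limsup tq ≤ 2` (`pm(n) ≥ n^{1/4}`,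
  `abc ≥ c²/2`: item `TowerLiouvilleExponent`); `ABC ⟹ limsup tq ≤ 1` (`pm ≥ rad`); crux ⟺ `< 2`.
* (a) load-bearing hypotheses.  Positivity: load-bearing only through `Π = 0`
  (`towerFourSubLiouville_false_without_pos`, witness `x = (0,1,1,1)`).  The equation: load-bearing
  (`towerFourSubLiouville_false_without_eq`, witness `z = (1,1,1,m)`, `c = m⁴` vs `Π = m`).
  Coprimality: NOT load-bearing for `∃ A < 2` — PROVED `towerIneq4NoCoprime_of_abc`: `ABC ⟹` the
  non-coprime inequality for every `A > 5/3` (`cube_lt_of_abc`: `a = g a'` etc., `g³c'² ≤ 2abc ≤ 2Π⁴`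
  and `c' < K rad(a'b'c')^{1+e} ≤ KΠ^{1+e}`, so `c³ < 2KΠ^{5+e}`), but it moves the FLOOR of the dial: without coprimality
  `TowerIneq` fails for every `A < 4/3` (`towerIneq4NoCoprime_false_below_four_thirds`, witness
  `2^{4k} + 2^{4k} = 2·2^{4k}`, `Π = 2·2^{3k}`), with coprimality only for `A < 1` (next item).
  CYCLE 2 (SHARP): `ABC ⟹` the non-coprime inequality for every `A ≥ 4/3` (`towerIneq4NoCoprime_of_abc_sharp`,
  via the prime-by-prime divisibility `g³·rad(a'b'c')³ ∣ Π⁴`, `cube_mul_radical_cube_dvd`), so under `ABC` the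
  non-coprime dial is EXACTLY `4/3` (`towerIneq4NoCoprime_iff_of_abc`) while the coprime one is exactly `1`.
  For a prover: a proof of `A < 2` that never uses coprimality is not excluded by anything here — but a
  gcd-insensitive argument proves at best `A = 4/3`; any target below `4/3` must use `gcd(a,b) = 1`.
* (b) tightness of the conjectural optimum `A = 1` (level-2 Pell families embedded `X₂ ↪ X₄`):
  `towerIneq4_false_below_one : ∀ A < 1, ¬ TowerIneq4 A` (`1 + 3v² = u²`, `y = (3,v,1,1)`,
  `z = (1,u,1,1)`, `Π = 3uv ≤ 3c`), and `not_towerIneq4OneNoEps`: at `A = 1` the `ε` cannot be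
  dropped (`c < C·Π` fails: Matiyasevich's `y_N² ∣ y_{N·y_N}` = `Pell.ysq_dvd_yy` gives `v = w²t`,
  `y = (3,t,1,w)`, `Π = 3uv/w ≤ 3c/N`) — the tower analogue of
  `Literature.Barriers.ABC.EpsilonCannotBeDropped`.  By Mason–Stothers no POLYNOMIAL family reaches
  `Π = O(c)` (`Σ deg-pm ≥ #roots(PQR) ≥ deg + 1`), which is why exponential (Pell) families are used.
  CYCLE 2 (QUANTITATIVE): the same family with `w = y_{N+1} ≥ 3^N` gives `c/Π ≥ w/3` with `log c ≤ 16 w log w`,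
  so even `c ≤ C·Π·(log c)^A` fails for every fixed `A < 1` (`not_towerIneq4One_logLoss`, last section);
  the loss `log c` itself is not refuted by Pell-type families (square part of `y_m` is `≲ m ≍ log c`).
* (c) constants.  `quality_point_4375`: `1 + 2·3⁷ = 5⁴·7` lifted as `y = (2,1,3,3)`, `z = (7,1,1,5)`
  has `Π = 630`, `tq = 1.30066`, `630^{13/10} < 4375`; so with `C = 1` the exponent must exceed
  `13/10` (`not_towerIneq4_constant_one_exponent_13_10`).  Exhaustive search: see
  `## Computation` below; no coprime point with `c ≤ 2·10⁵` has `tq ≥ 1.301`.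
* (d) targets: no line PICKED and `stuck_stubs = []`; two skeletons were registered under `Lines/` (03:52–04:01, after the
  item went moot).  Pre-emptive cheap checks of their 7 stubs (cycle 2): none refutable short of `¬ABC`, none misstated —
  `fourth-radical-binomial-thue`: `stub_transfer` true (this file's `bad_point_shape`; `w ≤ E³` forces `Z → ∞` with `c`),
  `stub_fixedFormsRoth` true per form (`roth_holds`, `|θ⁴ − r⁴| ≥ θ³|θ − r|`; rational `θ` with `gcd(v,w)=1` ⟹ `v = q⁴, w = p⁴`),
  `stub_genericFormsSaving` = the core (`ABC ⟹` it for `η < 8/13`); `isotypic-demjanenko-manin`: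
  `stub_uniformHeightDifference` (NB the tree's `canonicalHeight` is a `limUnder`, `tendsto_canonicalHeight` an unproved named
  fact — Tate's telescoping proves convergence and the bound together, so not blocked), `stub_isotypicRankLeOne` (Lang-type),
  `stub_isotypicHighRank` (`ABC ⟹` it with any `K > 1/2`; census `log Z / log w ≤ 0.515`), `stub_quarticThueOffSlice` = core.
* (e) near-misses: none claimed — see "why it resists".  Cycle 2 leaves open only the loss `log c` at `A = 1` (last section).

## Why it resists (for ideators / the lead)
1. Extremal regime (PROVED as `bad_point_shape`, from the exact identity `Π⁴ = abc·E`,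
   `E = (x₀y₀z₀)³(x₁y₁z₁)²(x₂y₂z₂)`, `towerProd_pow_four_eq`): a point with `C·Π^s ≤ c` has
   `min(a,b)·E·c² ≤ 2(c/C)^{4/s}`, i.e. for `s = 2 − δ`: `min(a,b)·E ≤ 2C^{-4/s}·c^{2δ/(2−δ)}` — the
   smaller summand and all nine non-quartic coordinates are `c^{O(δ)}`; the point is a coprime solution
   of the diagonal quartic Thue equation `wZ⁴ − vY⁴ = a` (`v = y₀y₁²y₂³`, `w = z₀z₁²z₂³`, `Y = y₃`,
   `Z = z₃`) with `a·v·w ≤ a·E ≤ c^{O(δ)} = Z^{O(δ)}`.  Conversely such solutions have `tq ≥ 2 − O(δ)`.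
   Hence: crux ⟺ (up to constants in the exponent) "for some `K`, every coprime solution of
   `wZ⁴ − vY⁴ = a` has `Z ≤ C·max(a,v,w)^K`" — a UNIFORM POLYNOMIAL bound for a two-parameter
   family of quartic Thue equations.  Known: Baker-type bounds `Z ≤ exp(c·(vw)^{κ} log a …)`
   (Bugeaud–Győry; `Literature.Barriers.ABC.BakerMethodBounds` — evaded by the crux only in that
   ineffective `C` is allowed); Thue–Siegel–Roth: for FIXED `(v,w)` finitely many solutions and
   `tq ≤ 8/5` along the family (Roth on `|⁴√(w/v) − Y/Z| ≍ a/(v^{1/4}w^{3/4}Z⁴)`), constants neither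
   effective nor uniform; quantitative Roth / Bombieri–Schmidt / Mueller–Schmidt / Evertse /
   Bennett (Crelle 2001, `|aX⁴ − bY⁴| = 1`) bound the NUMBER of (large) solutions uniformly, never
   their SIZE.  One huge solution per form, for infinitely many small forms, is exactly what no
   available tool excludes and what `ABC` forbids.  So: open, implied by `ABC`, and an unconditional
   proof would be the first polynomial-in-the-coefficients Thue bound for an infinite natural family.
2. Heuristic.  For `(v,w,Z)` the residue `a = wZ⁴ − v⌊(w/v)^{1/4}Z⌋⁴` is spread over
   `[0, 4v^{1/4}w^{3/4}Z³]`; solutions with `max(a,v,w) ≤ Z^{η}` up to height `T` number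
   `≈ Σ_T T^{3η−2}`: finite for `η < 2/3`, infinite for `η > 2/3`, and `tq ≈ 4/(2+3η)`; so the
   probabilistic value of the dial is `A*(4) = 1` (as the planner says) and counterexamples to the
   crux have probability zero.  Consistent with the job: record `tq` decreases with `c`.
3. Disproof routes tried and dead: (i) polynomial identities (Mason–Stothers caps them at
   `Π ≍ c^{1+1/d}`, `tq → 1⁻`… they cannot even beat `1`); (ii) Pell/Lucas families give `tq → 1`
   exactly (floor, items (b)); (iii) `S`-unit families `1 + (q^k − 1) = q^k`: `pm(q^k) = q^{⌈k/4⌉}`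
   costs `c^{1/4}`, so `tq > 1` needs the powerful excess `b/pm(b) = ∏ p^{e−⌈e/4⌉}` of `b = q^k − 1`
   to exceed `c^{1/4}` (e.g. `p² ∣ q^k − 1` with `p > c^{1/4}`), while lifting the exponent supplies
   `p^j ∣ q^k − 1` only for `p^{j−1} ∣ k`-type indices, i.e. `p ≲ k ≍ log c` — hopeless;
   (iv) near-quartic search (`v,w ≤ 60`, `Z ≤ 2·10⁴`, `a ≤ 10⁶`): best `tq` at `Z > 300` is 1.079,
   at `Z > 1000` it is 1.055 (see below).  A genuine kill needs an infinite family of coprime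
   `wZ⁴ − vY⁴ = a` with `log max(a,v,w) = o(log Z)` — which would refute `ABC`.

## Computation (seat folder `partA_local.py` / `partB_local.py`; larger ranges = kit job j007836 → item evidence)
* Exhaustive, coprime `a + b = c`, `c ≤ 2·10⁵`: exactly 111 points with `tq > 1`.  Top:
  `1+4374=4375` 1.30066 · `1+80=81` 1.29203 · `1+2400=2401` 1.28863 · `1+12167=12168` 1.25551 ·
  `1+57121=57122` 1.25398 (`57121 = 239²`, `57122 = 2·13⁴`) · `81+1250=1331` 1.24048 ·
  `1+6859=6860` 1.22808 · `1+8=9` 1.22629 · `28+50625=50653` 1.20928 · `1+9800=9801` 1.18660.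
  Max `tq` by decade of `c`: `[1,10)` 1.226, `[10,10²)` 1.292, `[10²,10³)` 1.185, `[10³,10⁴)` 1.301,
  `[10⁴,10⁵)` 1.256, `[10⁵,2·10⁵)` 1.120 — decreasing tail, as the heuristic predicts.
* Near-quartic regime `wZ⁴ − vY⁴ = a > 0`, `gcd = 1`, `Y` maximal: `v,w ≤ 60`, `Z ≤ 2·10⁴`,
  `a ≤ 10⁶` (`partB_local.py 60 20000 1000000`; 18216 points with `Z > 10`): best `tq` = 1.29203
  (`1+80=81`), then the sporadic all-quartic coincidence `3·11⁴ + 7·211⁴ = 10·193⁴`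
  (`c = 13 874 880 010`, `Π = rad = 94 070 130`, `tq = 1.27200`); by height: `Z > 100`: 613 points,
  max 1.27200; `Z > 300`: 82 points, max 1.07886 (`567845 + 21·577⁴ = 26·547⁴`); `Z > 1000`:
  4 points, max 1.05472 (`27409 + 47·943⁴ = 36·1008⁴`); `Z > 3000`: none with `a ≤ 10⁶`.
  Nothing anywhere near `2`, no family structure among the top points, record decreasing with height —
  the heuristic picture (item 2 above).  Kit job j007836 (queued behind the farm backlog at the time of
  writing) repeats part A to `c ≤ 3·10⁶` (`tq > 1.2`) and attaches its manifest to the item.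
-/

-- `Summit.ABC.ABC` is the mandated summit-side namespace (CONVENTIONS §2); the duplicate is deliberate.
set_option linter.dupNamespace false

namespace Summit.ABC.ABC.Cruxes.TowerFourSubLiouville.Disproof

open scoped BigOperators
open Summit.ABC.ABC.Theses.IneffectiveSubspace
open Literature.NumberTheory.DiophantineGeometry (IsABCTriple rad rad_def)

/-- The level-4 tower inequality with exponent dial `A`; the crux is `∃ A < 2, TowerIneq4 A`. -/
def TowerIneq4 (A : ℝ) : Prop :=
  ∀ ε : ℝ, 0 < ε → ∃ C : ℝ, 0 < C ∧ ∀ x y z : Fin 4 → ℕ, (∀ i, 0 < x i ∧ 0 < y i ∧ 0 < z i) →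
    (∏ i, x i ^ (i.val + 1)) + (∏ i, y i ^ (i.val + 1)) = ∏ i, z i ^ (i.val + 1) →
    Nat.Coprime (∏ i, x i ^ (i.val + 1)) (∏ i, y i ^ (i.val + 1)) →
    ((∏ i, z i ^ (i.val + 1) : ℕ) : ℝ) < C * ((∏ i, x i * y i * z i : ℕ) : ℝ) ^ (A + ε)

theorem crux_iff : TowerFourSubLiouville ↔ ∃ A : ℝ, A < 2 ∧ TowerIneq4 A := Iff.rfl

/-- Growth lemma used by every witness family: for `s < 1`, `K * T ^ s ≤ T` for all large `T`. -/
theorem key_growth {K s : ℝ} (hK : 0 ≤ K) (hs : s < 1) :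
    ∃ M : ℝ, 1 ≤ M ∧ ∀ T : ℝ, M ≤ T → K * T ^ s ≤ T := by
  refine ⟨max 1 (K ^ (1 - s)⁻¹), le_max_left _ _, fun T hT => ?_⟩
  have hT1 : 1 ≤ T := le_trans (le_max_left _ _) hT
  have hT0 : 0 < T := by linarith
  have hne : 1 - s ≠ 0 := (sub_pos.mpr hs).ne'
  have h1 : K ≤ T ^ (1 - s) := by
    calc K = (K ^ (1 - s)⁻¹) ^ (1 - s) := (Real.rpow_inv_rpow hK hne).symm
      _ ≤ T ^ (1 - s) :=
        Real.rpow_le_rpow (Real.rpow_nonneg hK _) (le_trans (le_max_right _ _) hT) (sub_pos.mpr hs).le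
  calc K * T ^ s ≤ T ^ (1 - s) * T ^ s := mul_le_mul_of_nonneg_right h1 (Real.rpow_nonneg hT0.le _)
    _ = T := by rw [← Real.rpow_add hT0, sub_add_cancel, Real.rpow_one]

/-- `(t ^ 4) ^ (s / 4) = t ^ s` for `t ≥ 0` (real exponent bookkeeping). -/
theorem pow_four_rpow {t : ℝ} (ht : 0 ≤ t) (s : ℝ) : (t ^ 4) ^ (s / 4) = t ^ s := by
  rw [show t ^ 4 = t ^ (4:ℝ) by rw [← Real.rpow_natCast]; norm_num, ← Real.rpow_mul ht]
  congr 1; ring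

/-- `(t ^ 3) ^ s = t ^ (3 * s)` for `t ≥ 0`. -/
theorem pow_three_rpow {t : ℝ} (ht : 0 ≤ t) (s : ℝ) : (t ^ 3) ^ s = t ^ (3 * s) := by
  rw [show t ^ 3 = t ^ (3:ℝ) by rw [← Real.rpow_natCast]; norm_num, ← Real.rpow_mul ht]


/-! ## Sandwich: `ABC ⟹ crux` — why no refutation can exist short of `¬ABC` -/

/-- `rad(abc)` divides `∏ xᵢyᵢzᵢ` for a tower point (`abc = ∏ (xᵢyᵢzᵢ)^{i+1}`; `radical_prod_dvd`,
`radical_pow_dvd`, `radical_dvd_self`). -/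
theorem rad_dvd_towerProd (x y z : Fin 4 → ℕ) :
    Literature.NumberTheory.DiophantineGeometry.rad (∏ i, x i ^ (i.val + 1)) (∏ i, y i ^ (i.val + 1))
      (∏ i, z i ^ (i.val + 1)) ∣ ∏ i, x i * y i * z i := by
  rw [Literature.NumberTheory.DiophantineGeometry.rad_def]
  have hprod : (∏ i, x i ^ (i.val + 1)) * (∏ i, y i ^ (i.val + 1)) * (∏ i, z i ^ (i.val + 1)) =
      ∏ i, (x i * y i * z i) ^ (i.val + 1) := by
    rw [← Finset.prod_mul_distrib, ← Finset.prod_mul_distrib]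
    refine Finset.prod_congr rfl fun i _ => ?_
    ring
  rw [hprod]
  calc UniqueFactorizationMonoid.radical (∏ i, (x i * y i * z i) ^ (i.val + 1))
      ∣ ∏ i, UniqueFactorizationMonoid.radical ((x i * y i * z i) ^ (i.val + 1)) :=
        UniqueFactorizationMonoid.radical_prod_dvd
    _ ∣ ∏ i, (x i * y i * z i) := Finset.prod_dvd_prod_of_dvd _ _ fun i _ =>
        UniqueFactorizationMonoid.radical_pow_dvd.trans UniqueFactorizationMonoid.radical_dvd_self

/-- **The sandwich.** `ABC ⟹ TowerIneq4 1`, hence `ABC ⟹` the crux (take `A = 1 < 2`): a tower point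
gives the abc triple `(a,b,c)` and `rad(abc) ≤ ∏ xᵢyᵢzᵢ`.  (Level-4 instance of the route's support
item `AbcGivesTower`, stmt-ABC-1652.)  Consequently any refutation of the crux refutes `ABC`. -/
theorem towerIneq4_one_of_abc (habc : ABC) : TowerIneq4 1 := by
  intro ε hε
  obtain ⟨C, hC, h⟩ := (ABC_iff.mp habc) ε hε
  refine ⟨C, hC, fun x y z hpos heq hcop => ?_⟩
  have ha : 0 < ∏ i, x i ^ (i.val + 1) := Finset.prod_pos fun i _ => pow_pos (hpos i).1 _
  have hb : 0 < ∏ i, y i ^ (i.val + 1) := Finset.prod_pos fun i _ => pow_pos (hpos i).2.1 _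
  have hlt := h _ _ _ ⟨ha, hb, heq, hcop⟩
  have hPpos : 0 < ∏ i, x i * y i * z i :=
    Finset.prod_pos fun i _ => Nat.mul_pos (Nat.mul_pos (hpos i).1 (hpos i).2.1) (hpos i).2.2
  have hle : ((Literature.NumberTheory.DiophantineGeometry.rad (∏ i, x i ^ (i.val + 1))
      (∏ i, y i ^ (i.val + 1)) (∏ i, z i ^ (i.val + 1)) : ℕ) : ℝ) ≤ ((∏ i, x i * y i * z i : ℕ) : ℝ) := by
    exact_mod_cast Nat.le_of_dvd hPpos (rad_dvd_towerProd x y z)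
  calc ((∏ i, z i ^ (i.val + 1) : ℕ) : ℝ)
      < C * ((Literature.NumberTheory.DiophantineGeometry.rad (∏ i, x i ^ (i.val + 1))
          (∏ i, y i ^ (i.val + 1)) (∏ i, z i ^ (i.val + 1)) : ℕ) : ℝ) ^ (1 + ε) := hlt
    _ ≤ C * ((∏ i, x i * y i * z i : ℕ) : ℝ) ^ (1 + ε) := by
        apply mul_le_mul_of_nonneg_left _ hC.le
        exact Real.rpow_le_rpow (by positivity) hle (by linarith)

theorem crux_of_abc (habc : ABC) : TowerFourSubLiouville :=
  ⟨1, by norm_num, towerIneq4_one_of_abc habc⟩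

/-! ## Reduction: shape of a bad point — the dictionary to the Thue regime `wZ⁴ − vY⁴ = a` -/

/-- The exact slack identity of the Liouville bound: `Π⁴ = abc · E` with the *excess*
`E = (x₀y₀z₀)³ (x₁y₁z₁)² (x₂y₂z₂)` (indices `0,1,2` = exponents `1,2,3`). -/
theorem towerProd_pow_four_eq (x y z : Fin 4 → ℕ) :
    (∏ i, x i * y i * z i) ^ 4 =
      (∏ i, x i ^ (i.val + 1)) * (∏ i, y i ^ (i.val + 1)) * (∏ i, z i ^ (i.val + 1)) *
        ((x 0 * y 0 * z 0) ^ 3 * (x 1 * y 1 * z 1) ^ 2 * (x 2 * y 2 * z 2)) := by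
  simp only [Fin.prod_univ_four, Fin.isValue, Fin.val_zero, Fin.val_one, Fin.val_two]
  simp only [show (3 : Fin 4).val = 3 from rfl]
  ring

/-- **Shape of a bad point (dictionary to the Thue regime).** If a positive tower point `a + b = c`
satisfies `C · Π^s ≤ c` (it violates the tower inequality with exponent `s` and constant `C`), then
`min(a,b) · E · c² ≤ 2 · (c/C)^{4/s}`, where `E = (x₀y₀z₀)³(x₁y₁z₁)²(x₂y₂z₂)`.  For `s = 2 − δ` the
right side is `2 C^{-4/s} · c^{2 + 2δ/(2−δ)}`: so `min(a,b) · E ≤ 2C^{-4/s} c^{2δ/(2−δ)}` — the smaller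
summand AND every non-quartic coordinate are `c^{O(δ)}`, i.e. the point is `a + vY⁴ = wZ⁴` with
`a·v·w ≤ a·E = c^{O(δ)}` (`v = y₀y₁²y₂³ ≤ E`, `w = z₀z₁²z₂³ ≤ E`). Proof: `Π⁴ = abcE`, `max(a,b) ≥ c/2`. -/
theorem bad_point_shape {C s : ℝ} (hC : 0 < C) (hs : 0 < s) (x y z : Fin 4 → ℕ)
    (hpos : ∀ i, 0 < x i ∧ 0 < y i ∧ 0 < z i)
    (heq : (∏ i, x i ^ (i.val + 1)) + (∏ i, y i ^ (i.val + 1)) = ∏ i, z i ^ (i.val + 1))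
    (hbad : C * ((∏ i, x i * y i * z i : ℕ) : ℝ) ^ s ≤ ((∏ i, z i ^ (i.val + 1) : ℕ) : ℝ)) :
    ((min (∏ i, x i ^ (i.val + 1)) (∏ i, y i ^ (i.val + 1)) : ℕ) : ℝ) *
        (((x 0 * y 0 * z 0) ^ 3 * (x 1 * y 1 * z 1) ^ 2 * (x 2 * y 2 * z 2) : ℕ) : ℝ) *
        ((∏ i, z i ^ (i.val + 1) : ℕ) : ℝ) ^ 2 ≤
      2 * (((∏ i, z i ^ (i.val + 1) : ℕ) : ℝ) / C) ^ (4 / s) := by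
  -- abbreviations
  generalize ha : (∏ i, x i ^ (i.val + 1)) = a at heq ⊢
  generalize hb : (∏ i, y i ^ (i.val + 1)) = b at heq ⊢
  generalize hc : (∏ i, z i ^ (i.val + 1)) = c at heq hbad ⊢
  generalize hE : ((x 0 * y 0 * z 0) ^ 3 * (x 1 * y 1 * z 1) ^ 2 * (x 2 * y 2 * z 2)) = E
  have hP4 : (∏ i, x i * y i * z i) ^ 4 = a * b * c * E := by
    rw [towerProd_pow_four_eq, ha, hb, hc, hE]
  generalize hP : (∏ i, x i * y i * z i) = P at hP4 hbad
  have hP0 : 0 < P := by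
    rw [← hP]; exact Finset.prod_pos fun i _ => Nat.mul_pos (Nat.mul_pos (hpos i).1 (hpos i).2.1) (hpos i).2.2
  -- real version of Π⁴ ≤ (c/C)^{4/s}
  have hPR : (0 : ℝ) < P := by exact_mod_cast hP0
  have hcC : (P : ℝ) ^ s ≤ (c : ℝ) / C := by
    rw [le_div_iff₀ hC]; linarith
  have hPle : (P : ℝ) ≤ ((c : ℝ) / C) ^ (1 / s) := by
    have : ((P : ℝ) ^ s) ^ (1 / s) ≤ ((c : ℝ) / C) ^ (1 / s) :=
      Real.rpow_le_rpow (by positivity) hcC (by positivity)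
    rwa [← Real.rpow_mul hPR.le, mul_one_div_cancel hs.ne', Real.rpow_one] at this
  have hcC0 : (0 : ℝ) ≤ (c : ℝ) / C := le_trans (by positivity) hcC
  have hP4le : (P : ℝ) ^ 4 ≤ ((c : ℝ) / C) ^ (4 / s) := by
    calc (P : ℝ) ^ 4 ≤ (((c : ℝ) / C) ^ (1 / s)) ^ 4 := by gcongr
      _ = ((c : ℝ) / C) ^ (4 / s) := by
          rw [← Real.rpow_natCast, ← Real.rpow_mul hcC0]; norm_num; ring_nf
  -- combinatorial part: min(a,b) · E · c² ≤ 2 · a b c E = 2 P⁴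
  have hP4R : ((P : ℝ)) ^ 4 = (a : ℝ) * b * c * E := by exact_mod_cast hP4
  have hkey : ((min a b : ℕ) : ℝ) * (E : ℝ) * (c : ℝ) ^ 2 ≤ 2 * ((a : ℝ) * b * c * E) := by
    have hE0 : (0 : ℝ) ≤ (E : ℝ) := by positivity
    have hc0 : (0 : ℝ) ≤ (c : ℝ) := by positivity
    rcases le_total a b with hab | hab
    · rw [min_eq_left hab]
      have h2b : (c : ℝ) ≤ 2 * (b : ℝ) := by
        have : c ≤ 2 * b := by omega
        exact_mod_cast this
      have ha0 : (0 : ℝ) ≤ (a : ℝ) := by positivity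
      calc (a : ℝ) * E * (c : ℝ) ^ 2 = ((a : ℝ) * E * c) * c := by ring
        _ ≤ ((a : ℝ) * E * c) * (2 * b) := mul_le_mul_of_nonneg_left h2b (by positivity)
        _ = 2 * ((a : ℝ) * b * c * E) := by ring
    · rw [min_eq_right hab]
      have h2a : (c : ℝ) ≤ 2 * (a : ℝ) := by
        have : c ≤ 2 * a := by omega
        exact_mod_cast this
      calc (b : ℝ) * E * (c : ℝ) ^ 2 = ((b : ℝ) * E * c) * c := by ring
        _ ≤ ((b : ℝ) * E * c) * (2 * a) := mul_le_mul_of_nonneg_left h2a (by positivity)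
        _ = 2 * ((a : ℝ) * b * c * E) := by ring
  calc ((min a b : ℕ) : ℝ) * (E : ℝ) * (c : ℝ) ^ 2 ≤ 2 * ((a : ℝ) * b * c * E) := hkey
    _ = 2 * (P : ℝ) ^ 4 := by rw [hP4R]
    _ ≤ 2 * ((c : ℝ) / C) ^ (4 / s) := by linarith

/-! ## (a) Load-bearing hypotheses -/

/-- The crux with the positivity hypothesis `∀ i, 0 < x i ∧ 0 < y i ∧ 0 < z i` dropped. -/
def TowerFourSubLiouvilleWithoutPos : Prop :=
  ∃ A : ℝ, A < 2 ∧ ∀ ε : ℝ, 0 < ε → ∃ C : ℝ, 0 < C ∧ ∀ x y z : Fin 4 → ℕ,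
    (∏ i, x i ^ (i.val + 1)) + (∏ i, y i ^ (i.val + 1)) = ∏ i, z i ^ (i.val + 1) →
    Nat.Coprime (∏ i, x i ^ (i.val + 1)) (∏ i, y i ^ (i.val + 1)) →
    ((∏ i, z i ^ (i.val + 1) : ℕ) : ℝ) < C * ((∏ i, x i * y i * z i : ℕ) : ℝ) ^ (A + ε)

/-- Positivity is load-bearing (through `Π = 0` only): witness `x = (0,1,1,1)`, `y = z = (1,1,1,1)`,
`0 + 1 = 1`, `gcd(0,1) = 1`, `Π = 0`, and `1 < C · 0 ^ (A+ε) = 0` fails (`ε := |A| + 1`). -/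
theorem towerFourSubLiouville_false_without_pos : ¬ TowerFourSubLiouvilleWithoutPos := by
  rintro ⟨A, -, h⟩
  have hε : (0 : ℝ) < |A| + 1 := by positivity
  obtain ⟨C, -, h⟩ := h (|A| + 1) hε
  have key := h ![0, 1, 1, 1] ![1, 1, 1, 1] ![1, 1, 1, 1] (by simp [Fin.prod_univ_four])
    (by simp [Fin.prod_univ_four])
  have hne : A + (|A| + 1) ≠ 0 := by
    have := neg_abs_le A
    intro h0; linarith
  simp [Fin.prod_univ_four, Real.zero_rpow hne] at key
  norm_num at key

/-- The crux with the equation `a + b = c` dropped. -/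
def TowerFourSubLiouvilleWithoutEq : Prop :=
  ∃ A : ℝ, A < 2 ∧ ∀ ε : ℝ, 0 < ε → ∃ C : ℝ, 0 < C ∧ ∀ x y z : Fin 4 → ℕ, (∀ i, 0 < x i ∧ 0 < y i ∧ 0 < z i) →
    Nat.Coprime (∏ i, x i ^ (i.val + 1)) (∏ i, y i ^ (i.val + 1)) →
    ((∏ i, z i ^ (i.val + 1) : ℕ) : ℝ) < C * ((∏ i, x i * y i * z i : ℕ) : ℝ) ^ (A + ε)

/-- The equation is load-bearing: witness `x = y = (1,1,1,1)`, `z = (1,1,1,m)`: `c = m⁴`, `Π = m`,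
and `m⁴ < C m^{A+1}` fails for large `m` since `A + 1 < 3 < 4` (`ε := 1`). -/
theorem towerFourSubLiouville_false_without_eq : ¬ TowerFourSubLiouvilleWithoutEq := by
  rintro ⟨A, hA, h⟩
  obtain ⟨C, hC, h⟩ := h 1 one_pos
  obtain ⟨M, hM1, hM⟩ := key_growth hC.le (by linarith : (A + 1) / 4 < 1)
  obtain ⟨m, hm⟩ := exists_nat_gt M
  have hm1 : (1 : ℝ) < m := lt_of_le_of_lt hM1 hm
  have hm0 : 0 < m := by exact_mod_cast (zero_lt_one.trans hm1)
  have key := h ![1, 1, 1, 1] ![1, 1, 1, 1] ![1, 1, 1, m]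
    (by intro i; fin_cases i <;> simp [hm0]) (by simp [Fin.prod_univ_four])
  simp [Fin.prod_univ_four] at key
  -- key : (m:ℝ) ^ 4 < C * (m:ℝ) ^ (A + 1)
  have hmm : (m : ℝ) ≤ (m : ℝ) ^ 4 := by exact_mod_cast Nat.le_self_pow (by norm_num : 4 ≠ 0) m
  have hb := hM ((m : ℝ) ^ 4) (by linarith [hm.le])
  rw [pow_four_rpow (by positivity)] at hb
  linarith

/-! ## (a') Coprimality: NOT load-bearing for `∃ A < 2` (heuristically; `ABC ⟹` the non-coprime
version for every `A > 5/3`), but it moves the floor of the dial from `1` to `4/3`. -/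

/-- Level-4 tower inequality WITHOUT the coprimality hypothesis. -/
def TowerIneq4NoCoprime (A : ℝ) : Prop :=
  ∀ ε : ℝ, 0 < ε → ∃ C : ℝ, 0 < C ∧ ∀ x y z : Fin 4 → ℕ, (∀ i, 0 < x i ∧ 0 < y i ∧ 0 < z i) →
    (∏ i, x i ^ (i.val + 1)) + (∏ i, y i ^ (i.val + 1)) = ∏ i, z i ^ (i.val + 1) →
    ((∏ i, z i ^ (i.val + 1) : ℕ) : ℝ) < C * ((∏ i, x i * y i * z i : ℕ) : ℝ) ^ (A + ε)

/-- Without coprimality the dial cannot go below `4/3`: `2^{4k} + 2^{4k} = 2·2^{4k}` with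
`x = y = (1,1,1,2^k)`, `z = (2,1,1,2^k)` has `Π = 2·2^{3k}` and `c = 2·2^{4k} ≍ Π^{4/3}`. -/
theorem towerIneq4NoCoprime_false_below_four_thirds (A : ℝ) (hA : A < 4 / 3) :
    ¬ TowerIneq4NoCoprime A := by
  intro h
  have hmax : max A 0 < 4 / 3 := max_lt hA (by norm_num)
  have hA0 : A ≤ max A 0 := le_max_left _ _
  have h0 : 0 ≤ max A 0 := le_max_right _ _
  set s : ℝ := (max A 0 + 4 / 3) / 2 with hs
  have hsA : A < s := by rw [hs]; linarith
  have hs43 : s < 4 / 3 := by rw [hs]; linarith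
  have hs0 : 0 < s := by rw [hs]; linarith
  obtain ⟨C, hC, h⟩ := h (s - A) (by linarith)
  obtain ⟨M, hM1, hM⟩ := key_growth (K := 4 * C) (by positivity) (by linarith : 3 * s / 4 < 1)
  obtain ⟨k, hk⟩ := exists_nat_gt M
  have key := h ![1, 1, 1, 2 ^ k] ![1, 1, 1, 2 ^ k] ![2, 1, 1, 2 ^ k]
    (by intro i; fin_cases i <;> simp) (by simp [Fin.prod_univ_four]; ring)
  simp [Fin.prod_univ_four] at key
  -- key : 2 * (2 ^ k) ^ 4 < C * (2 * (2 ^ k * 2 ^ k * 2 ^ k)) ^ s     (in ℝ)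
  set t : ℝ := 2 ^ k with ht
  have ht1 : (1 : ℝ) ≤ t := one_le_pow₀ (by norm_num)
  have ht0 : (0 : ℝ) ≤ t := by linarith
  have hkt : (k : ℝ) < t := by rw [ht]; exact_mod_cast Nat.lt_two_pow_self
  have htt : t ≤ t ^ 4 := by
    have := Nat.le_self_pow (by norm_num : 4 ≠ 0) (2 ^ k)
    have : ((2 ^ k : ℕ) : ℝ) ≤ ((2 ^ k : ℕ) : ℝ) ^ 4 := by exact_mod_cast this
    push_cast at this; rw [ht]; exact this
  have hb := hM (t ^ 4) (by linarith [hk.le])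
  -- hb : 4 * C * (t ^ 4) ^ (3 * s / 4) ≤ t ^ 4
  have h2s : (2 : ℝ) ^ s ≤ 4 := by
    calc (2 : ℝ) ^ s ≤ (2 : ℝ) ^ (2 : ℝ) :=
          Real.rpow_le_rpow_of_exponent_le (by norm_num) (by linarith)
      _ = 4 := by norm_num
  have h3 : (t * t * t) ^ s = (t ^ 4) ^ (3 * s / 4) := by
    rw [show t * t * t = t ^ 3 by ring, pow_three_rpow ht0, show 3 * s / 4 = (3 * s) / 4 by ring,
      pow_four_rpow ht0]
  have h4 : C * (2 * (t * t * t)) ^ s ≤ 4 * C * (t ^ 4) ^ (3 * s / 4) := by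
    rw [Real.mul_rpow (by norm_num) (by positivity), h3]
    have hnn : (0 : ℝ) ≤ (t ^ 4) ^ (3 * s / 4) := Real.rpow_nonneg (by positivity) _
    calc C * ((2 : ℝ) ^ s * (t ^ 4) ^ (3 * s / 4)) = (2 : ℝ) ^ s * (C * (t ^ 4) ^ (3 * s / 4)) := by ring
      _ ≤ 4 * (C * (t ^ 4) ^ (3 * s / 4)) :=
          mul_le_mul_of_nonneg_right h2s (mul_nonneg hC.le hnn)
      _ = 4 * C * (t ^ 4) ^ (3 * s / 4) := by ring
  have ht4 : (0 : ℝ) < t ^ 4 := by positivity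
  linarith

/-- Core of "coprimality is not load-bearing": from abc with exponent `1 + e` one gets, for ANY
positive `a + b = c` (not necessarily coprime) and any `P` with `abc ≤ P⁴` and `rad(abc) ∣ P`,
the bound `c³ < 2K · P^{5+e}` — write `g = gcd(a,b)`, `c = g c'`: `g³c'² ≤ 2abc ≤ 2P⁴` and
`c' < K rad(a'b'c')^{1+e} ≤ K P^{1+e}`. -/
theorem cube_lt_of_abc {K e : ℝ} (he : 0 ≤ e)
    (hK' : ∀ a b c : ℕ, IsABCTriple a b c → (c : ℝ) < K * (rad a b c : ℝ) ^ (1 + e))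
    {a b c P : ℕ} (ha : 0 < a) (hb : 0 < b) (hc : a + b = c) (hP0 : 0 < P)
    (hP : a * b * c ≤ P ^ 4) (hrad : UniqueFactorizationMonoid.radical (a * b * c) ∣ P) :
    (c : ℝ) ^ 3 < 2 * K * (P : ℝ) ^ (5 + e) := by
  set g := Nat.gcd a b with hg
  have hg0 : 0 < g := Nat.gcd_pos_of_pos_left _ ha
  obtain ⟨a', ha'⟩ : ∃ a', a = g * a' := Nat.gcd_dvd_left a b
  obtain ⟨b', hb'⟩ : ∃ b', b = g * b' := Nat.gcd_dvd_right a b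
  have ha'0 : 0 < a' := by
    rcases Nat.eq_zero_or_pos a' with h0 | h0
    · rw [h0, mul_zero] at ha'; omega
    · exact h0
  have hb'0 : 0 < b' := by
    rcases Nat.eq_zero_or_pos b' with h0 | h0
    · rw [h0, mul_zero] at hb'; omega
    · exact h0
  have hcop : Nat.Coprime a' b' := by
    have h1 : a' = a / g := by rw [ha', Nat.mul_div_cancel_left _ hg0]
    have h2 : b' = b / g := by rw [hb', Nat.mul_div_cancel_left _ hg0]
    rw [h1, h2]; exact Nat.coprime_div_gcd_div_gcd hg0
  have hc' : c = g * (a' + b') := by rw [← hc, ha', hb']; ring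
  -- abc for the primitive triple
  have htriple : IsABCTriple a' b' (a' + b') := ⟨ha'0, hb'0, rfl, hcop⟩
  have hlt := hK' _ _ _ htriple
  -- rad(a'b'c') ∣ rad(abc) ∣ P
  have hc0 : 0 < c := hc ▸ Nat.add_pos_left ha b
  have habc0 : a * b * c ≠ 0 := (Nat.mul_pos (Nat.mul_pos ha hb) hc0).ne'
  have hdvd' : a' * b' * (a' + b') ∣ a * b * c :=
    mul_dvd_mul (mul_dvd_mul (Dvd.intro_left _ ha'.symm) (Dvd.intro_left _ hb'.symm))
      (Dvd.intro_left _ hc'.symm)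
  have hradle : (rad a' b' (a' + b') : ℝ) ≤ P := by
    have h1 : rad a' b' (a' + b') ∣ P := by
      rw [rad_def]
      exact (UniqueFactorizationMonoid.radical_dvd_radical hdvd' habc0).trans hrad
    exact_mod_cast Nat.le_of_dvd hP0 h1
  have hKpos : 0 < K := by
    -- from hlt at the triple: 0 < c' < K * rad^(1+e), rad^(1+e) > 0
    have hr : (0 : ℝ) < (rad a' b' (a' + b') : ℝ) ^ (1 + e) := by
      apply Real.rpow_pos_of_pos
      rw [rad_def]; exact_mod_cast Nat.radical_pos _
    have hcpos : (0 : ℝ) < ((a' + b' : ℕ) : ℝ) := by positivity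
    by_contra hK
    have hK0 : K ≤ 0 := not_lt.mp hK
    have : K * (rad a' b' (a' + b') : ℝ) ^ (1 + e) ≤ 0 := mul_nonpos_of_nonpos_of_nonneg hK0 hr.le
    linarith
  have hc'lt : ((a' + b' : ℕ) : ℝ) < K * (P : ℝ) ^ (1 + e) := by
    calc ((a' + b' : ℕ) : ℝ) < K * (rad a' b' (a' + b') : ℝ) ^ (1 + e) := hlt
      _ ≤ K * (P : ℝ) ^ (1 + e) := by
          apply mul_le_mul_of_nonneg_left _ hKpos.le
          exact Real.rpow_le_rpow (by positivity) hradle (by linarith)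
  -- g³ c'² ≤ 2 abc ≤ 2 P⁴  (in ℝ)
  have hineq : ((g : ℝ) ^ 3 * ((a' + b' : ℕ) : ℝ) ^ 2) ≤ 2 * (P : ℝ) ^ 4 := by
    have h1 : ((a' + b' : ℕ) : ℝ) ≤ 2 * (a' : ℝ) * b' := by
      have : (1 : ℝ) ≤ a' := by exact_mod_cast ha'0
      have : (1 : ℝ) ≤ b' := by exact_mod_cast hb'0
      push_cast; nlinarith
    have h2 : (a : ℝ) * b * c ≤ (P : ℝ) ^ 4 := by exact_mod_cast hP
    have h3 : (a : ℝ) * b * c = (g : ℝ) ^ 3 * ((a' : ℝ) * b' * ((a' + b' : ℕ) : ℝ)) := by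
      rw [ha', hb', hc']; push_cast; ring
    have hg' : (0 : ℝ) ≤ (g : ℝ) ^ 3 := by positivity
    have hcn : (0 : ℝ) ≤ ((a' + b' : ℕ) : ℝ) := by positivity
    calc (g : ℝ) ^ 3 * ((a' + b' : ℕ) : ℝ) ^ 2 = (g : ℝ) ^ 3 * (((a' + b' : ℕ) : ℝ) * ((a' + b' : ℕ) : ℝ)) := by ring
      _ ≤ (g : ℝ) ^ 3 * ((2 * (a' : ℝ) * b') * ((a' + b' : ℕ) : ℝ)) := by
          apply mul_le_mul_of_nonneg_left _ hg'
          exact mul_le_mul_of_nonneg_right h1 hcn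
      _ = 2 * ((a : ℝ) * b * c) := by rw [h3]; ring
      _ ≤ 2 * (P : ℝ) ^ 4 := by linarith
  -- conclude
  have hP0' : (0 : ℝ) < (P : ℝ) := by exact_mod_cast hP0
  have hsplit : (P : ℝ) ^ (5 + e) = (P : ℝ) ^ 4 * (P : ℝ) ^ (1 + e) := by
    rw [show (5 + e) = (4 : ℝ) + (1 + e) by ring, Real.rpow_add hP0']
    congr 1
    rw [← Real.rpow_natCast]; norm_num
  have hcn : (0 : ℝ) ≤ ((a' + b' : ℕ) : ℝ) := by positivity
  have hgc : (c : ℝ) = (g : ℝ) * ((a' + b' : ℕ) : ℝ) := by rw [hc']; push_cast; ring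
  calc (c : ℝ) ^ 3 = ((g : ℝ) ^ 3 * ((a' + b' : ℕ) : ℝ) ^ 2) * ((a' + b' : ℕ) : ℝ) := by rw [hgc]; ring
    _ ≤ (2 * (P : ℝ) ^ 4) * ((a' + b' : ℕ) : ℝ) := mul_le_mul_of_nonneg_right hineq hcn
    _ < (2 * (P : ℝ) ^ 4) * (K * (P : ℝ) ^ (1 + e)) := by
        apply mul_lt_mul_of_pos_left hc'lt; positivity
    _ = 2 * K * (P : ℝ) ^ (5 + e) := by rw [hsplit]; ring

/-- `abc ≤ P⁴` for a level-4 tower point (`(xᵢyᵢzᵢ)^{i+1} ≤ (xᵢyᵢzᵢ)⁴`). -/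
theorem abc_le_towerProd_pow_four (x y z : Fin 4 → ℕ) (hpos : ∀ i, 0 < x i ∧ 0 < y i ∧ 0 < z i) :
    (∏ i, x i ^ (i.val + 1)) * (∏ i, y i ^ (i.val + 1)) * (∏ i, z i ^ (i.val + 1)) ≤
      (∏ i, x i * y i * z i) ^ 4 := by
  have hprod : (∏ i, x i ^ (i.val + 1)) * (∏ i, y i ^ (i.val + 1)) * (∏ i, z i ^ (i.val + 1)) =
      ∏ i, (x i * y i * z i) ^ (i.val + 1) := by
    rw [← Finset.prod_mul_distrib, ← Finset.prod_mul_distrib]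
    refine Finset.prod_congr rfl fun i _ => ?_
    ring
  rw [hprod, ← Finset.prod_pow]
  apply Finset.prod_le_prod (fun i _ => by positivity) fun i _ => ?_
  apply Nat.pow_le_pow_right
  · exact Nat.mul_pos (Nat.mul_pos (hpos i).1 (hpos i).2.1) (hpos i).2.2
  · have := i.isLt; omega

/-- **Coprimality is not load-bearing (conditionally).** `ABC ⟹ TowerIneq4NoCoprime A` for every
`A > 5/3`: with `K = C_abc(3A − 5)`, `cube_lt_of_abc` gives `c³ < 2K·Π^{3A}`, and `(K+1)³ ≥ 2K`,
`Π ≥ 1` give `c < (K+1)·Π^{A+ε}`.  Together with `towerIneq4NoCoprime_false_below_four_thirds`: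
under `ABC` the non-coprime dial lies in `[4/3, 5/3]`, the coprime one is exactly `1`; the crux's
threshold `2` is above both, so nothing forces a proof of the crux to use coprimality. -/
theorem towerIneq4NoCoprime_of_abc (habc : ABC) (A : ℝ) (hA : 5 / 3 < A) : TowerIneq4NoCoprime A := by
  intro ε hε
  obtain ⟨K, hK, hK'⟩ := (ABC_iff.mp habc) (3 * A - 5) (by linarith)
  refine ⟨K + 1, by linarith, fun x y z hpos heq => ?_⟩
  have ha : 0 < ∏ i, x i ^ (i.val + 1) := Finset.prod_pos fun i _ => pow_pos (hpos i).1 _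
  have hb : 0 < ∏ i, y i ^ (i.val + 1) := Finset.prod_pos fun i _ => pow_pos (hpos i).2.1 _
  have hP0 : 0 < ∏ i, x i * y i * z i :=
    Finset.prod_pos fun i _ => Nat.mul_pos (Nat.mul_pos (hpos i).1 (hpos i).2.1) (hpos i).2.2
  have hcube := cube_lt_of_abc (e := 3 * A - 5) (by linarith) hK' ha hb heq hP0
    (abc_le_towerProd_pow_four x y z hpos) (by have := rad_dvd_towerProd x y z; rwa [rad_def] at this)
  have hP1 : (1 : ℝ) ≤ ((∏ i, x i * y i * z i : ℕ) : ℝ) := by exact_mod_cast hP0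
  set P : ℝ := ((∏ i, x i * y i * z i : ℕ) : ℝ) with hPdef
  refine lt_of_pow_lt_pow_left₀ 3 (by positivity) ?_
  calc ((∏ i, z i ^ (i.val + 1) : ℕ) : ℝ) ^ 3 < 2 * K * P ^ (5 + (3 * A - 5)) := hcube
    _ ≤ (K + 1) ^ 3 * P ^ (3 * (A + ε)) := by
        have h1 : 2 * K ≤ (K + 1) ^ 3 := by
          nlinarith [sq_nonneg K, mul_nonneg (mul_nonneg hK.le hK.le) hK.le]
        have h2 : P ^ (5 + (3 * A - 5)) ≤ P ^ (3 * (A + ε)) :=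
          Real.rpow_le_rpow_of_exponent_le hP1 (by linarith)
        have h3 : (0 : ℝ) ≤ P ^ (5 + (3 * A - 5)) := Real.rpow_nonneg (by linarith) _
        calc 2 * K * P ^ (5 + (3 * A - 5)) ≤ (K + 1) ^ 3 * P ^ (5 + (3 * A - 5)) :=
              mul_le_mul_of_nonneg_right h1 h3
          _ ≤ (K + 1) ^ 3 * P ^ (3 * (A + ε)) := mul_le_mul_of_nonneg_left h2 (by positivity)
    _ = ((K + 1) * P ^ (A + ε)) ^ 3 := by
        rw [mul_pow, show (3 : ℝ) * (A + ε) = (A + ε) * 3 by ring, Real.rpow_mul (by linarith),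
          show ((P ^ (A + ε)) ^ (3 : ℝ)) = (P ^ (A + ε)) ^ (3 : ℕ) by rw [← Real.rpow_natCast]; norm_num]

/-! ## (b) Tightness: the dial cannot go below `1`, and `ε` cannot be dropped at `A = 1`
(Pell families, embedded from level 2: `X_2 ↪ X_4`). -/

/-- `1 < 2` in `ℕ`, the parameter `a1` of Mathlib's `Pell.xn`/`Pell.yn` with `a = 2` (`d = 3`). -/
theorem one_lt_two' : (1 : ℕ) < 2 := by norm_num

/-- Mathlib's Pell sequences for `a = 2` solve `x² − 3y² = 1`. -/
theorem pell3 (n : ℕ) : Pell.xn one_lt_two' n ^ 2 = 3 * Pell.yn one_lt_two' n ^ 2 + 1 := by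
  have h := Pell.pell_eqz one_lt_two' n
  rw [Pell.dz_val] at h
  have h' : (Pell.xn one_lt_two' n : ℤ) ^ 2 = 3 * (Pell.yn one_lt_two' n : ℤ) ^ 2 + 1 := by
    simp only [Pell.xz, Pell.yz, Pell.az] at h; push_cast at h; linarith
  exact_mod_cast h'

/-- `yₙ ≤ xₙ` for the `d = 3` Pell sequences. -/
theorem pell3_y_le_x (n : ℕ) : Pell.yn one_lt_two' n ≤ Pell.xn one_lt_two' n := by
  have h := pell3 n
  have : Pell.yn one_lt_two' n ^ 2 ≤ Pell.xn one_lt_two' n ^ 2 := by rw [h]; nlinarith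
  exact (Nat.pow_le_pow_iff_left (by norm_num)).mp this

/-- **The dial cannot go below 1.** For every `A < 1`, `TowerIneq4 A` fails: the Pell family
`1 + 3v² = u²` (`x = (1,1,1,1)`, `y = (3,v,1,1)`, `z = (1,u,1,1)`) has `c = u²` and
`Π = 3uv ≤ 3u² = 3c`, so `c < C Π^{s}` with `s < 1` fails for large `u`. -/
theorem towerIneq4_false_below_one (A : ℝ) (hA : A < 1) : ¬ TowerIneq4 A := by
  intro h
  have hmax : max A 0 < 1 := max_lt hA one_pos
  have hA0 : A ≤ max A 0 := le_max_left _ _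
  have h0 : 0 ≤ max A 0 := le_max_right _ _
  set s : ℝ := (max A 0 + 1) / 2 with hs
  have hsA : A < s := by rw [hs]; linarith
  have hs1 : s < 1 := by rw [hs]; linarith
  have hs0 : 0 < s := by rw [hs]; linarith
  obtain ⟨C, hC, h⟩ := h (s - A) (by linarith)
  obtain ⟨M, hM1, hM⟩ := key_growth (K := 3 * C) (by positivity) hs1
  obtain ⟨n, hn⟩ := exists_nat_gt M
  have hn0 : 0 < n := by exact_mod_cast (lt_of_lt_of_le zero_lt_one hM1).trans hn
  obtain ⟨u, hu⟩ : ∃ u, Pell.xn one_lt_two' n = u := ⟨_, rfl⟩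
  obtain ⟨v, hv⟩ : ∃ v, Pell.yn one_lt_two' n = v := ⟨_, rfl⟩
  have hnu : n < u := hu ▸ Pell.n_lt_xn one_lt_two' n
  have hu0 : 0 < u := lt_trans hn0 hnu
  have hv0 : 0 < v := hv ▸ lt_of_lt_of_le hn0 (Pell.yn_ge_n one_lt_two' n)
  have hvu : v ≤ u := hu ▸ hv ▸ pell3_y_le_x n
  have heq : 1 + 3 * v ^ 2 = u ^ 2 := by rw [← hu, ← hv, pell3 n]; ring
  have key := h ![1, 1, 1, 1] ![3, v, 1, 1] ![1, u, 1, 1]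
    (by intro i; fin_cases i <;> simp [hu0, hv0]) (by simp [Fin.prod_univ_four]; omega)
    (by simp [Fin.prod_univ_four])
  simp [Fin.prod_univ_four] at key
  -- key : (u:ℝ) ^ 2 < C * (3 * (v * u)) ^ s
  have hu1 : (1 : ℝ) ≤ u := by exact_mod_cast hu0
  have huR : (0 : ℝ) ≤ u := by positivity
  have hvuR : (v : ℝ) ≤ u := by exact_mod_cast hvu
  have hvR : (0 : ℝ) ≤ v := by positivity
  have hT : M ≤ (u : ℝ) ^ 2 := by
    have h1 : (n : ℝ) < u := by exact_mod_cast hnu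
    have h2 : (u : ℝ) ≤ (u : ℝ) ^ 2 := by nlinarith
    linarith
  have hb := hM ((u : ℝ) ^ 2) hT
  -- hb : 3 * C * (u ^ 2) ^ s ≤ u ^ 2
  have h3s : (3 : ℝ) ^ s ≤ 3 := by
    calc (3 : ℝ) ^ s ≤ (3 : ℝ) ^ (1 : ℝ) := Real.rpow_le_rpow_of_exponent_le (by norm_num) hs1.le
      _ = 3 := Real.rpow_one _
  have h4 : C * (3 * ((v : ℝ) * u)) ^ s ≤ 3 * C * ((u : ℝ) ^ 2) ^ s := by
    have hmono : (3 * ((v : ℝ) * u)) ^ s ≤ (3 * ((u : ℝ) ^ 2)) ^ s :=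
      Real.rpow_le_rpow (by positivity) (by nlinarith) hs0.le
    have hsplit : (3 * ((u : ℝ) ^ 2)) ^ s = (3 : ℝ) ^ s * ((u : ℝ) ^ 2) ^ s :=
      Real.mul_rpow (by norm_num) (by positivity)
    rw [hsplit] at hmono
    have hnn : (0 : ℝ) ≤ ((u : ℝ) ^ 2) ^ s := Real.rpow_nonneg (by positivity) _
    calc C * (3 * ((v : ℝ) * u)) ^ s ≤ C * ((3 : ℝ) ^ s * ((u : ℝ) ^ 2) ^ s) :=
          mul_le_mul_of_nonneg_left hmono hC.le
      _ = (3 : ℝ) ^ s * (C * ((u : ℝ) ^ 2) ^ s) := by ring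
      _ ≤ 3 * (C * ((u : ℝ) ^ 2) ^ s) := mul_le_mul_of_nonneg_right h3s (mul_nonneg hC.le hnn)
      _ = 3 * C * ((u : ℝ) ^ 2) ^ s := by ring
  linarith

/-- `TowerIneq(4, 1)` with `ε = 0`, i.e. a single constant: `c < C · Π`. -/
def TowerIneq4OneNoEps : Prop :=
  ∃ C : ℝ, 0 < C ∧ ∀ x y z : Fin 4 → ℕ, (∀ i, 0 < x i ∧ 0 < y i ∧ 0 < z i) →
    (∏ i, x i ^ (i.val + 1)) + (∏ i, y i ^ (i.val + 1)) = ∏ i, z i ^ (i.val + 1) →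
    Nat.Coprime (∏ i, x i ^ (i.val + 1)) (∏ i, y i ^ (i.val + 1)) →
    ((∏ i, z i ^ (i.val + 1) : ℕ) : ℝ) < C * ((∏ i, x i * y i * z i : ℕ) : ℝ)

/-- **`ε` cannot be dropped at `A = 1`** (tower analogue of `EpsilonCannotBeDropped`): with
`w = y_N`, `m = N·w`, Matiyasevich's `w² ∣ y_m` (`Pell.ysq_dvd_yy`) writes `v = y_m = w²t`, and the
point `x = (1,1,1,1)`, `y = (3,t,1,w)`, `z = (1,u,1,1)` (`u = x_m`) has `b = 3t²w⁴ = 3v²`, `c = u²`,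
`Π = 3tuw = 3uv/w ≤ 3c/N`; so `c < CΠ` fails once `N > 3C`. -/
theorem not_towerIneq4OneNoEps : ¬ TowerIneq4OneNoEps := by
  rintro ⟨C, hC, h⟩
  obtain ⟨n, hn⟩ := exists_nat_gt (3 * C)
  obtain ⟨w, hw⟩ : ∃ w, Pell.yn one_lt_two' (n + 1) = w := ⟨_, rfl⟩
  have hwN : n + 1 ≤ w := hw ▸ Pell.yn_ge_n one_lt_two' (n + 1)
  have hw0 : 0 < w := lt_of_lt_of_le (Nat.succ_pos n) hwN
  obtain ⟨u, hu⟩ : ∃ u, Pell.xn one_lt_two' ((n + 1) * w) = u := ⟨_, rfl⟩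
  obtain ⟨v, hv⟩ : ∃ v, Pell.yn one_lt_two' ((n + 1) * w) = v := ⟨_, rfl⟩
  have hm0 : 0 < (n + 1) * w := Nat.mul_pos (Nat.succ_pos n) hw0
  have hv0 : 0 < v := hv ▸ lt_of_lt_of_le hm0 (Pell.yn_ge_n one_lt_two' _)
  have hu0 : 0 < u := hu ▸ Pell.x_pos one_lt_two' _
  have hvu : v ≤ u := hu ▸ hv ▸ pell3_y_le_x _
  have heq : 1 + 3 * v ^ 2 = u ^ 2 := by rw [← hu, ← hv, pell3]; ring
  have hdvd : w * w ∣ v := by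
    have := Pell.ysq_dvd_yy one_lt_two' (n + 1)
    rwa [hw, hv] at this
  obtain ⟨t, ht⟩ := hdvd
  have ht0 : 0 < t := by
    rcases Nat.eq_zero_or_pos t with h0 | h0
    · rw [h0, mul_zero] at ht; omega
    · exact h0
  have key := h ![1, 1, 1, 1] ![3, t, 1, w] ![1, u, 1, 1]
    (by intro i; fin_cases i <;> simp [hu0, hw0, ht0])
    (by simp [Fin.prod_univ_four]; rw [← heq, ht]; ring)
    (by simp [Fin.prod_univ_four])
  simp [Fin.prod_univ_four] at key
  -- key : (u:ℝ) ^ 2 < C * (3 * (t * u) * w)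
  have h1 : 3 * C * ((t : ℝ) * w) ≤ (u : ℝ) := by
    have htw : (0 : ℝ) ≤ (t : ℝ) * w := by positivity
    have hN' : 3 * C ≤ ((n + 1 : ℕ) : ℝ) := by push_cast; linarith
    have hwN' : ((n + 1 : ℕ) : ℝ) ≤ w := by exact_mod_cast hwN
    have hvu' : (v : ℝ) ≤ u := by exact_mod_cast hvu
    have hv' : (v : ℝ) = w * w * t := by exact_mod_cast ht
    calc 3 * C * ((t : ℝ) * w) ≤ ((n + 1 : ℕ) : ℝ) * ((t : ℝ) * w) := mul_le_mul_of_nonneg_right hN' htw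
      _ ≤ w * ((t : ℝ) * w) := mul_le_mul_of_nonneg_right hwN' htw
      _ = v := by rw [hv']; ring
      _ ≤ u := hvu'
  have h2 : C * (3 * ((t : ℝ) * u) * w) ≤ (u : ℝ) ^ 2 := by
    have hu' : (0 : ℝ) ≤ u := by positivity
    calc C * (3 * ((t : ℝ) * u) * w) = (3 * C * ((t : ℝ) * w)) * u := by ring
      _ ≤ u * u := mul_le_mul_of_nonneg_right h1 hu'
      _ = (u : ℝ) ^ 2 := by ring
  linarith


/-! ## (c) Constants: with `C = 1` the exponent must exceed `1.3` -/

/-- The record small point: `1 + 4374 = 4375` (`4374 = 2·3⁷`, `4375 = 5⁴·7`), lifted minimally as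
`x = (1,1,1,1)`, `y = (2,1,3,3)` (`2·1²·3³·3⁴ = 4374`), `z = (7,1,1,5)` (`7·5⁴ = 4375`): `Π = 630`,
tower quality `log 4375 / log 630 = 1.30066`, and `630^{13/10} < 4375` (`630¹³ < 4375¹⁰`). -/
theorem quality_point_4375 :
    ∃ x y z : Fin 4 → ℕ, (∀ i, 0 < x i ∧ 0 < y i ∧ 0 < z i) ∧
      (∏ i, x i ^ (i.val + 1)) + (∏ i, y i ^ (i.val + 1)) = ∏ i, z i ^ (i.val + 1) ∧
      Nat.Coprime (∏ i, x i ^ (i.val + 1)) (∏ i, y i ^ (i.val + 1)) ∧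
      ((∏ i, z i ^ (i.val + 1) : ℕ) : ℝ) = 4375 ∧ ((∏ i, x i * y i * z i : ℕ) : ℝ) = 630 ∧
      ((∏ i, x i * y i * z i : ℕ) : ℝ) ^ ((13:ℝ) / 10) < ((∏ i, z i ^ (i.val + 1) : ℕ) : ℝ) := by
  refine ⟨![1, 1, 1, 1], ![2, 1, 3, 3], ![7, 1, 1, 5], ?_, by decide, by decide, ?_, ?_, ?_⟩
  · intro i; fin_cases i <;> simp
  · simp [Fin.prod_univ_four]
  · simp [Fin.prod_univ_four]
  · simp [Fin.prod_univ_four]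
    norm_num
    -- goal: (630:ℝ) ^ (13/10) < 4375
    refine lt_of_pow_lt_pow_left₀ 10 (by norm_num) ?_
    rw [← Real.rpow_natCast, ← Real.rpow_mul (by norm_num)]
    norm_num

/-- Hence `TowerIneq(4, ·)` with constant `C = 1` needs exponent `> 13/10`: the shape
`c < 1 · Π^{13/10}` fails at the point above. -/
theorem not_towerIneq4_constant_one_exponent_13_10 :
    ¬ ∀ x y z : Fin 4 → ℕ, (∀ i, 0 < x i ∧ 0 < y i ∧ 0 < z i) →
      (∏ i, x i ^ (i.val + 1)) + (∏ i, y i ^ (i.val + 1)) = ∏ i, z i ^ (i.val + 1) →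
      Nat.Coprime (∏ i, x i ^ (i.val + 1)) (∏ i, y i ^ (i.val + 1)) →
      ((∏ i, z i ^ (i.val + 1) : ℕ) : ℝ) < 1 * ((∏ i, x i * y i * z i : ℕ) : ℝ) ^ ((13:ℝ) / 10) := by
  intro h
  obtain ⟨x, y, z, hpos, heq, hcop, -, -, hlt⟩ := quality_point_4375
  have := h x y z hpos heq hcop
  linarith

/-! ## Cycle 2 (refuter-cdisprove-stmt-ABC-1649-g2-0; v22: the inlined copies of `Negative.NoCoprimeSharp` (p80795) and `Negative.LogLoss` (p80878) are replaced by IMPORTS + restatements): the non-coprime dial is EXACTLY `4/3` under `ABC`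

Sharpens `towerIneq4NoCoprime_of_abc` (`A > 5/3`) to the optimal `A ≥ 4/3`; LANDED in the tree as
`Summits/ABC/ABC/Theorems/TowerFourSubLiouville/Negative/NoCoprimeSharp.lean` (p80795, importable).  The proof is local: for a positive
tower point `a ∣ X⁴`, `b ∣ Y⁴`, `c ∣ Z⁴` (`X = ∏ xᵢ`, …, exponents `i+1 ≤ 4`) and ANY common factorisation
`a = g a'`, `b = g b'`, `c = g c'` one has `g³ · rad(a'b'c')³ ∣ (XYZ)⁴` (`cube_mul_radical_cube_dvd`: at a prime
`p` with `m = v_p(g)`, `4 v_p(X) ≥ m + v_p(a')` etc., and the ceilings give `4(v_pX + v_pY + v_pZ) ≥ 3m + 3·[p ∣ a'b'c']`,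
`valuation_arith`); then abc on the primitive triple gives `c³ = g³c'³ < K³ (g³R³) R^{3e} ≤ K³ Π^{4+3e}`. -/

section cycle2
open Summit.ABC.ABC.Theorems.TowerFourSubLiouville.Negative

/-- **Cycle 2 (LANDED p80795)**: under `ABC` the non-coprime dial is EXACTLY `4/3` (`TowerIneq4NoCoprime A ↔ 4/3 ≤ A`). -/
example (habc : ABC) (A : ℝ) :=
  Summit.ABC.ABC.Theorems.TowerFourSubLiouville.Negative.towerIneq4NoCoprime_iff_of_abc habc A

end cycle2

/-! ## Cycle 2 (cont.; v22: IMPORTED from `Negative.LogLoss`, p80878): at `A = 1` even a loss `(log c)^A`, `A < 1`, fails (quantitative `ε`-drop)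

LANDED in the tree as `Summits/ABC/ABC/Theorems/TowerFourSubLiouville/Negative/LogLoss.lean` (p80878, importable).  The Pell family of
`not_towerIneq4OneNoEps` made quantitative: `w = y_{N+1} ≥ 3^N`, `m = (N+1)w`, `u = x_m ≤ 4^m`, `v = y_m = w²t`;
the point `x = (1,1,1,1)`, `y = (3,t,1,w)`, `z = (1,u,1,1)` has `c = u²`, `Π = 3tuw ≤ 3c/w`, `log c ≤ 8(N+1)w ≤ 16 w log w`,
so `c/Π ≥ w/3 ≫ log c / log log c`: NO constant `C` gives `c ≤ C·Π·(log c)^A` for a fixed `A < 1`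
(`not_towerIneq4One_logLoss`; tower analogue of `Literature.Barriers.ABC.EpsilonCannotBeDroppedPolylog`, where for abc
EVERY power of `log` fails by Stewart–Tijdeman's pigeonhole).  Left open: the loss `log c` itself (`A = 1`) — the square
part `W² ∣ y_m` of this Lucas sequence is `≲ m`, so Pell-type families gain at most `≍ log c`; high prime powers, which
drive the abc constructions, are discounted only to `p^⌈e/4⌉` by the tower radical `pm`. -/

section cycle2b
open Summit.ABC.ABC.Theorems.TowerFourSubLiouville.Negative

/-- **Cycle 2 (LANDED p80878)**: at `A = 1` no constant gives `c ≤ C·Π·(log c)^A` for a fixed `A < 1` (Pell–Matiyasevich). -/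
example (A : ℝ) (hA : A < 1) :=
  Summit.ABC.ABC.Theorems.TowerFourSubLiouville.Negative.not_towerIneq4One_logLoss A hA

end cycle2b

/-! ## Cycle 3 (refuter-cdisprove-stmt-ABC-1649-g3-0; re-recorded from the LANDED modules): the uniform saving
CEILING `η ≤ 3/2` and the Mason–Stothers FLOOR of identity enemies

After cycle 2 the route produced the line `fourth-radical-binomial-thue`, whose landed stubs `stub_transfer` (p86153),
`stub_fixedFormsRoth` (p85914), converse `stub_cruxGivesUBQ` (p86389) and certificate `towerFourSubLiouville_iff_core`
(p87895) put the crux in THUE COORDINATES: crux ⟺ ∃ `η > 0` such that, off a finite box of coefficient pairs and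
beyond a threshold `Z₀`, every coprime `v Y⁴ ≠ w Z⁴` with `max(v,w) ≤ Z^η` (fourth-power-free `v, w`) has
`|wZ⁴ − vY⁴| > Z^η` (the *uniform binomial quartic saving*, "UBQ η"; exactly the regime isolated by
`bad_point_shape`).  Cycle 3 calibrated this dial from above and recorded why identity-type enemies stall at `1`:

* CEILING (`Negative.UniformSavingCeiling`, p106450).  `not_ubq_of_three_halves_lt`: `UBQ η` fails for every
  `η > 3/2`; `genericFormsSaving_witness_le_three_halves`: so does the matrix of the open stub, for every box `H`.
  Enemy: the explicit degree-2 Padé identity `padeFamily₂`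
  `(35280k²+1)(17640k²+1050k+13)⁴ − (35280k²+3360k+81)(17640k²+630k+3)⁴ = 2000(42k+1)(26460k²+1260k+11)`,
  coprime for every `k`, coefficients `≤ 27 Z`, value `≤ 8000 Z^{3/2}`; and the degree-1 corner `padeFamily₁`
  `(50k²+90k+41)(5k+6)⁴ − (50k²+130k+85)(5k+5)⁴ = 10k + 11` (value `2Z+1` at coefficient height `4Z²`).
  In the two-exponent language (coefficients `≍ Z^θ`, value `≍ Z^φ`; a family kills every `η > max(θ,φ)`):
  `padeFamily₂` sits at `(1, 3/2)`, `padeFamily₁` at `(2, 1)`.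
* FLOOR (`Negative.PolynomialEnemyFloor`, p107305).  `masonStothers_enemy_floor`: a polynomial identity
  `w(t)Z(t)⁴ − v(t)Y(t)⁴ = a(t)` over a field of characteristic `0` (coprime, `Z` non-constant) has
  `deg Z + 1 ≤ max(deg v, deg w, deg a)`, i.e. `θ + φ`-wise `3 deg Z + 1 ≤ deg v + deg Y + deg a`: one-parameter
  POLYNOMIAL families have `η_fam ≥ 1 + 1/z` (`z = deg Z`), with equality exactly for Belyi (three-point) maps.
  So identities can lower the ceiling only degree by degree (`3/2, 4/3, 5/4, …`) and only if the corresponding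
  rigid dessins are defined over `ℚ`; they never reach the probabilistic critical value `η* = 1`
  (heuristic of cycle 3, correcting item 2 of "Why it resists": pairs `(v,w) ≤ Z^η`, residue spread `≍ v^{1/4}w^{3/4}Z³`,
  expected violators at height `Z` number `≍ Z^{2η−3}` — summable iff `η < 1`).
* Census (g3, kit j017963, `mem`-killed at 1548 s but its partial table attached): no rational rigid identity of shape
  `z = 3` found; the symmetric `z = 3` scheme has no real point.  Literature placement: for generic `w/v` at `r = 4`
  no engine gives ANY uniform `η` (per-form Thue–Siegel–Roth; Baker `exp(poly)`; hypergeometric needs anchors; counting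
  results bound numbers, not sizes) — the open stub is a Hall–Lang-type uniform sub-Liouville statement. -/

section cycle3
open Polynomial

example (η : ℝ) (hη : 3 / 2 < η) :
    ¬ ∃ Z₀ : ℕ, ∀ v w Y Z : ℕ, Z₀ ≤ Z → 0 < v → 0 < w → 0 < Y → Nat.Coprime (v * Y) (w * Z) →
      ((max v w : ℕ) : ℝ) ≤ (Z : ℝ) ^ η → w * Z ^ 4 ≠ v * Y ^ 4 →
      (Z : ℝ) ^ η < |((w * Z ^ 4 : ℕ) : ℝ) - ((v * Y ^ 4 : ℕ) : ℝ)| :=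
  Summit.ABC.ABC.Theorems.TowerFourSubLiouville.Negative.not_ubq_of_three_halves_lt η hη

example (η : ℝ) (hη : 3 / 2 < η) (H : ℕ) :
    ¬ ∃ Z₀ : ℕ, ∀ v w Y Z : ℕ, Z₀ ≤ Z → H < max v w → (∀ t : ℕ, t ^ 4 ∣ v → t = 1) →
      (∀ t : ℕ, t ^ 4 ∣ w → t = 1) → 0 < v → 0 < w → 0 < Y → Nat.Coprime (v * Y) (w * Z) →
      ((max v w : ℕ) : ℝ) ≤ (Z : ℝ) ^ η → w * Z ^ 4 ≠ v * Y ^ 4 →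
      (Z : ℝ) ^ η < |((w * Z ^ 4 : ℕ) : ℝ) - ((v * Y ^ 4 : ℕ) : ℝ)| :=
  Summit.ABC.ABC.Theorems.TowerFourSubLiouville.Negative.genericFormsSaving_witness_le_three_halves η hη H

example {k : Type*} [Field k] [DecidableEq k] [CharZero k] {v w a Y Z : k[X]} (hv : v ≠ 0) (hw : w ≠ 0)
    (ha : a ≠ 0) (hY : Y ≠ 0) (hZ : 0 < Z.natDegree) (hcop : IsCoprime (w * Z ^ 4) (v * Y ^ 4))
    (hid : w * Z ^ 4 - v * Y ^ 4 = a) :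
    Z.natDegree + 1 ≤ max (max v.natDegree w.natDegree) a.natDegree :=
  Summit.ABC.ABC.Theorems.TowerFourSubLiouville.Negative.masonStothers_enemy_floor hv hw ha hY hZ hcop hid

end cycle3

/-! ## Cycle 4 (refuter-cdisprove-stmt-ABC-1649-g4-0; re-recorded from the LANDED module and the item's evidence notes):
the TORUS floor `η ≥ 1` and the dessin census

* `Negative.TorusEnemyFloor` (p109688): the floor families of this crux are polynomial–EXPONENTIAL (Pell: Laurent
  polynomials evaluated at powers of a unit).  Such "Pell-boosted" identities clear to `W P⁴ − V Q⁴ = X^j · A` in `k[X]`,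
  and Mason–Stothers with the root `X = 0` counted once gives `min(deg P, deg Q) ≤ max(deg V, deg W, deg A)`
  (`masonStothers_torus_floor`): in the `(θ, φ)` diagram torus identities live on or above `θ + φ = 2`, the probabilistic
  boundary — they could pin the ceiling to `η = 1` (every `η > 1` refuted) but never below.
* Census (g4; kit j018393, rc 0, report attached to the item as `compute-j018393.json` — its table post-dates v12 and
  was not folded into this file by g4; the present seat cannot read another seat's job outputs):
  (b) the MINIMAL torus identity (degree-10 Belyi passport `[4,4,1,1]³`) has 16 dessins (`A₆ ×1`, order-720 `×6`,
  `A₁₀ ×3`, order-320 `×6`); only the `A₆` one is Galois-invariant and its real form is the pointless conic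
  (`r ↦ −2/r̄`) ⇒ no width-1 Pell-boosted family over `ℚ`; width 2 (degree-20 passport) open — the quotient-type
  width-2 passports `[8,1,1]/[4,2,2,1,1]/[4,4,1,1]`: 42 dessins, 16 real-structure solutions, none with rational
  invariants;  (c) ℙ¹, `z = 3`: the `w`-constant `n = 12` shape has no rational member (a `ℚ(√5)` pair and a quartic
  orbit), the `n = 15` shape is populous (field degree `> 8`); the odd-symmetric scheme (source of `padeFamily₂`) is
  unique-and-rational only at `z = 2` (`z = 3`: `(4,3)` no real point, `(3,4)` two real points of degree `> 6`;
  `z = 4`: `(4,5)` none real, `(5,4), (5,5)` real irrational; `z = 5, 6`: real irrational / none real); the rigid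
  `z = 3` passports are populous (Frobenius `Σ 1/|Aut| = 3412, 14339`) with `8` resp. `2` real solutions, all of
  degree `> 6`.  Verdict of cycle 4: ceiling stays `3/2`, identity floor `1` (ℙ¹: `1 + 1/z`), conditional floor `8/13`. -/

section cycle4
open Polynomial

example {k : Type*} [Field k] [DecidableEq k] [CharZero k] {V W A P Q : k[X]} {j : ℕ} (hV : V ≠ 0)
    (hW : W ≠ 0) (hA : A ≠ 0) (hQ : Q ≠ 0) (hP : 0 < P.natDegree)
    (hcop : IsCoprime (W * P ^ 4) (V * Q ^ 4)) (hid : W * P ^ 4 - V * Q ^ 4 = X ^ j * A) :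
    min P.natDegree Q.natDegree ≤ max (max V.natDegree W.natDegree) A.natDegree :=
  Summit.ABC.ABC.Theorems.TowerFourSubLiouville.Negative.masonStothers_torus_floor hV hW hA hQ hP hcop hid

end cycle4

/-! ## Cycle 5 (refuter-cdisprove-stmt-ABC-1649-g5-0, 2026-08-16): per-form dial EXACTLY `2`; the height coupling is
the whole content; NON-RIGID identity families are high-genus curves

### (5a) LANDED `Negative.FixedFormsDirichlet` (p125878)
The two hypotheses of the line not yet tested were `η < 2` in the fixed-form stratum and the height coupling
`max(v,w) ≤ Z^η` of the uniform statement.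
* `fixedForms_false_above_two`: for every real `η > 2` and every box `H ≥ 8` the matrix of `stub_fixedFormsRoth`
  has NO threshold `Z₀` — Dirichlet (`Real.exists_rat_abs_sub_le_and_den_le`) for `ξ = 2^{1/4}` gives reduced `Y/Z`
  with `|2Z⁴ − Y⁴| ≤ 43 Z²`; the forms `(v,w) = (1,2)` (`Y` odd) and `(8,1)` at `(Y/2, Z)` (`Y` even, `Z` odd) absorb
  the parity so the registered coprimality `gcd(vY, wZ) = 1` always holds; `Z → ∞` is forced by the Liouville
  inequality `|ξ − Y/Z| ≥ 1/(43 Z⁴)` (`Y⁴ ≠ 2Z⁴` by `2`-adic parity).  With `not_fixedFormsRoth_without_lt_two`: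
  the stub with `η < 2` dropped is FALSE.  So the per-form dial is EXACTLY `2` (`η < 2` true by Roth, `η > 2` false by
  Dirichlet; `η = 2` itself = bounded partial quotients of `⁴√2`, open and not claimed), the uniform dial `≤ 3/2`:
  uniformity in the coefficients provably costs at least `1/2` — and in `stub_fixedFormsRoth` the hypotheses
  `0 < Y`, coprimality and `max v w ≤ Z^η` are decoration (its own docstring: unused), `η < 2` is the only
  load-bearing one.
* `ubq_false_without_height`: `UBQ η` with the coupling `max(v,w) ≤ Z^η` dropped is false for EVERY `η ≥ 0`
  (Bezout witness `(v,w,Y,Z) = (Z⁴+1, 1, 1, Z)`, value `1`).  Trivial, but it is the formal statement that "uniform in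
  ALL forms" is false for the trivial reason: every saving must be paid for in admissible coefficient height, and the
  crux (via `bad_point_shape`) pays exactly `Z^{O(2−A)}`.

### (5b) Non-rigid identity families (the gap left by the cycle-3/4 census) — numerically closed, negatively; SUPERSEDED and certified by CENSUS-c14.md
Identities `VY⁴ − WZ⁴ = A` over `ℚ` (`deg Y = deg Z = z`) come in families of dimension `d = (3/4)δ_V + δ_A + δ_W/4 − 2z − 1` (Riemann–Hurwitz for
`f = VY⁴/(WZ⁴)`; `d = 0` = Mason–Stothers equality = rigid Belyi maps); best exponent at parameter degree `z` is `η = 1 + 1/z`.  `z = 1`, shape `(2,2,2)`: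
RATIONAL (`hurwitzFamily₁_identity` below; its member `k = −1/2` is `padeFamily₁`).  `z = 2`, shape `(3,3,3)`: the family is an irreducible plane curve
`D(y₂,z₂) = 0` of degree `8`, GENUS `6` (numerical monodromy: 20 finite simple branch points, `[6,2]` at `∞`) — by Faltings finitely many rational
members; the only point of height `≤ 80` is the degenerate `padeFamily₂` `(−21/80, −1/80)`; the tight sub-shape `(3,3,2)` (corner `(3/2,1)`) lives in the
CUBIC field of `u³ + 63u² + 2475u + 17325`.  `z = 3`, shape `(4,4,4)` (`η = 4/3`, would lower the ceiling): genus `≫ 6`, no rational-looking fibre points.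
CONCLUSION for the `(1, 3/2]` window: identity enemies are exhausted as a SYSTEMATIC source (made rigorous mod `p` in § Cycle 14); the ceiling `3/2`
stands; heuristic value of the uniform dial `η* = 1`.  For provers: nothing on the negative side distinguishes `η = 1/100` from `η = 1`.

### (5b') LANDED `Negative.TwoExponentDiagram` (p126734; v2 p126869): the proved part of the `(θ, φ)` map
`UBQ₂(θ, φ)` (coefficients `≤ Z^θ ⟹ |wZ⁴ − vY⁴| > Z^φ`; the core is the diagonal) is FALSE at the four corners
`(3,0)` (`bezoutFamily₃`: `(20s³+130s²+284s+209)(s+1)⁴ = (20s³+50s²+44s+13)(s+2)⁴ + 1`, value EXACTLY `1` at cubic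
height — the `z = 1` tight shape `(3,3,0)`), `(2,1)` (`padeFamily₁`), `(1,3/2)` (`padeFamily₂`), `(0,2)` (Dirichlet), hence
on the union of the four quadrants (`ubq₂_false_of_corner₄`); TRUE on every fixed box below `φ = 2` (Roth) and, under
`ABC`, on `(9/4)θ + φ < 2` (abc on `vY⁴ + k = wZ⁴`; diagonal `η < 8/13`); conjectural boundary `θ + φ = 2`.  All corners
sit on the Mason–Stothers lines `θ + φ = 2 + 1/z`; the missing tight corners `(3/2,1)` (`z = 2`, cubic field, above) and
`(1,4/3)`, `(4/3,1)` (`z = 3`, degree `> 6`) are exactly the irrational dessins of the census.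

### (5c) The Lang–Waldschmidt edge (p111401) is consistent with every identity enemy
`stub_cruxOfLangWaldschmidt` assumes LW₄ in PRODUCT form: `|Σ bᵢ log aᵢ| ≥ C(ε) (∏ aᵢ)^{−1−ε}` (`|bᵢ| ≤ 4`).  On the
vector `b = (−1, 1, −4, 4)` at `a = (v, w, Y, Z)` this reads `|wZ⁴ − vY⁴| ≳ Y³/(wZ)·(vwYZ)^{−ε}`, a uniform ROTH-strength
bound (value exponent `2`, polynomial in the coefficient height) — far stronger than the crux.  It is not refutable by
identities either: for a polynomial family the requirement `deg A + deg W + deg Z < 3 deg Y` is exactly what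
Mason–Stothers forbids (`3 deg Y + 1 ≤ deg W + deg Z + deg A`, `masonStothers_enemy_ineq`), and Belyi-tight families
realise `|Λ| ≍ t · (∏ aᵢ)^{−1}` — the `ε` of LW is used but not beaten (checked on `padeFamily₂`: `v ≈ 2Z`, so LW needs
`|a| ≳ Z^{1−ε}`, and `a ≈ 8000 Z^{3/2}`).  So both typed edges into the crux (`ABC`, LW₄) are abc-strength and mutually
consistent with all enemies in this file; neither is a disproof target.

### (5d) Open edges after cycle 5 — superseded by § (15e)/(16d). -/

section cycle5

example (η : ℝ) (hη : 2 < η) (H : ℕ) (hH : 8 ≤ H) :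
    ¬ ∃ Z₀ : ℕ, ∀ v w Y Z : ℕ, Z₀ ≤ Z → max v w ≤ H → 0 < v → 0 < w → 0 < Y →
      Nat.Coprime (v * Y) (w * Z) → ((max v w : ℕ) : ℝ) ≤ (Z : ℝ) ^ η → w * Z ^ 4 ≠ v * Y ^ 4 →
      (Z : ℝ) ^ η < |((w * Z ^ 4 : ℕ) : ℝ) - ((v * Y ^ 4 : ℕ) : ℝ)| :=
  Summit.ABC.ABC.Theorems.TowerFourSubLiouville.Negative.fixedForms_false_above_two η hη H hH

/-- The landed stub with `η < 2` dropped is false (per-form dial exactly `2`). -/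
example : ¬ ∀ H : ℕ, ∀ η : ℝ, 0 < η → ∃ Z₀ : ℕ, ∀ v w Y Z : ℕ, Z₀ ≤ Z → max v w ≤ H → 0 < v → 0 < w →
      0 < Y → Nat.Coprime (v * Y) (w * Z) → ((max v w : ℕ) : ℝ) ≤ (Z : ℝ) ^ η →
      w * Z ^ 4 ≠ v * Y ^ 4 → (Z : ℝ) ^ η < |((w * Z ^ 4 : ℕ) : ℝ) - ((v * Y ^ 4 : ℕ) : ℝ)| :=
  Summit.ABC.ABC.Theorems.TowerFourSubLiouville.Negative.not_fixedFormsRoth_without_lt_two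

example (η : ℝ) (hη : 0 ≤ η) :
    ¬ ∃ Z₀ : ℕ, ∀ v w Y Z : ℕ, Z₀ ≤ Z → 0 < v → 0 < w → 0 < Y → Nat.Coprime (v * Y) (w * Z) →
      w * Z ^ 4 ≠ v * Y ^ 4 → (Z : ℝ) ^ η < |((w * Z ^ 4 : ℕ) : ℝ) - ((v * Y ^ 4 : ℕ) : ℝ)| :=
  Summit.ABC.ABC.Theorems.TowerFourSubLiouville.Negative.ubq_false_without_height η hη

-- The proved FALSE region of the two-exponent diagram is `Negative.TwoExponentDiagram.ubq₂_false_of_corner₄`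
-- (p126734 / p126869); it is not imported here only because this work file must elaborate on every farm node
-- immediately after that module's rebuild (coherence lag) — import it freely elsewhere.

/-- The fourth corner's identity (`bezoutFamily₃`, shape `(3,3,0)`, value exactly `1` at cubic height), restated. -/
example (s : ℕ) : (20 * s ^ 3 + 130 * s ^ 2 + 284 * s + 209) * (s + 1) ^ 4 =
    (20 * s ^ 3 + 50 * s ^ 2 + 44 * s + 13) * (s + 2) ^ 4 + 1 := by
  ring

/-- **The `z = 1` non-rigid identity family** (shape `(2,2,2)`, `η = 2`): a TWO-parameter polynomial identity;
`k = -1/2` (after doubling) is `padeFamily₁`.  Recorded as the base case of § (5b). -/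
theorem hurwitzFamily₁_identity (k t : ℤ) :
    (t ^ 2 + (4 + 2 * k) * t + (5 + 5 * k)) * t ^ 4 - (t ^ 2 + 2 * k * t - (1 + 3 * k)) * (t + 1) ^ 4 =
      (5 + 10 * k) * t ^ 2 + (4 + 10 * k) * t + (1 + 3 * k) := by
  ring

/-- Its degenerate member (`2·(k = −1/2)`): the corner identity of `padeFamily₁` in closed form. -/
theorem hurwitzFamily₁_corner (t : ℤ) :
    (2 * t ^ 2 - 2 * t + 1) * (t + 1) ^ 4 - (2 * t ^ 2 + 6 * t + 5) * t ^ 4 = 2 * t + 1 := by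
  ring

/-- The `z = 2` boundary check: `padeFamily₂` in the odd-symmetric variable `s` (`Z = P(s)`, `Y = P(−s)`, `w = Q(s)`,
`v = Q(−s)`, `20·P = 20s² − 10s − 4`, `20·Q = 20s² + 40s + 21`), the rational point `(y₂,z₂) = (−21/80, −1/80)` of the
genus-6 curve of § (5b); scaled to integer coefficients (`s = 42k + 1` recovers `padeFamily₂_identity`). -/
theorem padeFamily₂_symmetric_form (s : ℤ) :
    (20 * s ^ 2 - 40 * s + 21) * (20 * s ^ 2 + 10 * s - 4) ^ 4 -
      (20 * s ^ 2 + 40 * s + 21) * (20 * s ^ 2 - 10 * s - 4) ^ 4 =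
      32000 * s * (15 * s ^ 2 - 4) := by
  ring

end cycle5

/-! ## Cycle 6 (refuter-cdisprove-stmt-ABC-1649-g6-0, 2026-08-16): the two free parameters `C`, `ε` and the last
hypothesis (coprimality) settled for the threshold question; the `log c` loss at `A = 1` pushed to the reach of Pell families

### (6a) LANDED `Negative.ConstantFree` (p127459) — the Liouville end with `C = 1`, `ε = 0`; crux ⟺ constant-free form
* `towerPoint_lt_towerProd_sq`: EVERY positive level-4 point (coprime or not) has `c < Π²` strictly — elementary from
  `Π⁴ = abc·E`: `E ≥ 2 ⟹ c = a + b < 2ab ≤ abE` unless `a = b = 1` (then `Π⁴ = 2E` forces `E ≥ 3`); `E = 1 ⟹` the point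
  is `X⁴ + Y⁴ = Z⁴` and `Z < XY` (`X = 1` impossible as `(Y+1)⁴ > Y⁴ + 1`; `X, Y ≥ 2 ⟹ X⁴Y⁴ > X⁴ + Y⁴`) — Fermat for
  `n = 4` is NOT needed (a hypothetical Fermat quadruple would have tower quality `4 log Z / log(XYZ) ∈ (4/3, 2)`).  So
  `Π ≥ 2` on every point (`two_le_towerProd`) and every single tower quality `log c / log Π` is `< 2`; with (c) of cycle 1:
  at `C = 1` the admissible exponents are exactly those `≥ s* := sup tq` (or `> s*`), `1.30066 ≤ s* ≤ 2`.
* `towerFourSubLiouville_constantFree`: crux ⟹ `∃ A < 2, ∀ positive coprime points, c < Π^A` (absorb `C` into `Π^ε`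
  beyond `Π ≥ C^{1/ε}`; the finitely many small points have `c ≤ Π² − 1 < Π^{2−δ}` once `P₀^δ = 1 + (2P₀²)⁻¹`).  With the
  trivial converse `crux_of_constantFree` below: **crux ⟺ `s* < 2`**, the supremum of ONE explicit bounded set of reals
  each `< 2`.  For the disprover this closes the door "refute the `C = 1`, `ε = 0` strengthening instead": it IS the crux.

### (6b) LANDED `Negative.LogLossSharp` (p127558) — at `A = 1`, `log c/(log log c)^B` fails for every `B > 1`
`not_towerIneq4One_logLossLogLog`: no `(C, c₀)` with `c·(log log c)^B ≤ C·Π·log c` on all positive coprime points with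
`c ≥ c₀`.  The Pell–Matiyasevich family (`pell_family_two_pow`, now with `2^m ≤ x_m ≤ 4^m`, `m = (N+1)w`) has gain
`c/Π ≥ w/3` with `w ≤ log c ≤ 3(N+1)w` and `N ≤ log₃ w`, i.e. gain `≍ log c / log log c` EXACTLY; this improves cycle 2's
`(log c)^A`, `A < 1` to the boundary of what Pell/Lucas families can show — `B ≤ 1` (the bare loss `log c`, or
`log c / log log c`) is out of their reach (the square part of `y_m` is `≲ m`).  Heuristic: the number of level-4 points
with `c ~ T` and `Π ≤ T/λ` is `≈ polylog(T)/λ`, so the truth at `A = 1` is plausibly a POLYLOGARITHMIC loss `(log c)^{B₀}`,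
`B₀ ≥ 1` bounded — strictly between the proved floor and anything provable from `ABC` with `ε`.

### (6c) LANDED `Negative.CoprimeDispensable` (p127991) — coprimality is dispensable UNCONDITIONALLY
`towerIneq4NoCoprime_of_towerFourSubLiouville : TowerFourSubLiouville → ∃ A < 2, TowerIneq4NoCoprime A` (no
`Nat.Coprime` hypothesis; same shape as `towerIneq4NoCoprime_false_below_four_thirds`).  With the trivial converse
`crux_of_noCoprime` below: **crux ⟺ its non-coprime form** — the hypothesis `Nat.Coprime a b` can be deleted from the
crux without changing its truth value; cycles 1–2 knew this only under `ABC` (non-coprime dial exactly `4/3`).  Mechanism: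
a bad point (`Π^{2−δ} ≤ c`) has `a·E ≤ 2c^κ` (`bad_point_shape`), so `g = gcd(a,b) ≤ a` is TINY; dividing `g` out keeps
the binomial-quartic shape (`div_quartic_shape`: `g ∣ gcd(vY⁴, vg⁴) = v·gcd(Y,g)⁴`, so `vY⁴ = g·v'Y'⁴` with `v' ≤ vg³`,
`Y' = Y/gcd(Y,g)`; `reduce_to_coprime`); the reduced COPRIME point costs `≤ (aE)^{13}·Π` and has `c' ≥ c/(aE)`, and the
constant-free crux at exponent `t = max(A₀,1) < 2` gives `Π^{(2−δ)(1−27κ) − t} < 2^{27}`, the exponent being `(2−t)/2`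
for `δ = (2−t)/110`: `Π < 2^{54/(2−t)}` on bad points (`bad_point_bounded_of_le`).  Consequence for the disproof side:
NON-coprime families are admissible enemies of the crux as stated — but they reach only `4/3` (`2^{4k} + 2^{4k}`), and
under `ABC` nothing beyond: the window `(4/3, 2)` for non-coprime families is as empty as `(1, 2)` for coprime ones.

### (6d) The ladder at the top of the dial (where known mathematics stops), for ideators
`R0`: `c < √2·Π²` (trivial), `c < Π²` (p127459, elementary).  `R1`: `c = o(Π²)`, i.e. EVERY `C > 0` works at `A = 2`
beyond some `c₀(C)` — Thue–Roth per form (bounded `a, v, w ⟹` bounded `Z`; in-tree via `stub_fixedFormsRoth`),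
ineffective.  `R2`: `c ≤ Π²/(log Π)^{δ₀}` for some absolute `δ₀ > 0`, EFFECTIVE — Baker-type Thue bounds polynomial in
the height of the form (Bugeaud–Győry 1996, `max(Y,Z) ≤ exp(c·H^{6}(log H)^{7}·log a)`; ideator 3's stratum L4).
`R3`: `c ≤ C_B·Π²/(log Π)^B` for EVERY `B` (an arbitrary polylog saving): OPEN — it needs Thue bounds quasi-polynomial
in `log H`, i.e. abc-strength in the coefficient aspect.  `R4`: `c ≤ Π^{2−δ}` for some `δ > 0`: the CRUX.  `R5`:
`c ≤ C_ε·Π^{1+ε}`: `ABC`-strength (`TowerIneq(4,1)`).  Enemies: every known infinite family has tower quality `→ 1`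
(Pell, Dirichlet, identities); the sporadic record is `1.30066`.
Level transfer gives nothing: `TowerIneq(4, A) ⟹ TowerIneq(3, A) ⟹ TowerIneq(2, A)` (embed `x₄ = 1`), while the naive
converse costs a factor `Π` (`x₄⁴ = x₄·x₄³` doubles the cost of the quartic slot), so `TowerIneq(3, A₃) ⟹ TowerIneq(4, 2A₃)`
needs `A₃ < 1`, which is false (Pell embeds in level 3): the levels are independent open problems tied together only by
`ABC`.  Function fields give no obstruction: over `k[t]`, `char k = 0`, Mason–Stothers gives the tower inequality with
`A = 1` at every level; in characteristic `p` the Frobenius family `f^{q} + g^{q} = (f+g)^{q}`, `q = p^j`, has level-4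
quality `→ 4/3 < 2` (`pm₄(f^q) = f^{⌈q/4⌉}`), so even there the analogue of the crux is not violated.

### (6e) Open edges after cycle 6 — superseded by § (15e)/(16d) ((ii) DECIDED empty by § Cycle 14; (iii) the per-form endpoint `η = 2` stays open for quartic
irrational `w/v`, decided for `w/v = □` in § (13c)(v)); after six cycles positivity and the equation are load-bearing, coprimality, `C`, `ε` dispensable. -/

section cycle6

/-- The trivial converse of `Negative.ConstantFree.towerFourSubLiouville_constantFree` (p127459): the constant-free
form implies the crux (`C = 1`; `Π^A ≤ Π^{A+ε}` as `Π ≥ 1`).  Hence crux ⟺ `∃ A < 2, ∀ points, c < Π^A` ⟺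
`sup log c / log Π < 2`. -/
theorem crux_of_constantFree
    (h : ∃ A : ℝ, A < 2 ∧ ∀ x y z : Fin 4 → ℕ, (∀ i, 0 < x i ∧ 0 < y i ∧ 0 < z i) →
      (∏ i, x i ^ (i.val + 1)) + (∏ i, y i ^ (i.val + 1)) = ∏ i, z i ^ (i.val + 1) →
      Nat.Coprime (∏ i, x i ^ (i.val + 1)) (∏ i, y i ^ (i.val + 1)) →
      ((∏ i, z i ^ (i.val + 1) : ℕ) : ℝ) < ((∏ i, x i * y i * z i : ℕ) : ℝ) ^ A) :
    TowerFourSubLiouville := by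
  obtain ⟨A, hA, h⟩ := h
  refine ⟨A, hA, fun ε hε => ⟨1, one_pos, fun x y z hpos heq hcop => ?_⟩⟩
  have hP1 : (1 : ℝ) ≤ ((∏ i, x i * y i * z i : ℕ) : ℝ) := by
    have : 0 < ∏ i, x i * y i * z i :=
      Finset.prod_pos fun i _ => Nat.mul_pos (Nat.mul_pos (hpos i).1 (hpos i).2.1) (hpos i).2.2
    exact_mod_cast this
  calc ((∏ i, z i ^ (i.val + 1) : ℕ) : ℝ) < ((∏ i, x i * y i * z i : ℕ) : ℝ) ^ A := h x y z hpos heq hcop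
    _ ≤ ((∏ i, x i * y i * z i : ℕ) : ℝ) ^ (A + ε) := Real.rpow_le_rpow_of_exponent_le hP1 (by linarith)
    _ = 1 * ((∏ i, x i * y i * z i : ℕ) : ℝ) ^ (A + ε) := (one_mul _).symm

/-- The trivial converse of `Negative.CoprimeDispensable.towerIneq4NoCoprime_of_towerFourSubLiouville` (p127991): the
non-coprime form implies the crux (forget the hypothesis).  Hence crux ⟺ `∃ A < 2, TowerIneq4NoCoprime A`. -/
theorem crux_of_noCoprime (h : ∃ A : ℝ, A < 2 ∧ TowerIneq4NoCoprime A) : TowerFourSubLiouville := by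
  obtain ⟨A, hA, h⟩ := h
  refine ⟨A, hA, fun ε hε => ?_⟩
  obtain ⟨C, hC, hC'⟩ := h ε hε
  exact ⟨C, hC, fun x y z hpos heq _ => hC' x y z hpos heq⟩

end cycle6

/-! ## Cycle 7 (refuter-cdisprove-stmt-ABC-1649-g7-0, 2026-08-16): rung `R1` proved (`c = o(Π²)`), enemies of one form
REPEL (gap principle, kernel-checked), and the SPORADIC census of the two-exponent diagram (kit j020482)

### (7a) LANDED `Negative.LiouvilleEndLittleO` (p129100) — `R1`: the Liouville end holds with every constant
`towerIneq4_two_every_constant : ∀ κ > 0, ∃ c₁, ∀ positive level-4 points, c₁ < c → c < κ·Π²` — coprime or not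
(inlined below).  Mechanism = exactly the reach of the tree's proved Roth: `κΠ² ≤ c`, `a ≤ b` ⟹ `κ²·a·E ≤ 2`
(`bad_point_shape` at `s = 2`), so `(a, v, w)` lies in the finite box `≤ ⌈2/κ²⌉³` and the landed per-box Roth bound
`UniformSadicTowerFour.FourthPowerDivisor.binomialQuartic_bounded_box` bounds `Z`, hence `c = wZ⁴`.  So the ladder of
§ (6d) now reads: `R0` `c < Π²` (p127459, elementary) — `R1` `c = o(Π²)` (p129100, Roth, ineffective) — `R2` effective
`(log Π)^{−δ₀}` saving (Baker; not in the tree) — `R3` every polylog (open) — `R4` the crux.  For the disproof: with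
crux ⟺ `s* < 2` (cycle 6), a failure of the crux is a NON-attained supremum `s* = 2` along points whose forms escape
every box, and no enemy family can have `c ≥ κΠ²` infinitely often (`no_enemy_at_liouville_end`).  For provers: `R1`
is all that the per-form stratum (`stub_fixedFormsRoth`) gives for the crux's own inequality.

### (7b) LANDED `Negative.EnemiesRepel` (p129200) — the gap principle in integer form
`twoSolution_identity`: `a₁Z₂⁴ − a₂Z₁⁴ = v(Y₂Z₁ − Y₁Z₂)(Y₂Z₁ + Y₁Z₂)((Y₂Z₁)² + (Y₁Z₂)²)` (`aᵢ = wZᵢ⁴ − vYᵢ⁴`);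
`enemies_repel_core`: `Y₁Z₂ ≠ Y₂Z₁ ⟹ v·Y₁³·Z₂³ ≤ |a₁|Z₂⁴ + |a₂|Z₁⁴` (the cross-difference is a nonzero integer —
no real fourth roots, no size hypotheses); `ubq_violators_repel`: two DISTINCT coprime violators of one form `(v, w)`
(`|wZᵢ⁴ − vYᵢ⁴| ≤ Zᵢ^η`, `0 ≤ η ≤ 2`, `2 ≤ Z₁ ≤ Z₂`) satisfy **`Z₁³ < 4·Z₂^{1+η}`**.  So per form the violators are
super-lacunary — `log Z_{k+1} ≥ (3/(1+η)) log Z_k − log 4`: beyond the cube of the previous one as `η → 0`, beyond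
`Z^{3/2}/2` at `η = 1`, void only at the per-form endpoint `η = 2` (where Dirichlet supplies geometric families,
cycle 5) — and a form has `O_η(log log T)` violators up to `T`, uniformly and effectively.  This is the elementary
shadow of the counting theorems (Thue–Siegel, Bombieri–Schmidt, Evertse, Bennett) that `Lines/*-dead.md` found
useless for the crux, now as a kernel fact: COUNTING violators is free; the crux is the FIRST large violator of each
form, about which repulsion is silent.  An enemy family of the crux must change its form at essentially every step
(finitely many violators per form for `η < 2`, `stub_fixedFormsRoth`; consecutive ones cubically spaced, this file).

### (7c) Sporadic census of the two-exponent diagram (kit job j020482, `census/main.py`, attached to the item)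
The identity ceiling is `3/2` (cycle 3) but the probabilistic value of the uniform dial is `1`; the gap `(1, 3/2]`
must be filled by SPORADIC (structureless) violators.  For `η < 2` every violator with `Z` large is a continued
fraction convergent `Y/Z` of `(w/v)^{1/4}`, so the census is exhaustive: all ordered coprime pairs `(v, w)`, `v ≠ w`,
both fourth-power-free, `max(v, w) ≤ H = 10⁴` (`6.1·10⁷` pairs), all convergents with `2 ≤ Z ≤ 10⁴⁰`, recording
the `η`-VALUE `max(log max(v,w), log|a|)/log Z` of each (`a = wZ⁴ − vY⁴`; a row refutes `UBQ η` at that `Z` for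
every `η ≥` its value).  Random model (Khinchin-type: coprime `(Y, Z)` with `|αZ − Y| < ψ(Z)` number
`≈ (12/π²)Σψ`; `|a| ≈ 4v^{1/4}w^{3/4}Z³|αZ − Y|`; pair weight `Σ v^{−1/4}w^{−3/4} ≈ (16/3)M`): expected rows with
`η`-value `≤ η` and `Z ∈ [Z, Z+dZ]` ≈ `0.84·min(H, Z^η)·Z^{η−3} dZ` — growing like `Z^{2η−2}` while `Z^η ≤ H`
(hence infinitely many violators for every `η > 1` as `H → ∞`: uniform dial `= 1`, not `3/2`), decaying like
`H·Z^{η−2}` in the fixed box (Roth per form, with the density made quantitative).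
RESULTS (`5.5·10⁷` forms: `4.86·10⁷` with `v ≤ 8801` in kit j020482, 1651 s, the remaining `6.5·10⁶` with
`8802 ≤ v ≤ 10⁴` in the tail job j020675, 156 s — the box `max(v,w) ≤ 10⁴` is COMPLETE; rows = convergents with
`η`-value `≤ 1.7`; observed / predicted by the random model; ordered pairs, i.e. each coincidence counted in both
orientations, as the core's `Z` is the `w`-side variable):
```
Z-decade   η≤1.0    η≤1.1    η≤1.2     η≤1.3      η≤1.4      η≤1.5       η≤1.6       η≤1.7
10^1       0/1.9    0/3.9    1/8.0    5/16.6    17/35.2    49/75.7     128/165     291/364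
10^2       1/1.9    2/6.2   19/20.1   53/66.2   211/210    501/555   1165/1301   2597/2793
10^3       2/1.9    6/8.3   20/28.0   62/75.2   164/166    347/364    742/799    1694/1761
10^4       1/0.8    3/2.1    4/5.6    9/15.2    37/41.8   106/115     302/318     919/883
10^5       1/0.1    2/0.3    3/0.9     3/3.0    9/10.5     31/36.4    121/127     399/442
10^6        0/0      0/0    0/0.1     0/0.6     0/2.6     7/11.5     31/50.4     209/222
10^7        0/0      0/0      0/0     0/0.1     0/0.7      1/3.6     23/20.1     124/111
10^8–10^14  0/0      0/0      0/0       0/0     0/0.2      0/1.7    12/13.3     118/111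
total      5/6.7  13/20.8  47/62.7  132/177   438/467  1042/1163   2524/2793   6351/6688
```
(`η ≤ 0.9`: observed 0, predicted 2.2; `η ≤ 0.8`: 0 / 0.8.)  The law holds within a factor `≈ 0.9` over FOURTEEN decades
of `Z` and the whole window `1 ≤ η ≤ 1.7`, with no excess anywhere: the violators in `(1, 3/2]` are exactly as numerous
as coin-flipping predicts, and they are structureless (no form carries two distinct violators with `η`-value `≤ 1.5` —
cf. (7b); largest `Z` reached: `η ≤ 1.1`: `172055` (`877·172055⁴ − 5495·108749⁴ = 542630`), `η ≤ 1.4`: `806746`,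
`η ≤ 1.5`: `3.3·10⁷`, `η ≤ 1.6`: `4.4·10⁹`, `η ≤ 1.7`: `1.9·10¹⁴`).  BELOW `η = 1` the census finds exactly three
coincidences (five rows): `75·463⁴ − 388·307⁴ = −313` (`η`-value `0.971`), `282·1808⁴ − 665·1459⁴ = −1193` (`0.9446`;
`0.972` in the other orientation) and `1423·112575⁴ − 9166·70664⁴ = −52081` (`0.9337` at `Z = 112575`, the record;
`0.9727` at `Z = 70664` in the other orientation) — so the threshold of `UBQ 1` exceeds `112575` (`ubq_one_threshold`
below) — and NOTHING with `η`-value `≤ 0.9`: since every violator with `Z ≥ 11` is a convergent and every form with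
`max(v,w) ≤ Z^{η₀} ≤ 10⁴` is in the box, the list of violators with `η`-value `≤ η₀` and `11 ≤ Z ≤ 10^{4/η₀}` is
COMPLETE: **`UBQ η₀` holds on `11 ≤ Z ≤ 10^{4/η₀}` for every `η₀ ≤ 0.9`** — `UBQ 0.9` on `[11, 2.7·10⁴]`, `UBQ 0.8` on
`[11, 10⁵]`, `UBQ 0.7` on `[11, 5.1·10⁵]`, `UBQ 1/2` on `[11, 10⁸]`, `UBQ 1/4` on `[11, 10¹⁶]`.  Reading: the uniform
dial is `1` on the nose — for `η > 1` violators proliferate like `Z^{2η−2}` (the identity ceiling `3/2` of cycle 3 is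
an artefact of restricting to families), for `η < 1` the random model predicts `≈ 0.42·2^{2η−2}/(1−η)` violators IN
TOTAL over all forms and heights (`2.2` at `η = 0.9`, `0.4` at `η = 1/2`) and the census finds none below `0.93`.  For
provers: the natural effective target "UBQ 1/2 with `Z₀ = 11`" is consistent with everything computed; the crux needs
any `η > 0`, and nothing on the negative side distinguishes `η = 1/100` from `η = 0.9`.  Kit jobs j020482 + j020675
(`census/main.py`; manifests attached to the item as `compute-j020482.json`, `compute-j020675.json`).

### (7d) Dead ends examined in cycle 7 (analysis, no theorem; v28: compressed — full text in the cycle-7 item evidence)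
* `A = 1` loss: Pell/Lucas square parts (`v_p(y_m) = v_p(y_{r(p)}) + v_p(m)`; Smyth's index-divisible closure; `lcm`/highly-composite groupings)
  give gain `≲ log c·(log log log c)/log log c` at best — the bare `log c` is out of reach of this class (§ (6b)).
* Identity families over a base of genus `≥ 1`: Siegel + Faltings forbid `S`-integral approach and exceptional approximation, so the algebraic-identity
  class is `ℙ¹` (floors `2 + 1/z`) and `𝔾_m` (Pell-boosted, floor `2`) — and § Cycle 16 shows what `𝔾_m` of LARGE width still gives ON the line `θ + φ = 2`.
* All-quartic regime `αX⁴ + βY⁴ = γZ⁴`: beating the sporadic record `1.30066` needs `Z > 10¹⁹` at coefficient cost `30` (`3·11⁴ + 7·211⁴ = 10·193⁴`: `1.272`).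

### (7e) Open edges after cycle 7: (i) loss at `A = 1` between `log c/(log log c)^{1+}` and polylog; (ii) persistence of sporadic violators with `η`-value `< 1` (census § (7c): none `≤ 0.9`); (iii) per-form endpoint `η = 2`; (iv) rungs `R2` (effective, Baker) and `R3`. -/

section cycle7
open Summit.ABC.ABC.Theorems.TowerFourSubLiouville.Negative

/-! ### (7a), (7b) — v21: the cycle-7 INLINED copies of `Negative.LiouvilleEndLittleO` (p129100) and `Negative.EnemiesRepel`
(p129200) are removed (the modules are imported at the top of this file); their headline theorems restated: -/

/-- **(7a)** At the Liouville end the crux holds with EVERY constant: `∀ κ > 0`, `c < κΠ²` for all large positive level-4 points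
(LANDED p129100, `towerIneq4_two_every_constant`). -/
example (κ : ℝ) (hκ : 0 < κ) :
    ∃ c₁ : ℕ, ∀ x y z : Fin 4 → ℕ, (∀ i, 0 < x i ∧ 0 < y i ∧ 0 < z i) →
      (∏ i, x i ^ (i.val + 1)) + (∏ i, y i ^ (i.val + 1)) = ∏ i, z i ^ (i.val + 1) →
      c₁ < ∏ i, z i ^ (i.val + 1) →
      ((∏ i, z i ^ (i.val + 1) : ℕ) : ℝ) < κ * ((∏ i, x i * y i * z i : ℕ) : ℝ) ^ 2 :=
  towerIneq4_two_every_constant κ hκ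

/-- **(7b)** Two distinct coprime violators of ONE form repel cubically (LANDED p129200, `ubq_violators_repel`). -/
example {η : ℝ} (hη0 : 0 ≤ η) (hη2 : η ≤ 2) {v w Y₁ Z₁ Y₂ Z₂ : ℕ}
    (hv : 0 < v) (hw : 0 < w) (hZ₁ : 2 ≤ Z₁) (hle : Z₁ ≤ Z₂) (hne : (Y₁, Z₁) ≠ (Y₂, Z₂))
    (hc₁ : Nat.Coprime (v * Y₁) (w * Z₁)) (hc₂ : Nat.Coprime (v * Y₂) (w * Z₂))
    (ha₁ : |((w * Z₁ ^ 4 : ℕ) : ℝ) - ((v * Y₁ ^ 4 : ℕ) : ℝ)| ≤ (Z₁ : ℝ) ^ η)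
    (ha₂ : |((w * Z₂ ^ 4 : ℕ) : ℝ) - ((v * Y₂ ^ 4 : ℕ) : ℝ)| ≤ (Z₂ : ℝ) ^ η) :
    (Z₁ : ℝ) ^ 3 < 4 * (Z₂ : ℝ) ^ (1 + η) :=
  ubq_violators_repel hη0 hη2 hv hw hZ₁ hle hne hc₁ hc₂ ha₁ ha₂

/-- **(7c) The two lowest points of the sporadic census** (kit j020482 + j020675): `282·1808⁴ − 665·1459⁴ = −1193`
(`η`-value `max(log 665, log 1193)/log 1808 = 0.9446`) and the record `1423·112575⁴ − 9166·70664⁴ = −52081` (`η`-value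
`max(log 9166, log 52081)/log 112575 = 0.9337`) — the lowest points of the two-exponent diagram with `Z ≥ 11` over all
`5.5·10⁷` forms with `max(v, w) ≤ 10⁴` and all `Z ≤ 10⁴⁰`. -/
example : (282 : ℤ) * 1808 ^ 4 - 665 * 1459 ^ 4 = -1193 ∧
    (1423 : ℤ) * 112575 ^ 4 - 9166 * 70664 ^ 4 = -52081 := by
  constructor <;> norm_num

/-- **(7c) The threshold of `UBQ 1` exceeds `112575`**: the record sporadic violator
`1423·112575⁴ − 9166·70664⁴ = −52081` (`η`-value `0.9337`, also the largest `Z` below `η = 1` in the census) kills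
the core's matrix at `η = 1`, `Z₀ = 112575` (small-model fact; the core only asks for SOME `η > 0` and SOME `Z₀`). -/
theorem ubq_one_threshold : ¬ ∀ v w Y Z : ℕ, 112575 ≤ Z → 0 < v → 0 < w → 0 < Y → Nat.Coprime (v * Y) (w * Z) →
    ((max v w : ℕ) : ℝ) ≤ (Z : ℝ) ^ (1 : ℝ) → w * Z ^ 4 ≠ v * Y ^ 4 →
    (Z : ℝ) ^ (1 : ℝ) < |((w * Z ^ 4 : ℕ) : ℝ) - ((v * Y ^ 4 : ℕ) : ℝ)| := by
  intro h
  have key := h 9166 1423 70664 112575 le_rfl (by norm_num) (by norm_num) (by norm_num) (by norm_num)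
    (by rw [Real.rpow_one]; norm_num) (by norm_num)
  rw [Real.rpow_one] at key
  have : |((1423 * 112575 ^ 4 : ℕ) : ℝ) - ((9166 * 70664 ^ 4 : ℕ) : ℝ)| = 52081 := by
    rw [abs_eq (by norm_num)]
    right; push_cast; norm_num
  rw [this] at key
  norm_num at key

end cycle7

/-! ## Cycle 8 (refuter-cdisprove-stmt-ABC-1649-g8-0, 2026-08-16): the round-2 TRANSFER targets calibrated —
`HallLang1728 κ` needs `κ ≥ 3/2`, `UniformLjunggren K` needs `K ≥ 1/2` (LANDED p131589, p131711); thresholds, identity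
enemies and census of the transfer; the S1 window of `two-division-descent-anchor`

Context: ideation round 2 (ideator 5) filed `cm-hall-lang-transfer` and `two-division-descent-anchor`, which leave the Thue-inequality coordinates; this cycle calibrates their transfer targets.

### (8a) LANDED `Negative.HallLangTransfer` (p131589): floors `κ ≥ 3/2` and `K ≥ 1/2` by ONE identity
`ljunggrenFamily₂_identity`: `(16t⁵+32t⁴+64t³+64t²+56t+16)² − (t²+2)(4t²+4t+4)⁴ = −64(3t²+4t+4)` — a solution of
`x² − dy⁴ = k` by polynomials with `(deg d, deg y, deg k) = (2, 2, 2)`, EXTREMAL for Mason–Stothers (`deg y ≤ deg d/2 + deg k − 1`).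
* `not_uniformLjunggren_of_lt_half`: `UniformLjunggren K` is FALSE for every `K < 1/2` (`y ≍ t²`, `|d||k| ≤ 2112t⁴`);
* `not_hallLang1728_of_lt_three_halves`: `HallLang1728 κ` is FALSE for every `κ < 3/2` — the integral points
  `x = (t²+2)(4t²+4t+4)² ≥ t⁶`, `N = −64(t²+2)(3t²+4t+4)`, `|N| ≤ 2112t⁴` on `y² = x³ + Nx` (`hallLangFamily₂_onCurve`;
  dictionary `x = d·y'²`, `N = d·k`, `y = d·y'·x'` for `x'² − d y'⁴ = k`).
Both matrices are `SketchIdeator5.HallLang1728` / `.UniformLjunggren` VERBATIM (restated below as `example`s).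

### (8b) LANDED `Negative.HallLangTransferCruxFibre` (p131711): the floor `K ≥ 1/2` is already on the crux fibre
The crux feeds the transfer only through the doubly-square fibre `(d, k, x, y) = (vw, aw, wZ², Y)`; the identity of (8a) is
not of that shape.  `not_uniformLjunggren_fibre12_of_lt_half`: the `UniformLjunggren` matrix restricted to `d = 2`, `x = 2Z²`
(the single form `(v, w) = (1, 2)`) still fails for every `K < 1/2` — witnesses from Dirichlet for `⁴√2` (cycle 5,
`exists_good_approx`: coprime `(Y, Z)`, `Z > B`, `|2Z⁴ − Y⁴| ≤ 43Z²`; then `(2Z²)² − 2Y⁴ = 2(2Z⁴ − Y⁴)`, `|d||k| ≤ 172Z²`,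
`Y ≥ Z`).  This is the Dirichlet corner `(θ, φ) = (0, 2)` of the two-exponent diagram (§ Cycle 5).

### (8c) The full dial of the transfer (what is proved, what is heuristic, what is `ABC`)
* UPPER SIDE (`ABC`, informal here — same bookkeeping as `Negative.Framing.cube_lt_of_abc`): `ABC ⟹ UniformLjunggren K` for every
  `K > 1`, indeed `|y| ≪_ε d^{1/2+ε}|k|^{1+ε}`: in `x² = dy⁴ + k` reduced by `g = gcd(dy⁴, k)`, abc on the coprime triple gives
  `x²/g < C_ε(rad(dy⁴/g)·rad(k/g)·rad(x²/g))^{1+ε} ≤ C_ε(d|y|·|k|/g·|x|)^{1+ε}`, so `x² < C_ε g^{−ε}(d|y||k||x|)^{1+ε}` — the `g`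
  CANCELS — and with `x ≍ √d y²` (else `|k| > dy⁴/2` and the bound is trivial) `|y|^{1−3ε} ≪ d^{1/2+3ε/2}|k|^{1+ε}`.  In Hall–Lang
  coordinates (`x = dm²`, `N = dk` for the integral point `(dm², dmn)` of `n² − dm⁴ = k`): `ABC ⟹ HallLang1728 κ` for every `κ > 2`.
  So `C⁺` is unrefutable short of `¬ABC`, like the crux (sandwich for the transfer).
* RANDOM MODEL (for each `(d, y)` the best `k` is spread over `|k| ≲ √d·y²`): `#{(d,k,y) : y ≥ (d|k|)^K} ≈ Σ_d d^{−K−1/2} Σ_k |k|^{−K}`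
  — divergent in `k` iff `K ≤ 1` (already for ONE `d`), in `d` iff `K ≤ 1/2`.  Thresholds: `K* = 1`, `κ* = 2` (`κ`: `Σ_m m^{2/κ−2}`),
  EQUAL to the `ABC` exponents — unlike `UBQ` (heuristic `1`, crux needs `> 0`, `ABC` gives `< 8/13`), the transfer target has NO
  window between "heuristically false" and "`ABC`-true": `UniformLjunggren K` should be exactly the statements `K > 1` (any
  `C`) — and the crux needs only ONE `K`, receiving `η < 1/(4K+2)` (card; the bookkeeping checked this cycle even gives
  `η < 1/(4K + 1/4)`: `Y ≥ Z^{1−η/4}/2^{1/4}`, `v w²|a| ≤ Z^{4η}`), i.e. at best `η < 1/6`.  So the transfer relocates the crux to a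
  target with INFINITE slack in its own dial (aim at `K = 100`), whose difficulty is pure uniformity in `(d, k)` — Hall–Lang /
  Lang's integral-point conjecture for the quartic-twist family of `j = 1728`, open, Baker-shaped effective bounds only.
* THE CRUX FIBRE SITS AT THE BOTTOM EDGE OF THAT WINDOW.  Restricted to crux-shaped arguments `(d, k, x, y) = (vw, aw, wZ², Y)`
  (coprime violators `wZ⁴ = vY⁴ + a`, `v, w ≍ Z^θ`, `|a| ≍ Z^φ`), a violation of exponent `K` means `3θ + φ < 1/K`, and the
  random-model region of the core is `θ + φ ≥ 2` (§ Cycle 3/5): `min (3θ + φ) = 2` at the Dirichlet corner `(0, 2)`, so ON THE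
  FIBRE the heuristic threshold is `K = 1/2` — and there Dirichlet PROVES the violations ((8b), p131711) while `ABC` gives the
  matching upper side `Y ≤ C(vw|a|)^{1/2+ε}` (`wZ⁴ < C_ε(vwYZ|a|)^{1+ε}`, `Y ≍ (w/v)^{1/4}Z`).  So the fibre dial is PINNED at
  `1/2` (floor unconditional, ceiling under `ABC`), the ambient dial at `1` (floor `1/2` proved): `UniformLjunggren K` for
  `K ∈ (1/2, 1]` is heuristically false in general but heuristically true on everything the crux ever feeds it.
* IDENTITY ENEMIES of the transfer (this cycle's algebra; seat folder `alg/`).  In `ℚ[t, √d]`, `d = t² + e`, one has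
  `ℚ[t, √d] = ℚ[s, 1/s]` with `s = t + √d` (`s·s̄ = −e`), and a polynomial solution `n² − dm⁴ = k` with
  `(deg d, deg m, deg n, deg k) = (2, μ, 2μ+1, μ)` (Mason–Stothers-extremal; `K`-floor `μ/(μ+2)`, `κ`-floor `(2μ+2)/(μ+2)`) is
  exactly a truncated unit multiple `n + m²√d = c·s^{μ+1}P(s)`, `deg P = μ`, whose `√d`-part `Σ pᵢ b_{μ+1+i}(t)` (`s^j = a_j + b_j√d`,
  `b_{j+1} = 2t·b_j + e·b_{j−1}`) is a perfect square: `2μ+1` quadratic conditions on `2μ+2` unknowns with a `1`-dimensional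
  scaling — a rigid (Belyi-type, passport `[2^{2μ+1}] / [4^μ,1,1] / [3μ+2, 1^μ]`) zero-dimensional scheme for each `μ`.
  Solutions: `μ = 1`: `e = 1`, `P = s + 2`, `m = 2t+1` (`ljunggrenFamily₁_identity`, floors `1/3`, `4/3`); `μ = 2`: `e = 2`,
  `P = s² + 4s + 6`, `m = 4(t²+t+1)` ((8a); floors `1/2`, `3/2`); `μ = 3`: ONE Galois orbit, `e` a root of
  `4e⁴ − 612e³ + 16848e² − 151632e + 295245` (normalisation `m = t³ + (3/2)t² + …`; real roots `2.6573`, `120.65`) — no rational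
  family; `μ = 4`: `e ≈ 3.10119` (`m = t⁴ + 2t³ + …`) satisfies no integer relation of degree `≤ 10` (36 digits).  (The guess
  `P_μ = Σ C(2μ,i)s^{μ−i}`, `e = μ`, true for `μ = 1, 2`, fails from `μ = 3` on.)  So, exactly as for `UBQ` in cycle 3 (`z = 3`
  scheme without real points), the identity floor stalls: `K ≥ 1/2`, `κ ≥ 3/2`; the limits `1`, `2` (= the heuristic AND the
  `ABC` values — here Mason–Stothers and coin-flipping agree) would need rational points on the near-extremal curves
  (`deg k = μ + 1`: a `1`-parameter family for each `μ`, floors `μ/(μ+3)`, `(2μ+2)/(μ+3)`, beating `3/2` from `μ = 6` on) — open.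
* CENSUS (seat folder `census/ul_sporadic.py`, 10 s): non-square `d ≤ 30`, `2 ≤ y ≤ 3·10⁵`, best `k` per `(d, y)`,
  `ρ := log y/log(d|k|)`: `ρ ≥ 1`: 10 points (random-model expectation `≈ 1.45·ln(3·10⁵)·0.9 ≈ 16`), `ρ ≥ 0.9`: 38, `ρ ≥ 0.8`: 116;
  top: `239² − 2·13⁴ = −1` (`ρ = 3.70`, the Pell–Ljunggren point; in Hall–Lang form `(338, 6214)` on `y² = x³ − 2x`,
  `log x/log|N| = 8.4`), then `54379907² − 2·6201⁴ = −953` (`ρ = 1.156`; Hall–Lang ratio `log(2·6201²)/log 1906 = 2.40`),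
  `54836879² − 2·6227⁴ = 959` (`1.156`), `3124² − 2·47⁴ = 14` (`1.155`), `650851² − 3·613⁴ = 118` (`1.094`),
  `334072422² − 5·12223⁴ = −1121` (`1.090`).  None of these is a continued-fraction convergent (`|k| ≫ √d`): the card's own census
  ("square convergent denominators only at index `≤ 17`, `K ≥ 2` consistent off `d ≤ 13`") looked at convergents, i.e. at
  `|k| ≲ 2√d`, and therefore saw neither the `ρ > 1` sporadics nor the polynomial families of (8a); the random model predicts
  `≈ 1.45 ln Y` points with `ρ ≥ 1` up to height `Y` over all `d` and finitely many above each `ρ₀ > 1` — consistent.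
* CRUX-SHAPED points.  In the `(θ, φ)` diagram of the core (`v, w ≍ Z^θ`, `|a| ≍ Z^φ`) the image point has Hall–Lang ratio
  `log x/log|N| = (2θ + 2)/(φ + 3θ)`: Dirichlet corner `(0,2)` → `1`, `padeFamily₁` `(2,1)` → `6/7`, `padeFamily₂` `(1, 3/2)` → `8/9`,
  `bezoutFamily₃` `(3, 0)·` → `8/9`; every KNOWN enemy family of the core maps BELOW Hall–Lang ratio `1`, while a violator of the
  crux with exponent `η` maps to ratio `≥ (2+2η)/(4η) → ∞`.  The `κ ∈ [1, 3/2)` refutation of (8a) lives OFF the crux shape: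
  its points are `x = d·y'²`, `N = d·k` with `d = t²+2`, `k = −64(3t²+4t+4)`, but crux-shaped means in addition `d = vw`,
  `w ∣ k` and `x' = wZ²` (`x'² − dy'⁴ = k`), and `x' = 16t⁵ + … + 16` is not `w·□` along the family.  So inside Hall–Lang the
  crux is a thin fibre on which no infinite family with limiting ratio `> 1` is known (small sporadics do exceed `1`:
  `1 + 80 = 81 ↦ (x, y) = (20, 90)` on `y² = x³ + 5x`, ratio `log 20/log 5 = 1.86`; `1 + 2400 = 7⁴ ↦ (600, ·)` on
  `y² = x³ + 150x`, ratio `1.28` — the tower-quality record points of § Computation), while the conjectural truth of the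
  ambient dial is `2`: the transfer asks for much more than the crux needs, in exchange for a group structure.

### (8d) Card `two-division-descent-anchor`: the S1 window is NON-EMPTY (cheapest falsifier (i) run on paper)
Voutier, Acta Arith. 143 (2010) Thm 2.1 (read this cycle: arXiv:0805.3176 pp. 4–6, Lemma 7.4) with `K = ℚ(√(−av))`, `n = 4`,
`U = α₁²`, `Z = α₁ᾱ₁ = vw`, `g = α₁ = vα' + β√(−av)` (`w = vα'² + aβ²`), `d = 2β`: with `φ = arg α₁`, `sin φ = β√(av)/√(vw)`,
`E = 𝒩/(4𝒟₄|α₁|sin²(φ/2))`, `Q = 4𝒟₄|α₁|cos²(φ/2)/𝒩`, `κ = log Q/log E`, and `κ < 3 ⟺ Q < E³ ⟺ sin⁶(φ/2)cos²(φ/2) <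
(𝒩/(4𝒟₄|α₁|))⁴`, i.e. (small `φ`) `β⁶a³v² < 64(𝒩/(4𝒟₄))⁴·w`, i.e. **`α'² ≳ (𝒟₄⁴/4)(2/𝒩)⁴·a³vβ⁶`** (`𝒩 = 𝒩_{2β,4} =
2^{min(1+v₂(β),3)} ≥ 2`; with the table-free `𝒟₄ = 4μ₄ = 8` of Lemma 7.4(d): `α'² > 1024·a³vβ⁶` suffices up to the `cos²`
and `sin φ ≈ φ` corrections; the Table-1 value of `𝒟_{1,4}` improves the constant).  So S1 = {`(a, v, w = vα'² + aβ²)` with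
`α'² ≳ 10³a³vβ⁶`} is an explicit INFINITE four-parameter family of coefficient triples (containing Chen–Voutier's `a = v = β = 1`),
on which every principal-class violator has `Z ≤ (c√(w/a))^{2/(3−κ)}`, `c` polynomial in `vw`: a genuine uniform polynomial
FIRST-giant bound — the property triage r1 asked for — but on a THIN stratum: for fixed `(a, v)` the admissible `w ≤ W` number
`≍ W^{2/3}` (and the exponent `2/(3−κ)` blows up at the window's edge, so "polynomial with bounded exponent" needs `α'² ≥ λ·10³a³vβ⁶`,
`λ > 1` fixed).  Nothing here is refutable (every stratum statement is `ABC`-implied); the generic class (order-4 / non-lopsided /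
twisted S2) is the crux, as the card says.  Recorded for the triage panel; no Lean content (the first lemmas of both cards are
`ring` identities, checked in `SketchIdeator5.lean`).

### (8e) Open edges after cycle 8 — (v) the transfer window `K ∈ [1/2,1]` / `κ ∈ [3/2,2]`: CLOSED in § (9a); (vi) `ABC ⟹ UniformLjunggren`: formal since p131908/p132209. -/

section cycle8
open Summit.ABC.ABC.Theorems.TowerFourSubLiouville.Negative

/-- **(8a)** `HallLang1728 κ` (verbatim `SketchIdeator5.HallLang1728 κ`) fails for every `κ < 3/2` (LANDED p131589). -/
example (κ : ℝ) (hκ : κ < 3 / 2) :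
    ¬ ∃ C : ℝ, 0 < C ∧ ∀ N x y : ℤ, N ≠ 0 → y ^ 2 = x ^ 3 + N * x → (|x| : ℝ) ≤ C * (|N| : ℝ) ^ κ :=
  not_hallLang1728_of_lt_three_halves κ hκ

/-- **(8a)** `UniformLjunggren K` (verbatim `SketchIdeator5.UniformLjunggren K`) fails for every `K < 1/2` (LANDED p131589). -/
example (K : ℝ) (hK : K < 1 / 2) :
    ¬ ∃ C : ℝ, 0 < C ∧ ∀ d k x y : ℤ, ¬ IsSquare d → k ≠ 0 → x ^ 2 - d * y ^ 4 = k →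
      (|y| : ℝ) ≤ C * ((|d| * |k| : ℤ) : ℝ) ^ K :=
  not_uniformLjunggren_of_lt_half K hK

/-- **(8b)** … and already on the crux fibre `(v, w) = (1, 2)` (`d = 2`, `x = 2Z²`; LANDED p131711, Dirichlet for `⁴√2`). -/
example (K : ℝ) (hK : K < 1 / 2) :
    ¬ ∃ C : ℝ, 0 < C ∧ ∀ k x y : ℤ, (∃ Z : ℤ, x = 2 * Z ^ 2) → k ≠ 0 → x ^ 2 - 2 * y ^ 4 = k →
      (|y| : ℝ) ≤ C * ((|(2 : ℤ)| * |k| : ℤ) : ℝ) ^ K :=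
  not_uniformLjunggren_fibre12_of_lt_half K hK

/-- **(8a) The two rational extremal identities** (`μ = 1`: `s²(s+2)`, `e = 1`; `μ = 2`: `s³(s²+4s+6)`, `e = 2`). -/
example (t : ℤ) : (4 * t ^ 3 + 4 * t ^ 2 + 3 * t + 2) ^ 2 - (t ^ 2 + 1) * (2 * t + 1) ^ 4 = 4 * t + 3 ∧
    (16 * t ^ 5 + 32 * t ^ 4 + 64 * t ^ 3 + 64 * t ^ 2 + 56 * t + 16) ^ 2
      - (t ^ 2 + 2) * (4 * t ^ 2 + 4 * t + 4) ^ 4 = -(64 * (3 * t ^ 2 + 4 * t + 4)) :=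
  ⟨ljunggrenFamily₁_identity t, ljunggrenFamily₂_identity t⟩

/-- **(8a) The trivial floor `κ ≥ 1` of `HallLang1728`**, for comparison: `(m², m(m²+1))` lies on `y² = x³ + (2m²+1)x`,
`x ≍ |N|`. -/
example (m : ℤ) : (m * (m ^ 2 + 1)) ^ 2 = (m ^ 2) ^ 3 + (2 * m ^ 2 + 1) * m ^ 2 := by ring

/-- **(8c) Census points**: the Pell–Ljunggren point `239² − 2·13⁴ = −1` (`ρ = 3.70`) = the integral point `(338, 6214)` on
`y² = x³ − 2x` (Hall–Lang ratio `log 338/log 2 = 8.4`), and the top sporadic `54379907² − 2·6201⁴ = −953` (`ρ = 1.156`,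
Hall–Lang ratio `2.40` at `x = 2·6201²`, `N = −1906`). -/
example : (239 : ℤ) ^ 2 - 2 * 13 ^ 4 = -1 ∧ (6214 : ℤ) ^ 2 = 338 ^ 3 + (-2) * 338 ∧
    (54379907 : ℤ) ^ 2 - 2 * 6201 ^ 4 = -953 ∧
    ((2 : ℤ) * 6201 * 54379907) ^ 2 = (2 * 6201 ^ 2) ^ 3 + (-1906) * (2 * 6201 ^ 2) := by
  refine ⟨by norm_num, by norm_num, by norm_num, by norm_num⟩

end cycle8

/-! ## Cycle 9 (refuter-cdisprove-stmt-ABC-1649-g9-0, 2026-08-16/17): the transfer dials PINNED — `UniformLjunggren K` false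
for every `K < 1`, `HallLang1728 κ` false for every `κ < 2`, by a Pell-boosted family (LANDED `Negative.HallLangTransferPell`,
p132424); the new stub `stub_reciprocitySieve` checked (true)

Context.  Lead a1 PICKED `SketchIdeator5` (23:15Z) and by skeleton v3 (`Lines/SketchIdeator5.lean`) six of seven registered
stubs are landed (`stub_ulGivesUBQ` p131494, `stub_hallLangGivesUL` p131600, `stub_ulGivesHallLang` p131834, `stub_abcGivesUL`
p131908, `stub_reciprocitySieve` p132232, edge `stub_cruxOfHallLang1728` p132209); the ONLY `sorry` is the core
`stub_hallLang1728 : ∃ κ C, 0 < C ∧ ∀ N x y : ℤ, N ≠ 0 → y² = x³ + N x → |x| ≤ C |N|^κ` (Hall–Lang for the `j = 1728`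
family, OPEN; `ABC ⟹` it, p132209).  Cycle 8 left its dial at: false for `κ < 3/2` (polynomial identity, Mason–Stothers
extremal), conjecturally false for `κ < 2`, `ABC`-true for `κ > 2`, with the remark that only a Pell-boosted (Danilov-type)
family could close the window `[3/2, 2)` (§ (8e)(v)).  This cycle finds that family.

### (9a) LANDED `Negative.HallLangTransferPell` (p132424): the Pell-boosted family
`pellBoost_identity`:  **`u² = 2t² + 1 ⟹ (4u(t+1))² − 2·(2t+1)⁴ = 16t + 14`**  (`linear_combination 16(t+1)²·h`).
Along the Pell sequence `(u,t) = (3,2), (17,12), (99,70), (577,408), …` (`pellBoost_exists`: `(u,t) ↦ (3u+4t, 2u+3t)`,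
`t ≥ n + 2` at step `n`) this is a solution of `x² − d y⁴ = k` with `d = 2`, `y = 2t + 1`, `k = 16t + 14`, so
`|d|·|k| = 32t + 28 = 16|y| + 12`: the `UniformLjunggren` exponent is `K = 1` ON THE NOSE (worked members `36² − 2·5⁴ = 46`,
`884² − 2·25⁴ = 206`, `28116² − 2·141⁴ = 1134`; in Diophantine-approximation terms `‖(2t+1)²√2‖ = (16t+14)/((2t+1)²√2 + 4u(t+1))
≈ 2√2/(2t+1)`: in `(2t+1)²√2 = 4t²√2 + 4t√2 + √2` the constants `∓√2` of `4t²√2 ≈ 4tu − √2` and `4t√2 + √2 ≈ 4u + √2` cancel).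
In Hall–Lang coordinates (`x = d y'²`, `N = d k`, `y = d x' y'`): `pellBoost_onCurve`: the integral points
`(x, y) = (2(2t+1)², 8u(t+1)(2t+1))` on `y² = x³ + (32t + 28)·x`, with `x = 8t² + 8t + 2 = N²/128 + O(N)`, `y ≠ 0`.
Consequences, all with the matrices VERBATIM (`SketchIdeator5.UniformLjunggren K`, the registered `stub_hallLang1728` matrix,
and ideator 4's `y ≠ 0` variant `SketchIdeator4.HallLang1728`):
* `not_uniformLjunggren_of_lt_one`: `UniformLjunggren K` FALSE for every `K < 1`; `uniformLjunggren_exponent_ge_one`: any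
  `(K, C)` satisfying the matrix has `K ≥ 1`; `not_uniformLjunggren_one_of_lt_sixteenth`: at `K = 1`, `C ≥ 1/16` is necessary;
* `not_hallLang1728_of_lt_two` / `not_hallLang1728_ne_zero_of_lt_two`: `HallLang1728 κ` FALSE for every `κ < 2`;
  `hallLang1728_exponent_ge_two`: any `(κ, C)` satisfying the core's matrix has `κ ≥ 2`; `not_hallLang1728_two_of_lt`: at
  `κ = 2`, `C ≥ 1/128` is necessary.

### (9b) Where the family comes from, and why this road ENDS at `K = 1` / `κ = 2` (seat algebra, folder `NOTES.md`)
On the Pell conic `u² − D t² = 1` the coordinate ring is `ℚ(√D)[w, 1/w]`, `w = u + t√D` (`w̄ = 1/w`), and an integer-valued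
function is a Laurent polynomial `Σ cᵢ wⁱ` with `c₋ᵢ = σ(cᵢ)`; its size along the sequence `w = εᴰʲ` is `≍ εᴰ^{j·deg}`.  Laurent
solutions of `n² − D m⁴ = k` with `deg m = 1`, `m = a w + b + σ(a) w⁻¹`: writing `n = √D m² + p`, the degree count forces
`(m²)₀ = 0`, i.e. `N(a) = −b²/2`, and then `k = D b³ (4m + 3b)` identically (`deg k = deg m = 1`); `(D, a, b) = (2, √2/2, 1)`
is (9a) (`m = 2t + 1`, `k = 2(8t + 7)·…`: `n'² − 2m⁴ = 16t + 14` after removing the common factor), `(3, (1+√3)/2, 1)` gives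
`m = u + 3t + 1` on `u² − 3t² = 1` with the worse constant `1/36`, and in general the `K = 1` constant is `1/(4D²b³) ≤ 1/16`.
MASON–STOTHERS ON THE CONIC: for Laurent `n, m, k` of degrees `2μ, μ, κ` the polynomial triple `(w^{2μ}n)² − D(w^μ m)⁴ =
w^{4μ}k` has `8μ ≤ #roots − 1 ≤ 4μ + 2μ + (2κ + 1) − 1`, i.e. **`deg k ≥ deg m`**: NO family of this kind has `K`-value `> 1`
(`κ`-value `> 2`) — the Pell-boosted families stop exactly at the random-model = `ABC` threshold, just as Danilov's
Fermat–Pell family stops at Hall's exponent `1/2` (`Literature.Barriers.ABC.HallExponentSharp`: "the conjecture cannot be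
disproved by a polynomial parametrization … one does better with solutions parametrized by Fermat–Pell equations and thus
attains `θ = 1/2`", Elkies 2000 §4.1).  The extremal case `deg k = deg m = μ` is a genus-0 Belyi-type problem for each `μ`
(passport `[2^{4μ}] / [4^{2μ}] / [3μ, 3μ, 1^{2μ}]`); `μ = 2` over `ℚ(√2)` forces `a₁ = 0` (the condition `N(a₁) = −2/(3ρ²)`
needs `−6 ∈ N(ℚ(√D)^×)`, false for `D = 2, 3`, true for `D = 6`: `m = 6(8t² + 2t + 1)` on `u² − 6t² = 1`, constant `1/4032`) —
so larger `μ` changes only the constant, and whether `K = 1` / `κ = 2` fail for EVERY `C` (random model: yes, log-divergence at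
the threshold) stays open exactly as for Hall's conjecture (Danilov `0.97√x` vs. "every `c`").
LITERATURE: elementary, surely folklore (small values of `‖n²√2‖` along `n = 2t+1`, `t` Pell); no citation claimed (cycle-9 `lit search` ran degraded);
pointers: W. M. Schmidt, *Small fractional parts of polynomials* (CBMS 32, 1977); Zaharescu 1995 (`‖n²α‖ < n^{−2/3+ε}`).

### (9c) What the pin means for the line and the crux
* The core stub `stub_hallLang1728` (`∃ κ`) is untouched as a statement (`ABC ⟹` it with any `κ > 2`, p132209) but has NO
  sub-threshold regime left: false for every `κ < 2`, conjecturally false AT `κ = 2` for every `C`, `ABC`-true for `κ > 2`.  Any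
  proof of the core is a proof of Hall–Lang for the quartic twists of `32a/64a` AT THE CONJECTURAL EXPONENT — Lang's
  `ĥ(P) ≤ c·log|Δ_N|` with `c` pinned (`x ≍ N²` ⟺ `h_x(P) ≈ 2 log N = (2/3) log|Δ_N|`, `Δ_N = −64N³`) — not at some cheap exponent.
* Through `stub_hallLangGivesUL`/`stub_ulGivesUBQ` the crux receives `η < 1/(4K + 2) ≤ 1/6` (card's rate; `η = 1/(1 + 16K) ≤ 1/17`
  at the landed stub's rate) — the transfer costs a factor `≥ 6` in the saving even if Hall–Lang were known optimally.
* The family is OFF the crux fibre.  The crux feeds the transfer only through `(d, k, x, y) = (vw, aw, wZ², Y)` from coprime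
  violators `wZ⁴ = vY⁴ + a`; in Hall–Lang form `(x, N) = (vwY², avw²)` WITH `y = vw²YZ²`.  The Pell points do have
  `(x, N) = (1·2·(2t+1)², (8t+7)·1·2²)`, but `y = 8u(t+1)(2t+1) = 4(2t+1)Z²` needs `Z² = 2u(t+1)` — a square only sporadically
  (never among the first 60 members of the sequence, seat check; the other reading `(v, w) = (2, 1)`, `wZ² = 4u(t+1)`, holds
  exactly once there, at `t = 2`: the point `6⁴ − 2·5⁴ = 46`, `a = 46 > Z = 6`, no violator).  On the fibre the dials are
  different and ALSO pinned: `K = 1/2` (floor Dirichlet p131711, ceiling `ABC`: `Y ≪ (vw|a|)^{1/2+ε}`), i.e. Hall–Lang ratio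
  `log x/log|N| → 1` for dictionary images of ALL coprime solutions of `wZ⁴ = vY⁴ + a` with `v, w, a` free (random-model /
  `ABC` sup of the ratio over such "trident-A" points: `5/4`, at `v ≍ Z^{8/3}`, `w = 1`, `a = O(1)`; floor `1` from
  `N + 1 = Z⁴ ↦ (N, NZ²)`), while an actual `UBQ η`-violator maps to ratio `≥ (2 + 2η)/(4η) → ∞`.  So a core RESTRICTED to
  trident-shaped points would need only `κ > 5/4` heuristically — but "trident-shaped with `a, v, w ≤ Z^η`" is the crux itself
  (`stub_coreIffCrux`, p87895): the restriction that helps is exactly the one that gives back the crux.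
* THE DICTIONARY-RESTRICTED CORE IS CALIBRATED TOO (`Negative.HallLangTransferTrident`, LANDED p132837, inlined in § (9c′)):
  `TridentHallLang κ := ∃ C > 0, ∀ a v w Y Z ≥ 1, gcd(vY, wZ) = 1 → wZ⁴ = vY⁴ + a → vwY² ≤ C(avw²)^κ` — Hall–Lang demanded ONLY
  on the points the composition actually feeds to the core — is FALSE for every `κ < 6/5` (`not_tridentHallLang_of_lt_six_fifths`):
  the degree-7 polynomial family `Z = 40r⁷ + 140r⁶ + 252r⁵ + 280r⁴ + 210r³ + 105r² + 35r + 6`, `Y = 2r² + 2r + 1`,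
  `Z² + 1 = Y⁴·(100r⁶ + 300r⁵ + 485r⁴ + 470r³ + 309r² + 124r + 37)` (Hensel lift of `s ↦ s` modulo `(s²+1)⁴`, `s = 2r+1`;
  Mason–Stothers-extremal for `Z² + 1 = Y⁴c`), `v = c(Z² − 1)`, `w = a = 1`, coprime automatically, has `x = vY² ≍ r²⁴`,
  `N = v ≍ r²⁰`, ratio `→ 6/5` (`Z = 1 + m⁴` gives `7/6`; polynomial families stay below `5/4 =` random-model threshold `=`
  `ABC` ceiling `x ≲ a v^{5/4} w^{7/4}`).  So the restricted dial reads `[6/5 proved, 5/4 conjectural, ABC above 5/4]`, and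
  `TridentHallLang κ ⟹ UBQ η` exactly for `η < 4/(8κ + 1) ≤ 4/11`: restricting the core buys a factor in `η`, not a mechanism.
* `stub_reciprocitySieve` (stratum S0 of card `two-division-descent-anchor`, registered 23:45Z, landed p132232 by the lead's
  wave): TRUE and elementary — checked here independently incl. the degenerate corners (`Z = 0 ⟹ a = 0`; `Y = 0` or `v = 0 ⟹
  w = Z = a = 1`, claim reduces to `1 ≠ 0 ∧ IsSquare 1` in `ZMod p`); candidate proof attached to the item
  (evidence `ReciprocitySieve.lean`, 23:55Z).  Nothing in the line is refutable short of `¬ABC`; `-- Targets`: none stuck.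

### (9d) Open edges after cycle 9: (v') do `UniformLjunggren 1` / `HallLang1728 2` fail for EVERY constant? (random model: yes; families give
constants `≤ 1/16`, `≤ 1/128`; sporadic points `54379907² − 2·6201⁴ = −953` (`C ≥ 3.25` at `K = 1`), `239² − 2·13⁴ = −1` (`C ≥ 6.5`),
`(338, 6214)` on `y² = x³ − 2x` (`C ≥ 84.5` at `κ = 2`) — `example`s below); (vi) `ABC ⟹ UniformLjunggren K`, `K > 1`: formal (p132209). -/

section cycle9
open Summit.ABC.ABC.Theorems.TowerFourSubLiouville.Negative

/-! ### (9a), (9c′) — v20: the cycle-9 INLINED copies of `Negative.HallLangTransferPell` (p132424) and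
`Negative.HallLangTransferTrident` (p132837) are REMOVED (the modules are imported at the top of this file; the restatements below
resolve to the landed theorems by name; the 200 kB limit of crux workfiles forced the de-duplication). -/

/-! ### Restatements -/

/-- **(9a)** The Pell-boosted identity and its Hall–Lang form (LANDED p132424). -/
example {u t : ℤ} (h : u ^ 2 = 2 * t ^ 2 + 1) :
    (4 * u * (t + 1)) ^ 2 - 2 * (2 * t + 1) ^ 4 = 16 * t + 14 ∧
    (8 * u * (t + 1) * (2 * t + 1)) ^ 2 = (2 * (2 * t + 1) ^ 2) ^ 3 + (32 * t + 28) * (2 * (2 * t + 1) ^ 2) :=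
  ⟨pellBoost_identity h, pellBoost_onCurve h⟩

/-- **(9a)** The Pell sequence is unbounded (so the family is infinite). -/
example (M : ℝ) : ∃ u t : ℤ, u ^ 2 = 2 * t ^ 2 + 1 ∧ 1 ≤ u ∧ 1 ≤ t ∧ M ≤ (t : ℝ) := pellBoost_exists_ge M

/-- **(9a)** `UniformLjunggren K` (verbatim `SketchIdeator5.UniformLjunggren K`) fails for every `K < 1` … -/
example (K : ℝ) (hK : K < 1) :
    ¬ ∃ C : ℝ, 0 < C ∧ ∀ d k x y : ℤ, ¬ IsSquare d → k ≠ 0 → x ^ 2 - d * y ^ 4 = k →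
      (|y| : ℝ) ≤ C * ((|d| * |k| : ℤ) : ℝ) ^ K :=
  not_uniformLjunggren_of_lt_one K hK

/-- … and at `K = 1` needs `C ≥ 1/16`. -/
example (C : ℝ) (hC : C < 1 / 16) :
    ¬ ∀ d k x y : ℤ, ¬ IsSquare d → k ≠ 0 → x ^ 2 - d * y ^ 4 = k →
      (|y| : ℝ) ≤ C * ((|d| * |k| : ℤ) : ℝ) ^ (1 : ℝ) :=
  not_uniformLjunggren_one_of_lt_sixteenth C hC

/-- **(9a)** The registered core stub's matrix `HallLang1728 κ` fails for every `κ < 2` … -/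
example (κ : ℝ) (hκ : κ < 2) :
    ¬ ∃ C : ℝ, 0 < C ∧ ∀ N x y : ℤ, N ≠ 0 → y ^ 2 = x ^ 3 + N * x → (|x| : ℝ) ≤ C * (|N| : ℝ) ^ κ :=
  not_hallLang1728_of_lt_two κ hκ

/-- … also in ideator 4's `y ≠ 0` form … -/
example (κ : ℝ) (hκ : κ < 2) :
    ¬ ∃ C : ℝ, 0 < C ∧ ∀ N x y : ℤ, N ≠ 0 → y ≠ 0 → y ^ 2 = x ^ 3 + N * x → (|x| : ℝ) ≤ C * (|N| : ℝ) ^ κ :=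
  not_hallLang1728_ne_zero_of_lt_two κ hκ

/-- … so any witness `(κ, C)` of the core `stub_hallLang1728` has `κ ≥ 2` … -/
example (κ C : ℝ) (h : ∀ N x y : ℤ, N ≠ 0 → y ^ 2 = x ^ 3 + N * x → (|x| : ℝ) ≤ C * (|N| : ℝ) ^ κ) : 2 ≤ κ :=
  hallLang1728_exponent_ge_two κ C h

/-- … and at `κ = 2` needs `C ≥ 1/128`. -/
example (C : ℝ) (hC : C < 1 / 128) :
    ¬ ∀ N x y : ℤ, N ≠ 0 → y ^ 2 = x ^ 3 + N * x → (|x| : ℝ) ≤ C * (|N| : ℝ) ^ (2 : ℝ) :=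
  not_hallLang1728_two_of_lt C hC

/-- **(9b)** The `D = 6`, `μ = 2` Laurent family (constant `1/4032`, nothing new): on `u² = 6t² + 1`,
`n² − 6·m⁴ = k` with `m = 6(8t² + 2t + 1)`, `n = 48u(48t³ + 24t² + 11t + 1)`, `k = −288(112t² + 40t + 19)` (seat script,
checked on six members); first member `(u, t) = (5, 2)`: `120720² − 6·222⁴ = −157536`. -/
example : (48 * 5 * (48 * 2 ^ 3 + 24 * 2 ^ 2 + 11 * 2 + 1) : ℤ) = 120720 ∧ (6 * (8 * 2 ^ 2 + 2 * 2 + 1) : ℤ) = 222 ∧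
    (288 * (112 * 2 ^ 2 + 40 * 2 + 19) : ℤ) = 157536 ∧ (120720 : ℤ) ^ 2 - 6 * 222 ^ 4 = -157536 := by norm_num

/-- **(9d)(v')** Single points beating the family constants at the thresholds: `54379907² − 2·6201⁴ = −953` has
`y = 6201 > 3·(2·953)` (`K = 1`, `C ≥ 3.25`); `239² − 2·13⁴ = −1` has `y = 13 = 6.5·(2·1)`; and `(338, 6214)` on
`y² = x³ − 2x` has `x = 338 = 84.5·|N|²`. -/
example : (54379907 : ℤ) ^ 2 - 2 * 6201 ^ 4 = -953 ∧ (3 : ℤ) * (2 * 953) < 6201 ∧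
    (239 : ℤ) ^ 2 - 2 * 13 ^ 4 = -1 ∧ (6214 : ℤ) ^ 2 = 338 ^ 3 + (-2) * 338 ∧ (84 : ℤ) * (-2) ^ 2 < 338 := by norm_num

end cycle9

/-! ## Cycle 10 (refuter-cdisprove-stmt-ABC-1649-g10-0, 2026-08-17): the dictionary-restricted dial PINNED at `5/4` by a
Pell-boosted trident family (LANDED `Negative.HallLangTransferTridentPell`, p133548); the first TORUS corner `(8/3, 0)` of the
two-exponent diagram; the involution-symmetric torus identities of the first ceiling-LOWERING shape (`η = 4/3`) censused

Context: crux OPEN, `ABC ⟹ crux`; line `SketchIdeator5` dead at `stub_hallLang1728`; this cycle pins the DICTIONARY-restricted transfer dial.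

### (10a) LANDED `Negative.HallLangTransferTridentPell` (p133548): the Pell-boosted trident family
`tridentPell_identity`:  **`u² + 1 = 2t²  ⟹  (u(t² + 1))² + 1 = t⁴ (2t² + 3)`**.  Along the NEGATIVE Pell sequence
`(u,t) = (1,1), (7,5), (41,29), (239,169), …` (`negPell_exists`, step `(u,t) ↦ (3u+4t, 2u+3t)`) put `Z = u(t²+1)`, `Y = t`,
`c = 2t² + 3` (`Z² + 1 = Y⁴c`; `182² + 1 = 5⁴·53`), `w = a = 1`, `v = c(Z−1)(Z+1)` (`trident_equation`: `Z⁴ = vY⁴ + 1`;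
`trident_coprime` gives `gcd(vY, Z) = 1`).  Sizes: `t³ ≤ Z ≤ 4t³`, `v ≤ 100t⁸`, exactly `v + 4t² + 6 = t⁴c²`; so `x = vY² ∼ 4t¹⁰`
against `N = v ∼ 4t⁸`: Hall–Lang ratio `→ 5/4`, `x/N^{5/4} = t²/v^{1/4} ↗ 2^{−1/2}` (seat check on seven members:
`1.2239 … 1.2465`, `0.6868 → 0.70711`).
* `not_tridentHallLang_of_lt_five_fourths`: the dictionary-restricted core (matrix verbatim as in p132837) is FALSE for every
  `κ < 5/4`; `tridentHallLang_exponent_ge_five_fourths`; `not_tridentHallLang_five_fourths_of_sq_lt_half`: at `κ = 5/4`, `2C² ≥ 1`.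
* `not_ubq₂_corner_eightThirds_zero` / `ubq₂_false_of_corner₅`: in the two-exponent diagram (§ (5b'), `Negative.TwoExponentDiagram`)
  the cubic-height corner `(3, 0)` of `bezoutFamily₃` improves to **`(8/3, 0)`**: value EXACTLY `1` at coefficient height
  `v ≤ 100 Z^{8/3}` — the first corner supplied by a TORUS identity, ON the torus Mason–Stothers line of `Negative.TorusEnemyFloor`
  written with separate exponents, `(3/4)θ_v + (1/4)θ_w + φ ≥ 2` (`θ_v = 8/3`, `θ_w = φ = 0`; weights from
  `d_Y = d_Z + (d_w − d_v)/4`), which for `w = 1` is also the random-model boundary.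
The restricted dial now reads `[5/4 = PROVED floor = random-model threshold = ABC ceiling]` — pinned, like the unrestricted
(`κ = 2`) and crux-fibre (`K = 1/2`) dials; for the line, `TridentHallLang κ ⟹ UBQ η` only for `η < 4/(8κ+1) ≤ 4/11`.

### (10b) Why the family is "free": even functions on the conic are POLYNOMIALS IN `u` (seat algebra, folder `torus/`)
On `𝒞 : u² − Dt² = n` the involution `ι : t ↦ −t` fixes `u`; `ι`-even coordinate functions are exactly `ℚ[u]` (`t² = (u²−n)/D`),
odd ones `t·ℚ[u]`, and Laurent degree (growth along the unit sequence) = degree in `u`.  So an `ι`-symmetric torus identity is a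
ONE-VARIABLE polynomial identity in `u` in which `Y` or `Z` carries an odd power of `t = √((u²−n)/D)` — a `ℙ¹`-identity with a
prescribed factor `(u² − n)^{odd/2}`; Mason–Stothers in `u` is Belyi-tight, and the torus gain over § (5b) is exactly that the branch
points `u = ±√n` of `𝒞 → ℙ¹_u` absorb ramification.  Trident-Pell is `Z = u(u²+3)/2`, `Y⁴ = t⁴ = (u²+1)²/4`, `c = u² + 4` on
`u² + 1 = 2t²`: the classical cubic `X(X+3)² + 4 = (X+1)²(X+4)` at `X = u²` (one dessin) — rational for free; `bezoutFamily₃` is the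
`ℙ¹` point `(3,0)`, the conic moves it to `(8/3, 0)`.  (p132424 is the same phenomenon for `x² − dy⁴ = k`.)

### (10c) Census (superseded and CERTIFIED by CENSUS-c14.md): torus Mason–Stothers allows, with `w` CONSTANT, the tight shapes
`(d_Z, d_Y, d_v, d_w, d_a) = (3,1,8,0,0)` (trident-Pell, `η_fam = 8/3`), `S₁ = (3,2,4,0,3)` (`4/3 < 3/2`), `(4,3,4,0,5)` (`5/4`), `(7,5,8,0,8)` (`8/7`), … —
`w`-constant torus families could lower the uniform ceiling towards `8/7`, never to `1`.  Cycle 10 found numerically (homotopy + LLL, seat folder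
`torus/`) that the `ι`-symmetric parts of `S₁` (patterns A: 33 dessins, one achiral; B: 26 dessins, two achiral) have NO rational member; cycle 14
re-derived this arithmetically and extended it to the asymmetric dessins of torus width 2.  For provers nothing changes.

### (10d) Open edges after cycle 10 — (vii) asymmetric / wider torus shapes: DECIDED EMPTY over `ℚ` through width 2 by § Cycle 14. -/

section cycle10
open Summit.ABC.ABC.Theorems.TowerFourSubLiouville.Negative

/-- **(10a)** The Pell-boosted trident identity and one step of the negative Pell recursion (LANDED p133548). -/
example {u t : ℕ} (h : u ^ 2 + 1 = 2 * t ^ 2) :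
    (u * (t ^ 2 + 1)) ^ 2 + 1 = t ^ 4 * (2 * t ^ 2 + 3) ∧ (3 * u + 4 * t) ^ 2 + 1 = 2 * (2 * u + 3 * t) ^ 2 :=
  ⟨tridentPell_identity h, negPell_step h⟩

/-- **(10a)** The family is infinite and carries all the bookkeeping. -/
example (M : ℝ) : ∃ t Z Zm : ℕ, 1 ≤ t ∧ M ≤ (t : ℝ) ∧ Z = Zm + 1 ∧ 0 < Zm ∧
    Z ^ 2 + 1 = t ^ 4 * (2 * t ^ 2 + 3) ∧ t ^ 3 ≤ Z ∧
    (2 * t ^ 2 + 3) * Zm * (Z + 1) ≤ 100 * t ^ 8 ∧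
    (2 * t ^ 2 + 3) * Zm * (Z + 1) ≤ t ^ 4 * (2 * t ^ 2 + 3) ^ 2 :=
  exists_tridentPell M

/-- **(10a)** The dictionary-restricted core `TridentHallLang κ` fails for every `κ < 5/4` (was: `κ < 6/5`, p132837) … -/
example (κ : ℝ) (hκ : κ < 5 / 4) :
    ¬ ∃ C : ℝ, 0 < C ∧ ∀ a v w Y Z : ℕ, 0 < a → 0 < v → 0 < w → 0 < Y → 0 < Z →
        Nat.Coprime (v * Y) (w * Z) → w * Z ^ 4 = v * Y ^ 4 + a →
        ((v * w * Y ^ 2 : ℕ) : ℝ) ≤ C * ((a * v * w ^ 2 : ℕ) : ℝ) ^ κ :=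
  not_tridentHallLang_of_lt_five_fourths κ hκ

/-- … so any witness `(κ, C)` has `κ ≥ 5/4`, and at `κ = 5/4` the constant must satisfy `2C² ≥ 1`. -/
example (κ C : ℝ) (hC : 0 < C)
    (h : ∀ a v w Y Z : ℕ, 0 < a → 0 < v → 0 < w → 0 < Y → 0 < Z →
        Nat.Coprime (v * Y) (w * Z) → w * Z ^ 4 = v * Y ^ 4 + a →
        ((v * w * Y ^ 2 : ℕ) : ℝ) ≤ C * ((a * v * w ^ 2 : ℕ) : ℝ) ^ κ) : 5 / 4 ≤ κ :=
  tridentHallLang_exponent_ge_five_fourths κ C hC h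

example (C : ℝ) (hC2 : 2 * C ^ 2 < 1) :
    ¬ ∀ a v w Y Z : ℕ, 0 < a → 0 < v → 0 < w → 0 < Y → 0 < Z →
        Nat.Coprime (v * Y) (w * Z) → w * Z ^ 4 = v * Y ^ 4 + a →
        ((v * w * Y ^ 2 : ℕ) : ℝ) ≤ C * ((a * v * w ^ 2 : ℕ) : ℝ) ^ (5 / 4 : ℝ) :=
  not_tridentHallLang_five_fourths_of_sq_lt_half C hC2

/-- **(10a)** The five-corner FALSE region of the two-exponent diagram (`(8/3, 0)` replacing `(3, 0)`). -/
example {θ φ : ℝ} (hc : (8 / 3 < θ ∧ 0 ≤ φ) ∨ (2 < θ ∧ 1 < φ) ∨ (1 < θ ∧ 3 / 2 < φ) ∨ (0 < θ ∧ 2 < φ)) :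
    ¬ ∃ Z₀ : ℕ, ∀ v w Y Z : ℕ, Z₀ ≤ Z → 0 < v → 0 < w → 0 < Y → Nat.Coprime (v * Y) (w * Z) →
      ((max v w : ℕ) : ℝ) ≤ (Z : ℝ) ^ θ → w * Z ^ 4 ≠ v * Y ^ 4 →
      (Z : ℝ) ^ φ < |((w * Z ^ 4 : ℕ) : ℝ) - ((v * Y ^ 4 : ℕ) : ℝ)| :=
  ubq₂_false_of_corner₅ hc

/-- **(10b)** Trident-Pell on the `u`-line: the classical cubic `X(X+3)² + 4 = (X+1)²(X+4)` at `X = u²`; and the cycle-9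
`w`-identity of the same family, `(x+1)⁴(x²+14x+1) − (x³+9x²−9x−1)² = 256x³` at `x = w²`. -/
example (u x : ℤ) : (u * (u ^ 2 + 3)) ^ 2 + 4 = (u ^ 2 + 1) ^ 2 * (u ^ 2 + 4) ∧
    (x + 1) ^ 4 * (x ^ 2 + 14 * x + 1) - (x ^ 3 + 9 * x ^ 2 - 9 * x - 1) ^ 2 = 256 * x ^ 3 := by
  constructor <;> ring

end cycle10


/-! ## Cycle 11 (refuter-cdisprove-stmt-ABC-1649-g11-0, 2026-08-17): the `ABC` half-plane of the two-exponent diagram PROVED and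
the strategist's moving-target ladder sandwiched (LANDED `Negative.TwoExponentSandwich`, p137739); the degenerate column `θ = 0`
(LANDED `Negative.TwoExponentThetaZero`, p137751); census of the `s ↦ −s` symmetric tight ℙ¹ identity shapes (no new ℙ¹ corner);
and the NEW CORNER `(2, 0)` from the torus shape `(1,1,2,2,0)` (LANDED `Negative.TorusBezoutCorner`, p138228)

Context: the strategist (`STRATEGY-CENSUS.md`, `StrategistSketch.lean`) typed two rungs ABOVE the core — `UniformMovingThue4` (S⁺2, saving `Z^{1−ε}`) and `UniformMovingRoth4` (S⁺3, saving `Z^{2−ε}`), edges `S⁺3 ⟹ S⁺2 ⟹ UBQ ⟹ crux` kernel-checked; this cycle attacks the ladder and the `(θ, φ)` plane.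

### (11a) LANDED `Negative.TwoExponentSandwich` (p137739): `ABC ⟹ UBQ₂(θ, φ)` on the whole half-plane `(9/4)θ + φ < 2`
`ubq₂_of_abc`: for `θ ≥ 0`, `(9/4)θ + φ < 2`, `ABC` gives `UBQ₂(θ, φ)` (matrix verbatim as in `Negative.TwoExponentDiagram`).  Proof
(`abc_enemy_numerics`): an enemy `a + vY⁴ = wZ⁴` (either order; `coprime_binomial`: `gcd(vY⁴, wZ⁴) = 1`) is an abc triple with `c ≥ Z⁴`
and `rad ≤ a·v·w·Y·Z` (`rad_binomial_dvd`), `Y⁴ ≤ 2Z^{θ+4}`; at `δ = s/16`, `s = 2 − (9/4)θ − φ`, abc yields `Z¹⁶ < K⁴2^{1+δ}Z^{16−3s}`.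
So the diagram's conditional side, stated in its docstring since cycle 5, is now a theorem; corollaries `ubq_of_abc` (diagonal, every
`η < 8/13`), **`uniformMovingRoth4_of_abc`** (`η(ε) = ε/5`; any `η < 4ε/9`) and **`uniformMovingThue4_of_abc`** (`η(ε) = (1+ε)/3`; any
`η < 4(1+ε)/9`), matrices of `StrategistSketch` verbatim.  **The ladder is sandwiched `ABC ⟹ S⁺3 ⟹ S⁺2 ⟹ UBQ ⟹ crux`: no rung is
refutable short of `¬ABC`** — the status of every typed strengthening on record (`HallLang1728 ⟺ UniformLjunggren`, Lang–Waldschmidt₄,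
`UniformSadicTowerFour`, and now the moving-target rungs).
Unconditional side (landed corners): a Roth-rung witness has `η(ε) ≤ 1` for `ε < 1/2` (`movingRoth4_budget_le_one`, corner `(1,3/2)`) and
`≤ 2` for `ε < 1` (`_le_two`, `(2,1)`); a Thue-rung witness `η(ε) ≤ 8/3` (`movingThue4_budget_le`, torus corner `(8/3,0)`); the Roth
rung's `0 < ε` is load-bearing (`movingRoth4_false_without_pos_eps`, `(0,2)`); neither rung survives `∃η ↦ ∀η`
(`not_uniformMovingRoth4_forall_eta`, `not_uniformMovingThue4_forall_eta`).  Dials of the ladder, for the record: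
`S⁺3`: ABC-floor `4ε/9` ≤ truth ≤ proved ceiling `1` (ε < 1/2); random model `η < ε`.  `S⁺2`: `4(1+ε)/9` ≤ truth ≤ `8/3`; random model `1 + ε`.

### (11b) LANDED `Negative.TwoExponentThetaZero` (p137751): the column `θ = 0` is pinned at `φ = 3`
At `θ = 0` the budget `max(v,w) ≤ 1` leaves the form `Z⁴ − Y⁴`: `UBQ₂(0, φ)` holds iff `φ ≤ 3` (`ubq₂_theta_zero_of_le_three`, `Z₀ = 2`;
`not_ubq₂_theta_zero_of_three_lt`, witness `Y = Z − 1`, value `4Z³ − 6Z² + 4Z − 1`).  So the Dirichlet corner `(0,2)` is a limit `θ → 0⁺`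
(forms `(1,2)`, `(8,1)` need height `8 ≤ Z^θ`), the FALSE region `{θ > 0, φ > 2}` is not closed at its corner, and the `θ = 0` slice of the
matrix is NOT the per-form Roth box (`stub_fixedFormsRoth`: any fixed `H`, every `φ < 2`).  Degenerate-instance bookkeeping only.

### (11c) Census: the `s ↦ −s` symmetric tight identity shapes on `ℙ¹` (seat folder `shapes/`; kit j021711 smoke, j021837 full)
Every landed ℙ¹ corner comes from a TIGHT (Belyi) identity `wZ⁴ − vY⁴ = a`, `deg Z = deg Y = z`, `deg v = deg w = d`, `deg a = e`,
`d + e = 2z + 1` (Riemann–Hurwitz for `f = wZ⁴/(vY⁴)`, degree `4z + d`, passport `[4^z,1^d]² [4z+d−e, 1^e]`), supplying the corner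
`(θ, φ) = (d/z, e/z)` on the Mason–Stothers line `θ + φ = 2 + 1/z`; and all three rational ones are SYMMETRIC under an involution
`s ↦ −s` exchanging `(w, Z) ↔ (v, Y)`: `Z = P(s)`, `Y = P(−s)`, `w = Q(s)`, `v = (−1)^d Q(−s)`, `a = Q(s)P(s)⁴ − Q(−s)P(−s)⁴` (odd or even
part).  Normal forms (`ring`-checked below): `(z; d, e) = (1;2,1)`: `(4s²+8s+5)(2s−1)⁴ − (4s²−8s+5)(2s+1)⁴ = −64s` (`padeFamily₁`, corner
`(2,1)`); `(1;3,0)`: `(20s³+40s²+29s+8)(2s−1)⁴ − (20s³−40s²+29s−8)(2s+1)⁴ = 16` (`bezoutFamily₃`, `(3,0)`); `(2;2,3)`: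
`(20s²+40s+21)(10s²−5s−2)⁴ − (20s²−40s+21)(10s²+5s−2)⁴ = −2000s(15s²−4)` (`padeFamily₂`, `(1,3/2)`).
PADÉ FORMULATION (this cycle): with `x = 1/s`, `A(x) = x^d Q(1/x)` normalised `A(0) = 1`, `A'(0) = 2` (scaling), `Π(x) = x^z P(1/x)`, the
shape holds iff `E(x) := Π(x)·g(x) − Π(−x) = O(x^{2z+2d−1})`, `g := (A(x)/A(−x))^{1/4}`; since `g(x)g(−x) = 1` forces `E(−x) = −E(x)/g(x)`,
the first non-vanishing order of `E` is odd, the symmetric `[z/z]` Padé conditions are `e₁ = e₃ = … = e_{2z−1} = 0` (linear in `Π`), and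
the shape is the `d − 1` extra conditions `e_{2z+1} = … = e_{2z+2d−3} = 0` on the `d − 1` moduli of `A` — rigid, as it must be.
* `d = 2` (corners `(2/z, 2 − 1/z)`, marching to `(0,2)` along `φ = 2 − θ/2`): ONE modulus `q = A''(0)/2`, condition = the determinant `D_z(q)` of the
  augmented `(z+1) × (z+1)` system (seat `shapes/det_d2.py`; sympy j021711/j021837): `D₁ ∝ 4q − 5` (`padeFamily₁`), `D₂ ∝ 20q − 21` (`padeFamily₂`),
  `D₃ ∝ 320q³ − 1008q² + 1116q − 429`, `D₄ ∝ 6720q³ − 20592q² + 21164q − 7293`, `D₅`, `D₆` irreducible sextics, `D₇` irreducible of degree `10` —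
  **no rational root for `z = 3, …, 7`**: the symmetric `d = 2` identities exist over `ℚ` EXACTLY for `z ≤ 2`; the march of corners stops at `(1, 3/2)`.
* `d ≥ 3` (40-digit multistart Newton + rational recognition, kit **j021837**, 22 shapes `z ≤ 7`): all real symmetric solutions IRRATIONAL (`(2;3,2)` cubic ✓,
  `(2;5,0)`, `(3;3,4)`, `(3;5,2)`, `(4;3,6)`, `(4;5,4)`, `(5;3,8)`, `(5;5,6)`, `(6;5,8)`, `(6;7,6)`; none at all for the other twelve); so no diagonal-lowering
  shape (`5/4`, `6/5`, `7/5`, `4/3`, `7/6`) and no low-`φ` lobe shape has a rational symmetric member — ceiling `3/2` (p106450).  Asymmetric dessins and the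
  torus: § Cycle 14 (CENSUS-c14.md, rigorous mod `p`, complete through ℙ¹ width 4 / torus width 2).

### (11d) Why no explicit enemy family approaches `(0,2)` from below — CORRECTED in v28 (§ (16c))
One-variable identity families cannot beat `θ + φ = 2 + 1/z` (ℙ¹) / `= 2` (torus); cycle 11's "anchoring at a rational `p/q` never goes below `Z²`" holds for
BOUNDED `q` only — anchored at the value-`1` corner family (`q = Z₀ → ∞`) the next Padé convergent has value `≍ 5Z²/Z₀²`: the torus-tight line points
`(2/(6z+1), 12z/(6z+1))` of §§ Cycle 16–17.  What stays true: no construction goes strictly BELOW the line (negative-side face of the strategist's B4).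

### (11f) LANDED `Negative.TorusBezoutCorner` (p138228): the corner `(2, 0)` — value EXACTLY `1` at quadratic coefficient height
The torus analogue of (11c) for the smallest shape with BOTH coefficients non-constant and constant value,
`(d_Z, d_Y, d_v, d_w, d_a) = (1, 1, 2, 2, 0)` (outside the cycle-4 all-width-1 and cycle-10 `w`-constant censuses; tight for the torus
Mason–Stothers inequality `(3/4)θ_v + (1/4)θ_w + φ ≥ 2` with `θ_v = θ_w = 2`, i.e. ON the random-model boundary `θ + φ = 2`), has in its
`ι`-symmetric part the `u`-line Belyi maps `w(u)(u² − n)²/(v(u)(u + y₀)⁴)` (passport `[2,2,1,1] [4,1,1] [6]`; seat `torus2/caseA.py`,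
`torusk.py`): a 6 × 6 rigid system with TWO real dessins for `n = +1` resp. their twins for `n = −1`, ALL RATIONAL up to scaling, the
simplest being `y₀ = 0`:
  **`(2u² + 1)(u² − 1)² − (2u² − 3)u⁴ = 1`**  (Bezout for `u⁴`, `(u² − 1)²` — cofactors of degree two by parity; `bezout_sq_identity`),
and on the Pell conic `u² − 2t² = 1` (`(u²−1)² = 4t⁴`; `(3,2), (17,12), (99,70), …`):
  **`(16t² + 12)·t⁴ − (4t² − 1)·u⁴ = 1`**  (`pellBezout_identity`; `76·2⁴ − 15·3⁴ = 1`, `2316·12⁴ − 575·17⁴ = 1`; twin on the negative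
  conic `u² + 1 = 2t²`: `(4t² + 1)u⁴ − (16t² − 12)t⁴ = 1`, `101·7⁴ − 388·5⁴ = 1`).
So `Z = t`, `Y = u`, `w = 16Z² + 12 ≤ 28Z²`, `v = 4Z² − 1`, value `1` (coprimality automatic): `exists_pellBezout`.  Consequences (all landed):
* `not_ubq₂_corner_two_zero`: **`UBQ₂(θ, φ)` FALSE for every `θ > 2`, `φ ≥ 0`** — supersedes `(3,0)` (bezoutFamily₃), `(8/3,0)` (trident–Pell)
  and `(2,1)` (padeFamily₁); `ubq₂_false_of_corner₆`: the proved FALSE region is the union of THREE lobes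
  `{θ > 2, φ ≥ 0} ∪ {θ > 1, φ > 3/2} ∪ {θ > 0, φ > 2}`; a proved point of the random-model line `θ + φ = 2` at positive height (the other one being the Dirichlet limit corner `(0,2)`); with (11a) the truth on
  the axis `φ = 0` is bracketed `8/9 ≤ θ* ≤ 2`.
* `movingThue4_budget_le_two`: the Thue rung of the ladder has budget `η(ε) ≤ 2` at every `ε ≤ 1` (sharpens (11a)'s `8/3`).
* `not_ubqOn_unitSlice_of_two_lt`: the strategist's Dc1 ON-piece `UBQOn unitSlice η` (core restricted to `wZ⁴ − vY⁴ ∣ 4`, matrix verbatim)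
  is FALSE for every `η > 2`: value-`1` enemies are norm-one units `(2wZ⁴ − 1) + 2Y²Z²√(vw)` and here they come from the POLYNOMIAL Pell
  identity `(32Z⁶ + 24Z⁴ − 1)² − (4Z²−1)(16Z²+12)(4Z⁴ + 2Z²)² = 1` (`pellBezout_unit_identity`) — a unit of size `≍ D^{3/2}`, `D = vw ≍ Z⁴`,
  whose `W`-coordinate `2(2Z²+1)Z²` is doubly square exactly when `2Z² + 1 = Y²`; so S⁺7's "doubly-quartic unit" residue is realised
  infinitely often at `η = 2` and any unit-slice argument must use `vw > Z^{4+δ}`.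
Diagonal value of the family: `2` (> `3/2`): the uniform ceiling is unchanged.  The torus shapes `(k, k, k+1, k+1, k−1)` lie ON `θ + φ = 2` with corners
`(1 + 1/k, 1 − 1/k)` (`k = 3` would LOWER THE UNIFORM CEILING to `4/3`); their `ι`-symmetric parts (kit j022054) and doubly-even sub-classes have NO rational
member for `k = 2, 3, 4` resp. `k = 3, 5, 7` — superseded and certified by the exhaustive torus width-2 census of § Cycle 14 (CENSUS-c14.md).

### (11e) Open edges after cycle 11: (viii)/(x) asymmetric dessins and wider torus shapes — DECIDED EMPTY over `ℚ` through the widths of § Cycle 14;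
(ix) an existence proof of enemies at `(θ, 2 − cθ)`, `θ → 0` (metric Diophantine approximation for `q·(w/v)^{1/4}`) would pin the Roth-rung budget at
`η(ε) ≤ ε/c` — open. -/

section cycle11
open Summit.ABC.ABC.Theorems.TowerFourSubLiouville.Negative

/-- **(11a)** `ABC ⟹ UBQ₂(θ, φ)` on the half-plane `(9/4)θ + φ < 2` (LANDED p137739). -/
example (habc : ABC) {θ φ : ℝ} (hθ : 0 ≤ θ) (hline : 9 / 4 * θ + φ < 2) :
    ∃ Z₀ : ℕ, ∀ v w Y Z : ℕ, Z₀ ≤ Z → 0 < v → 0 < w → 0 < Y → Nat.Coprime (v * Y) (w * Z) →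
      ((max v w : ℕ) : ℝ) ≤ (Z : ℝ) ^ θ → w * Z ^ 4 ≠ v * Y ^ 4 →
      (Z : ℝ) ^ φ < |((w * Z ^ 4 : ℕ) : ℝ) - ((v * Y ^ 4 : ℕ) : ℝ)| :=
  ubq₂_of_abc habc hθ hline

/-- **(11a)** … hence `ABC ⟹ UBQ η` for every `0 ≤ η < 8/13`, and with `crux_of_abc` / `stub_transfer` the diagonal sandwich. -/
example (habc : ABC) {η : ℝ} (hη0 : 0 ≤ η) (hη : η < 8 / 13) :
    ∃ Z₀ : ℕ, ∀ v w Y Z : ℕ, Z₀ ≤ Z → 0 < v → 0 < w → 0 < Y → Nat.Coprime (v * Y) (w * Z) →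
      ((max v w : ℕ) : ℝ) ≤ (Z : ℝ) ^ η → w * Z ^ 4 ≠ v * Y ^ 4 →
      (Z : ℝ) ^ η < |((w * Z ^ 4 : ℕ) : ℝ) - ((v * Y ^ 4 : ℕ) : ℝ)| :=
  ubq_of_abc habc hη0 hη

/-- **(11a)** `ABC ⟹ UniformMovingRoth4` (S⁺3 of `StrategistSketch`, matrix verbatim) with budget `η(ε) = ε/5` … -/
example (habc : ABC) :
    ∀ ε : ℝ, 0 < ε → ε < 1 → ∃ η : ℝ, 0 < η ∧ ∃ Z₀ : ℕ, ∀ v w Y Z : ℕ, Z₀ ≤ Z → 0 < v → 0 < w → 0 < Y →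
      Nat.Coprime (v * Y) (w * Z) → ((max v w : ℕ) : ℝ) ≤ (Z : ℝ) ^ η → w * Z ^ 4 ≠ v * Y ^ 4 →
      (Z : ℝ) ^ (2 - ε) < |((w * Z ^ 4 : ℕ) : ℝ) - ((v * Y ^ 4 : ℕ) : ℝ)| :=
  uniformMovingRoth4_of_abc habc

/-- … and `ABC ⟹ UniformMovingThue4` (S⁺2) with budget `η(ε) = (1+ε)/3`. -/
example (habc : ABC) :
    ∀ ε : ℝ, 0 < ε → ε < 1 → ∃ η : ℝ, 0 < η ∧ ∃ Z₀ : ℕ, ∀ v w Y Z : ℕ, Z₀ ≤ Z → 0 < v → 0 < w → 0 < Y →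
      Nat.Coprime (v * Y) (w * Z) → ((max v w : ℕ) : ℝ) ≤ (Z : ℝ) ^ η → w * Z ^ 4 ≠ v * Y ^ 4 →
      (Z : ℝ) ^ (1 - ε) < |((w * Z ^ 4 : ℕ) : ℝ) - ((v * Y ^ 4 : ℕ) : ℝ)| :=
  uniformMovingThue4_of_abc habc

/-- **(11a)** Unconditional ceilings on the ladder's budgets: Roth rung `η ≤ 1` at `ε < 1/2`; Thue rung `η ≤ 8/3`; and the
Roth rung with `∀ η` in place of `∃ η` is false. -/
example {ε η : ℝ} (hε : ε < 1 / 2) (hη : 1 < η) :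
    ¬ ∃ Z₀ : ℕ, ∀ v w Y Z : ℕ, Z₀ ≤ Z → 0 < v → 0 < w → 0 < Y → Nat.Coprime (v * Y) (w * Z) →
      ((max v w : ℕ) : ℝ) ≤ (Z : ℝ) ^ η → w * Z ^ 4 ≠ v * Y ^ 4 →
      (Z : ℝ) ^ (2 - ε) < |((w * Z ^ 4 : ℕ) : ℝ) - ((v * Y ^ 4 : ℕ) : ℝ)| :=
  movingRoth4_budget_le_one hε hη

example {ε η : ℝ} (hε : ε ≤ 1) (hη : 8 / 3 < η) :
    ¬ ∃ Z₀ : ℕ, ∀ v w Y Z : ℕ, Z₀ ≤ Z → 0 < v → 0 < w → 0 < Y → Nat.Coprime (v * Y) (w * Z) →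
      ((max v w : ℕ) : ℝ) ≤ (Z : ℝ) ^ η → w * Z ^ 4 ≠ v * Y ^ 4 →
      (Z : ℝ) ^ (1 - ε) < |((w * Z ^ 4 : ℕ) : ℝ) - ((v * Y ^ 4 : ℕ) : ℝ)| :=
  movingThue4_budget_le hε hη

example : ¬ ∀ ε : ℝ, 0 < ε → ε < 1 → ∀ η : ℝ, 0 < η → ∃ Z₀ : ℕ, ∀ v w Y Z : ℕ, Z₀ ≤ Z → 0 < v → 0 < w → 0 < Y →
      Nat.Coprime (v * Y) (w * Z) → ((max v w : ℕ) : ℝ) ≤ (Z : ℝ) ^ η → w * Z ^ 4 ≠ v * Y ^ 4 →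
      (Z : ℝ) ^ (2 - ε) < |((w * Z ^ 4 : ℕ) : ℝ) - ((v * Y ^ 4 : ℕ) : ℝ)| :=
  not_uniformMovingRoth4_forall_eta

/-- **(11b)** The column `θ = 0` is pinned at `φ = 3` (LANDED p137751). -/
example {φ : ℝ} (hφ : φ ≤ 3) :
    ∃ Z₀ : ℕ, ∀ v w Y Z : ℕ, Z₀ ≤ Z → 0 < v → 0 < w → 0 < Y → Nat.Coprime (v * Y) (w * Z) →
      ((max v w : ℕ) : ℝ) ≤ (Z : ℝ) ^ (0:ℝ) → w * Z ^ 4 ≠ v * Y ^ 4 →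
      (Z : ℝ) ^ φ < |((w * Z ^ 4 : ℕ) : ℝ) - ((v * Y ^ 4 : ℕ) : ℝ)| :=
  ubq₂_theta_zero_of_le_three hφ

example {φ : ℝ} (hφ : 3 < φ) :
    ¬ ∃ Z₀ : ℕ, ∀ v w Y Z : ℕ, Z₀ ≤ Z → 0 < v → 0 < w → 0 < Y → Nat.Coprime (v * Y) (w * Z) →
      ((max v w : ℕ) : ℝ) ≤ (Z : ℝ) ^ (0:ℝ) → w * Z ^ 4 ≠ v * Y ^ 4 →
      (Z : ℝ) ^ φ < |((w * Z ^ 4 : ℕ) : ℝ) - ((v * Y ^ 4 : ℕ) : ℝ)| :=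
  not_ubq₂_theta_zero_of_three_lt hφ

/-- **(11c)** The three rational symmetric tight identities in their `s ↦ −s` normal forms (`padeFamily₁`, `bezoutFamily₃`,
`padeFamily₂` = shapes `(1;2,1)`, `(1;3,0)`, `(2;2,3)`), plus the `d = 1` member `(1;1,2)`; and the anchored-convergent identity of (11d). -/
example (s m : ℤ) :
    (4*s^2 + 8*s + 5) * (2*s - 1)^4 - (4*s^2 - 8*s + 5) * (2*s + 1)^4 = -64*s ∧
    (20*s^3 + 40*s^2 + 29*s + 8) * (2*s - 1)^4 - (20*s^3 - 40*s^2 + 29*s - 8) * (2*s + 1)^4 = 16 ∧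
    (20*s^2 + 40*s + 21) * (10*s^2 - 5*s - 2)^4 - (20*s^2 - 40*s + 21) * (10*s^2 + 5*s - 2)^4 = -2000*s*(15*s^2 - 4) ∧
    (s + 2) * (2*s - 1)^4 - (s - 2) * (2*s + 1)^4 = 80*s^2 + 4 ∧
    (m^4 + 1) * (4*m^3)^4 - (4*m^4 + 1)^4 = -(96*m^8 + 16*m^4 + 1) := by
  refine ⟨by ring, by ring, by ring, by ring, by ring⟩

/-- **(11c)** The `d = 2` moduli polynomials have the recorded rational roots for `z = 1, 2`; spot checks that the obvious small
candidates are not roots of `D₃` (the full rational-root test is the seat computation). -/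
example : (4:ℚ) * (5/4) - 5 = 0 ∧ (20:ℚ) * (21/20) - 21 = 0 ∧
    (320:ℚ) * 1^3 - 1008 * 1^2 + 1116 * 1 - 429 ≠ 0 ∧ (320:ℚ) * (5/4)^3 - 1008 * (5/4)^2 + 1116 * (5/4) - 429 ≠ 0 ∧
    (320:ℚ) * (21/20)^3 - 1008 * (21/20)^2 + 1116 * (21/20) - 429 ≠ 0 := by norm_num

/-- **(11f)** The Pell–Bezout family (LANDED p138228): the polynomial Bezout identity, its Pell boost, the two smallest members,
the negative-conic twin, and the unit identity. -/
example (u : ℤ) : (2 * u ^ 2 + 1) * (u ^ 2 - 1) ^ 2 - (2 * u ^ 2 - 3) * u ^ 4 = 1 := bezout_sq_identity u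

example {u t : ℕ} (h : u ^ 2 = 2 * t ^ 2 + 1) (ht : 1 ≤ t) :
    (16 * t ^ 2 + 12) * t ^ 4 = (4 * t ^ 2 - 1) * u ^ 4 + 1 := pellBezout_identity h ht

example : (76 : ℕ) * 2 ^ 4 = 15 * 3 ^ 4 + 1 ∧ (2316 : ℕ) * 12 ^ 4 = 575 * 17 ^ 4 + 1 ∧
    (101 : ℕ) * 7 ^ 4 = 388 * 5 ^ 4 + 1 ∧ (3365 : ℕ) * 41 ^ 4 = 13444 * 29 ^ 4 + 1 := by norm_num

example (u : ℤ) : (2 * u ^ 2 + 3) * u ^ 4 - (2 * u ^ 2 - 1) * (u ^ 2 + 1) ^ 2 = 1 := by ring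

example (Z : ℤ) :
    (32 * Z ^ 6 + 24 * Z ^ 4 - 1) ^ 2 - (4 * Z ^ 2 - 1) * (16 * Z ^ 2 + 12) * (4 * Z ^ 4 + 2 * Z ^ 2) ^ 2 = 1 :=
  pellBezout_unit_identity Z

/-- **(11f)** The family packaged, beyond every height. -/
example (N : ℕ) : ∃ v w Y Z : ℕ, N ≤ Z ∧ 0 < v ∧ 0 < w ∧ 0 < Y ∧ 1 ≤ Z ∧
    Nat.Coprime (v * Y) (w * Z) ∧ w * Z ^ 4 = v * Y ^ 4 + 1 ∧ v ≤ w ∧ w ≤ 28 * Z ^ 2 ∧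
    w = 16 * Z ^ 2 + 12 ∧ v = 4 * Z ^ 2 - 1 ∧ Y ^ 2 = 2 * Z ^ 2 + 1 := exists_pellBezout N

/-- **(11f)** Corner `(2, 0)`; the three-lobe FALSE region; Thue-rung budget `≤ 2`; the unit slice is false above `2`. -/
example (θ φ : ℝ) (hθ : 2 < θ) (hφ : 0 ≤ φ) :
    ¬ ∃ Z₀ : ℕ, ∀ v w Y Z : ℕ, Z₀ ≤ Z → 0 < v → 0 < w → 0 < Y → Nat.Coprime (v * Y) (w * Z) →
      ((max v w : ℕ) : ℝ) ≤ (Z : ℝ) ^ θ → w * Z ^ 4 ≠ v * Y ^ 4 →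
      (Z : ℝ) ^ φ < |((w * Z ^ 4 : ℕ) : ℝ) - ((v * Y ^ 4 : ℕ) : ℝ)| :=
  not_ubq₂_corner_two_zero θ φ hθ hφ

example {θ φ : ℝ} (hc : (2 < θ ∧ 0 ≤ φ) ∨ (1 < θ ∧ 3 / 2 < φ) ∨ (0 < θ ∧ 2 < φ)) :
    ¬ ∃ Z₀ : ℕ, ∀ v w Y Z : ℕ, Z₀ ≤ Z → 0 < v → 0 < w → 0 < Y → Nat.Coprime (v * Y) (w * Z) →
      ((max v w : ℕ) : ℝ) ≤ (Z : ℝ) ^ θ → w * Z ^ 4 ≠ v * Y ^ 4 →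
      (Z : ℝ) ^ φ < |((w * Z ^ 4 : ℕ) : ℝ) - ((v * Y ^ 4 : ℕ) : ℝ)| := by
  rcases hc with h | h | h
  · exact ubq₂_false_of_corner₆ (Or.inl h)
  · exact ubq₂_false_of_corner₆ (Or.inr (Or.inr (Or.inr (Or.inl h))))
  · exact ubq₂_false_of_corner₆ (Or.inr (Or.inr (Or.inr (Or.inr h))))

example {ε η : ℝ} (hε : ε ≤ 1) (hη : 2 < η) :
    ¬ ∃ Z₀ : ℕ, ∀ v w Y Z : ℕ, Z₀ ≤ Z → 0 < v → 0 < w → 0 < Y → Nat.Coprime (v * Y) (w * Z) →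
      ((max v w : ℕ) : ℝ) ≤ (Z : ℝ) ^ η → w * Z ^ 4 ≠ v * Y ^ 4 →
      (Z : ℝ) ^ (1 - ε) < |((w * Z ^ 4 : ℕ) : ℝ) - ((v * Y ^ 4 : ℕ) : ℝ)| :=
  movingThue4_budget_le_two hε hη

example (η : ℝ) (hη : 2 < η) :
    ¬ ∃ Z₀ : ℕ, ∀ v w Y Z : ℕ, Z₀ ≤ Z → ((w * Z ^ 4 : ℤ) - (v * Y ^ 4 : ℤ)) ∣ 4 → 0 < v → 0 < w → 0 < Y →
      Nat.Coprime (v * Y) (w * Z) → ((max v w : ℕ) : ℝ) ≤ (Z : ℝ) ^ η → w * Z ^ 4 ≠ v * Y ^ 4 →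
      (Z : ℝ) ^ η < |((w * Z ^ 4 : ℕ) : ℝ) - ((v * Y ^ 4 : ℕ) : ℝ)| :=
  not_ubqOn_unitSlice_of_two_lt η hη

end cycle11

/-! ## Cycle 12 (refuter-cdisprove-stmt-ABC-1649-g12-0, 2026-08-17): the last three un-calibrated typed statements on this crux get
their dials — S⁺4 `PolySzpiro s` EXACT at `6` (LANDED `Negative.PolySzpiroFloor` p140986 + `Negative.PolySzpiroSix` p141951),
S⁺5 Lang–Waldschmidt₄ pinned from below at `1` on the crux's own forms (LANDED `Negative.LangWaldschmidtFloor` p141178), and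
the strategist's anchored split Dc2 (LANDED `Negative.AnchoredSliceCorner` p141423); consolidated DIAL TABLE

Context: three TYPED statements had no recorded dial — S⁺4 `Ideator4.PolySzpiro s` (edge `SzpiroEdge`), S⁺5 `hLW` of p111401, Dc2 `UBQOn (anchoredSlice B) η`; all three landed this cycle (matrices verbatim; `Cruxes/` is not importable).

### (12a) S⁺4 — `PolySzpiro s` is FALSE for every `s ≤ 6`, `ABC`-TRUE for every `s > 6` (p140986, p141951)
`PolySzpiro s := ∃ C > 0, ∀ abc triples, (abc)² ≤ C · rad(abc)^s` (`Δ_Frey = 16(abc)²`; `s = 6 + ε` is Szpiro).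
* `not_polySzpiro_of_lt_six` (p140986): for `s < 6`, the Mason–Stothers-tight POWER FAMILY `m^{k+1} + b = (m+1)^{k+1}` of unbounded
  degree: `rad ≤ m · b · (m+1) ≤ (m+1)^{k+3}`, `(abc)² ≥ (m+1)^{6k+4}/4^{k+1}`, contradiction for `k > (3s−4)/(6−s)`, `m → ∞`
  (radical degree `k + 3` against `3(k + 1)`: limiting ratio `6`).
* **`not_polySzpiro_six` (p141951): `s = 6` itself is false — Szpiro's `ε` is NECESSARY — by an argument that needs no prime counting**
  (in print: Masser 1990, Zbl 0742.14027, via a Stewart–Tijdeman-type construction).  2-ADIC ACCUMULATION ON A CUBIC TWIST: on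
  `x³ + y³ = 19z³` iterate the duplication `(x, y, z) ↦ (x(x³+2y³), −y(2x³+y³), z(x³−y³))` from `(3, 5, 2)`
  (`cubic_dup_identity`: `x³(x³+2y³)³ − y³(2x³+y³)³ = (x³+y³)(x³−y³)³`); the invariants `gcd(x,y) = 1`, `x, y` odd, `x ≢ y (mod 3)` make
  every raw iterate primitive (`cubic_cofactors_isCoprime`: a common factor of `x³+2y³`, `2x³+y³` divides `3`, and `x³+2y³ ≡ x − y`), and
  `x³ − y³` is even, so **`2^{j+1} ∣ z_j`** (`cubicFamily`).  The abc triple `{|x|³, |y|³, 19|z|³}` has `(abc)² = 19²(xyz)⁶` but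
  `rad ≤ 19|x||y|·rad(z) ≤ 19|x||y||z|/2^j`: `(abc)² ≤ C rad⁶` forces `2^{6j} ≤ 19⁴C`.  (Signature `(3,3,3)` is Euclidean — real sizes
  cancel exactly in `(abc)²/rad⁶`, which is why Pell/conics, where sizes enter as `(xyz)^{−2}`, cannot do this and an elliptic
  divisibility sequence can.  First orbit points: `(3,5,2)`, `(831, −895, −196)`: `831³ + 19·196³ = 895³`.)
* `polySzpiro_of_abc`: `ABC ⟹ PolySzpiro s` for `s > 6` (`(abc)² ≤ c⁶ < C⁶ rad^{6(1+ε)}`); `polySzpiro_iff_of_abc`: under `ABC`,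
  `PolySzpiro s ⟺ 6 < s` for EVERY real `s`.  So the typed edge `SzpiroEdge` (`∀ s < 8, PolySzpiro s → crux`, unlanded, ≤ 80 lines)
  has content exactly on `s ∈ (6, 8)`, where `PolySzpiro s` lies between Szpiro's conjecture and polynomial abc with exponent
  `s/4 ∈ (3/2, 2)`; "every `s` is open" should read "every `s > 6` is open".

### (12b) S⁺5 — the Lang–Waldschmidt₄ dial is pinned from below at `1` by the crux's own forms (p141178)
`hLW` (hypothesis of `stub_cruxOfLangWaldschmidt`, matrix verbatim): `∀ ε > 0 ∃ C > 0 ∀ a : Fin 4 → ℕ, b : Fin 4 → ℤ` (positive,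
`|bᵢ| ≤ 4`, `Λ = ∑ bᵢ log aᵢ ≠ 0`): `C (∏ aᵢ)^{−(1+ε)} ≤ |Λ|`.  Write `LW₄(κ)` for exponent `−κ`.  `not_langWaldschmidt4_of_lt_one`:
**`LW₄(κ)` is FALSE for every `κ < 1`**, witnessed by the instances the EDGE ITSELF feeds to `hLW` — `a = (w, Z, v, Y)`, `b = (1,4,−1,−4)` —
along the Pell–Bezout family of `Negative.TorusBezoutCorner`: `Λ = log(1 + 1/(vY⁴)) ∈ (0, 1/(12Z⁶)]`, `∏ aᵢ = wZvY ≤ 224 Z⁶`, so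
`|Λ|(∏ aᵢ)^κ → 0`; `not_hLW_matrix_of_neg_eps`: the `0 < ε` of `hLW` cannot be relaxed to any `ε₀ < 0 < …`.  The conjectured exponent
`1` is ATTAINED (`|Λ| ≍ (∏ aᵢ)^{−1}`) on the dictionary instances; on a general enemy `|Λ|·∏ aᵢ ≍ a₀(v³w)^{1/4}/Z²`, so `LW₄(1)` with a
fixed constant fails iff there are enemies strictly BELOW the random-model line `θ + φ = 2` — the Pell–Bezout corner `(2,0)` sits ON it,
pinning the exponent at exactly `1` and no further.  Dial: false `κ < 1` (here) / conjectured `κ > 1` (LW) / sufficient for the crux for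
every `κ < 2` (edge docstring; landed at `κ = 6/5`).

### (12c) Dc2 — the anchored slice is not easier than height `2` (p141423)
`anchoredSlice B v w Y Z := ∃ p q ∈ [1, B], p⁴v ≠ q⁴w, 2|p⁴v − q⁴w|² ≤ q⁴w`; ON-piece `UBQOn (anchoredSlice B) η` (matrices verbatim).
`not_ubqOn_anchoredSlice_of_two_lt`: **FALSE for every `B ≥ 1`, `η > 2`** — the `(z; d, e) = (1; 1, 2)` tight identity
`(s+2)(2s−1)⁴ − (s−2)(2s+1)⁴ = 80s² + 4` on `s = 6m+3` (`v = 6m+1`, `w = v + 4`, `Y = 12m+7`, `Z = 12m+5`, value `2880m² + 2880m + 724 ≤ 81Z²`,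
coprimality by an explicit Bezout identity): anchored at `p = q = 1` with error `4`, in the slice once `w ≥ 32`, height `w ≤ Z` — the
corner `(1, 2)` realised INSIDE the slice with the best possible anchor.  `ubqOn_anchoredSlice_zero`: for `B = 0` the slice is empty
(vacuous truth), so `B ≥ 1` is needed.  NOTE (seat, after landing): the fixed Dirichlet form `(v,w) = (1,2)` of `Negative.FixedFormsDirichlet`
is ITSELF anchored at `p = q = 1` (error `1`: `2·1² ≤ 2`), so for `B ≥ 1` the slice already contains the Dirichlet lobe `{θ > 0, φ > 2}`
(convergents of `⁴√2` with odd numerator) — same diagonal threshold `2`; what the `(1;1,2)` family adds is that the MOVING-support part of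
the slice (`rad(vw) → ∞`, i.e. Dc2-ON ∩ Dc3-OFF, the piece a split would actually isolate) also reaches `φ = 2`, at `θ = 1`.  Remarks recorded there: the slice AS TYPED (anchor error up to `(q⁴w/2)^{1/2}`) is wider than
the range where Thue–Siegel/hypergeometric arguments beat Liouville (error `≲ (q⁴w)^{1/3}`), so "ON: provable now" holds at best for a
narrower slice and an unstated `η`; heuristically the ON-piece's diagonal truth is `4/3` (`≍ Z^{θ/2+φ−2}` anchored enemies per block),
proved ceiling `2` (here), `ABC` floor `8/13` (p137739).

### (12d) DIAL TABLE — moved (v25) to `Cruxes/TowerFourSubLiouville/DIALS.md` (every typed statement: landed FALSE floor | `ABC` side | what the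
crux needs); the rows changed later are § (13d) and § (15d).  Verdict unchanged: no kill short of `¬ABC`.

### (12e) Open edges after cycle 12 — superseded by § (15e). -/

section cycle12
open Summit.ABC.ABC.Theorems.TowerFourSubLiouville.Negative
open Literature.NumberTheory.DiophantineGeometry (IsABCTriple rad)

/-- **(12a)** `PolySzpiro s` is false for every `s ≤ 6` (p140986: `s < 6`; p141951: `s = 6`, Szpiro's `ε` is necessary) … -/
example {s : ℝ} (hs : s ≤ 6) :
    ¬ ∃ C : ℝ, 0 < C ∧ ∀ a b c : ℕ, IsABCTriple a b c →
      (((a * b * c : ℕ) : ℝ)) ^ (2 : ℕ) ≤ C * ((rad a b c : ℕ) : ℝ) ^ s :=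
  not_polySzpiro_of_le_six hs

/-- … and under `ABC` the dial is exactly `s > 6`. -/
example (habc : ABC) (s : ℝ) :
    (∃ C : ℝ, 0 < C ∧ ∀ a b c : ℕ, IsABCTriple a b c →
      (((a * b * c : ℕ) : ℝ)) ^ (2 : ℕ) ≤ C * ((rad a b c : ℕ) : ℝ) ^ s) ↔ 6 < s :=
  polySzpiro_iff_of_abc habc s

/-- **(12a)** The two witness families: the power family is an abc triple with small radical; the duplication on `x³ + y³ = 19z³`
and its first step. -/
example (m k : ℕ) (hm : 1 ≤ m) :
    IsABCTriple (m ^ (k + 1)) ((m + 1) ^ (k + 1) - m ^ (k + 1)) ((m + 1) ^ (k + 1)) ∧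
    rad (m ^ (k + 1)) ((m + 1) ^ (k + 1) - m ^ (k + 1)) ((m + 1) ^ (k + 1)) ≤
      m * ((m + 1) ^ (k + 1) - m ^ (k + 1)) * (m + 1) :=
  ⟨powerFamily_isABCTriple m k hm, rad_powerFamily_le m k hm⟩

example {x y z : ℤ} (h : x ^ 3 + y ^ 3 = 19 * z ^ 3) :
    (x * (x ^ 3 + 2 * y ^ 3)) ^ 3 + (-(y * (2 * x ^ 3 + y ^ 3))) ^ 3 = 19 * (z * (x ^ 3 - y ^ 3)) ^ 3 :=
  cubic_dup_identity h

example (j : ℕ) : ∃ x y z : ℤ, x ^ 3 + y ^ 3 = 19 * z ^ 3 ∧ IsCoprime x y ∧ Odd x ∧ Odd y ∧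
    ¬ (3 : ℤ) ∣ x - y ∧ z ≠ 0 ∧ (2 : ℤ) ^ (j + 1) ∣ z :=
  cubicFamily j

example : (3 : ℤ) ^ 3 + 5 ^ 3 = 19 * 2 ^ 3 ∧ (831 : ℤ) ^ 3 + 19 * 196 ^ 3 = 895 ^ 3 ∧ (196 : ℤ) = 4 * 49 := by norm_num

/-- **(12b)** The Lang–Waldschmidt₄ matrix with exponent `−κ`, `κ < 1`, is false (p141178); in particular `hLW` at any `ε < 0`. -/
example {κ : ℝ} (hκ : κ < 1) :
    ¬ ∃ C : ℝ, 0 < C ∧ ∀ a : Fin 4 → ℕ, ∀ b : Fin 4 → ℤ, (∀ i, 0 < a i) → (∀ i, |b i| ≤ 4) →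
      (∑ i, (b i : ℝ) * Real.log (a i : ℝ)) ≠ 0 →
      C * (((∏ i, a i : ℕ) : ℝ)) ^ (-κ) ≤ |∑ i, (b i : ℝ) * Real.log (a i : ℝ)| :=
  not_langWaldschmidt4_of_lt_one hκ

example {ε : ℝ} (hε : ε < 0) :
    ¬ ∃ C : ℝ, 0 < C ∧ ∀ a : Fin 4 → ℕ, ∀ b : Fin 4 → ℤ, (∀ i, 0 < a i) → (∀ i, |b i| ≤ 4) →
      (∑ i, (b i : ℝ) * Real.log (a i : ℝ)) ≠ 0 →
      C * (((∏ i, a i : ℕ) : ℝ)) ^ (-(1 + ε)) ≤ |∑ i, (b i : ℝ) * Real.log (a i : ℝ)| :=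
  not_hLW_matrix_of_neg_eps hε

/-- **(12c)** The anchored split Dc2: ON-piece false for `B ≥ 1`, `η > 2` (p141423); vacuous for `B = 0`; the family. -/
example (B : ℕ) (hB : 1 ≤ B) (η : ℝ) (hη : 2 < η) :
    ¬ ∃ Z₀ : ℕ, ∀ v w Y Z : ℕ, Z₀ ≤ Z →
      (∃ p q : ℕ, 0 < p ∧ 0 < q ∧ p ≤ B ∧ q ≤ B ∧ p ^ 4 * v ≠ q ^ 4 * w ∧
        2 * (((p ^ 4 * v : ℕ) : ℤ) - ((q ^ 4 * w : ℕ) : ℤ)).natAbs ^ 2 ≤ q ^ 4 * w) →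
      0 < v → 0 < w → 0 < Y → Nat.Coprime (v * Y) (w * Z) →
      ((max v w : ℕ) : ℝ) ≤ (Z : ℝ) ^ η → w * Z ^ 4 ≠ v * Y ^ 4 →
      (Z : ℝ) ^ η < |((w * Z ^ 4 : ℕ) : ℝ) - ((v * Y ^ 4 : ℕ) : ℝ)| :=
  not_ubqOn_anchoredSlice_of_two_lt B hB η hη

example (m : ℕ) :
    (6 * m + 5) * (12 * m + 5) ^ 4 = (6 * m + 1) * (12 * m + 7) ^ 4 + (2880 * m ^ 2 + 2880 * m + 724) ∧
    Nat.Coprime ((6 * m + 1) * (12 * m + 7)) ((6 * m + 5) * (12 * m + 5)) :=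
  ⟨anchoredFamily_identity m, anchoredFamily_coprime m⟩

example (s : ℤ) : (s + 2) * (2 * s - 1) ^ 4 - (s - 2) * (2 * s + 1) ^ 4 = 80 * s ^ 2 + 4 := by ring

end cycle12

/-! ## Cycle 13 (refuter-cdisprove-stmt-ABC-1649-g13-0, 2026-08-17): the `ABC` side of the two-exponent diagram is FINAL —
`ABC ⟹ UBQ₂` on the WHOLE random-model half-plane `θ + φ < 2`, which is the torus Mason–Stothers plane (LANDED
`Negative.TwoExponentSandwichSharp`, p143568) — and the last conjectural ceiling of the dial table becomes an `ABC`-edge: `ABC ⟹ hLW`,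
the Lang–Waldschmidt₄ hypothesis of p111401 (LANDED `Negative.LangWaldschmidtSandwich`, p143831)

Context: two rows were NOT tight against `ABC` after cycle 12 — the two-exponent diagram (`ABC`-true only on `(9/4)θ + φ < 2`) and S⁺5 (ceiling = the LW conjecture); both closed here.

### (13a) `Negative.TwoExponentSandwichSharp` (p143568): `ABC ⟹ UBQ₂(θ, φ)` for ALL `θ ≥ 0`, `θ + φ < 2` — and this is SHARP
Two savings were left on the table in cycle 11's `abc_enemy_numerics`: (i) the larger summand of the abc triple is `c ≥ w·Z⁴`, not
just `Z⁴` — keeping `w` in `c` cancels one full power of `w` from the radical `≤ a·v·w·Y·Z`; (ii) `Y ≍ (w/v)^{1/4}Z`, precisely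
`v·Y⁴ ≤ 2wZ⁴`, so `(vY)⁴ ≤ 2v³wZ⁴`: three quarters of `v` are absorbed by `Y`.  With both, abc at `δ = s/48` turns an enemy
`a ≤ Z^φ`, `v ≤ Z^{θ_v}`, `w ≤ Z^{θ_w}` into `Z^{2−O(δ)} ≲ a·v^{3/4}·w^{1/4}` (`abc_enemy_numerics_sharp`), i.e.
* `ubq₃_of_abc`: **`ABC ⟹` the three-exponent saving on the whole half-space `(3/4)θ_v + (1/4)θ_w + φ < 2`** (`v ≤ Z^{θ_v}`, `w ≤ Z^{θ_w}`
  separately) — and that plane is LITERALLY the torus Mason–Stothers inequality `3·deg P ≤ deg V + deg Q + deg A` of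
  `Negative.TorusEnemyFloor.masonStothers_torus_ineq` (p109688; read with `deg Q = deg P + (deg W − deg V)/4`): the integers under `ABC`
  and the Laurent-polynomial identities unconditionally see the same plane from opposite sides (as they must — Mason–Stothers is abc
  over function fields — but cycle 11's `9/4` hid it);
* `ubq₂_of_abc_sharp`: **`ABC ⟹ UBQ₂(θ, φ)` for every `θ ≥ 0`, `θ + φ < 2`** (`φ < 0` trivially; the cycle-11 half-plane is a corollary);
* `ubq₂_halfPlane_le_two` / `ubq₃_halfSpace_le_two`: UNCONDITIONALLY, a TRUE half-plane `θ + φ < c` (half-space `(3/4)θ_v+(1/4)θ_w+φ < c`)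
  has `c ≤ 2` — the Pell–Bezout corner `(2,0)` (`θ_v = θ_w = 2`, value `1`) lies ON the line, as does the Dirichlet limit corner `(0,2)`.
  So the statement is best possible of its shape: the `ABC` side of the diagram cannot be improved as a half-plane;
* `ubq_of_abc_sharp`: **diagonal — `ABC ⟹ UBQ η` for every `0 ≤ η < 1`** (was `8/13`): the random-model critical value; the uniform
  dial of the crux-equivalent core is bracketed `[1, 3/2]` under `ABC` (ceiling: padeFamily₂, p106450);
* `ubq₂_axis_iff_of_abc`: **the axis `φ = 0` is PINNED at `θ* = 2` under `ABC`** (`UBQ₂(θ,0) ↔ θ < 2` for `θ ≠ 2`): bounded values of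
  coprime binomial quartic forms need quadratic coefficient height (`ABC`) and occur at height `≤ 28Z²` (torus, p138228) — the corner
  `(2,0)` is OPTIMAL short of `¬ABC`; column `θ_v = 0` (`ubq₃_of_abc_unit_v`): `Y⁴ ± a = wZ⁴`, `a ≤ Z^φ` forces `w > Z^{θ_w}` whenever
  `θ_w/4 + φ < 2` (value `1`: `w > Z^{8−o(1)}`, i.e. `Z⁴ ∣ Y⁴ ± 1 ⟹ Z ≤ Y^{1/3+o(1)}`);
* the strategist's ladder gets the RANDOM-MODEL budgets from `ABC`: `movingRoth4_of_abc_of_lt` (saving `Z^{2−ε}` at ANY budget `η < ε`;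
  cycle 11: `η < 4ε/9`), `movingThue4_of_abc_of_lt` / `movingThue4_of_abc_one` (saving `Z^{1−ε}` at any `η < 1 + ε`, in particular the
  `ε`-INDEPENDENT budget `η = 1`; cycle 11: `η < 4(1+ε)/9`).  Unconditional ceilings unchanged (`1` for `ε < 1/2`; `2`).
The plane after (13a): `ABC`-TRUE strictly below `θ + φ = 2`; FALSE in the three lobes; undetermined — even under `ABC` — only in the
closed band between the line and the staircase `(0,2)–(1,2)–(1,3/2)–(2,3/2)–(2,0)`, where the random model says FALSE and where only
rational identity shapes ON `θ + φ = 2` (torus; asymmetric-dessin census open, (11e)(x)) could add unconditional corners.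
FOR IDEATORS: an enemy family of the core at ANY point with `θ + φ < 2` — any diagonal value `< 1`, any bounded-value family below
quadratic height, any fixed-`v` family with `θ_w/4 + φ < 2` — refutes `ABC`; unconditional enemies live ON or ABOVE the line, where both
identity floors (ℙ¹: `2 + 1/z`, p107305; torus: `2`, p109688) also put them.  FOR PROVERS: the crux needs ONE true diagonal point
`(η, η)`, `η > 0`; `ABC` gives all `η < 1`; nothing unconditional is known at any `η > 0`.

### (13b) `Negative.LangWaldschmidtSandwich` (p143831): `ABC ⟹ hLW`; the S⁺5 dial PINNED at `κ = 1`
`hLW_of_abc`: **`ABC ⟹` the hypothesis `hLW` of `stub_cruxOfLangWaldschmidt`** (p111401; `∀ ε > 0 ∃ C > 0 ∀ a : Fin 4 → ℕ` positive,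
`b : Fin 4 → ℤ`, `|bᵢ| ≤ 4`, `Λ = ∑ bᵢ log aᵢ ≠ 0`: `C(∏ aᵢ)^{−(1+ε)} ≤ |Λ|`, matrix verbatim).  Proof: `Λ = log P − log Q` with `P = ∏ aᵢ^{bᵢ⁺}`,
`Q = ∏ aᵢ^{bᵢ⁻}`, both `≤ A⁴` (`A = ∏ aᵢ`), `rad(PQ) ∣ A`; dividing `{P, Q} = {m < M}` by the gcd gives an abc triple `m' + r = M'` with
`rad ≤ A·r` and `|Λ| = log(M'/m') ≥ r/M'`; if `|Λ| < C A^{−(1+ε)}` then `r < C A^{−(1+ε)}M'` and abc at `δ = ε/8` yields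
`M' < K(Ar)^{1+δ} ≤ K C^{1+δ} A^{4δ−ε(1+δ)} M' ≤ M'` for `C = min(1, 1/K)`.  (Folklore in substance — abc controls linear forms in logarithms of
integers with bounded coefficients, cf. Baker 1998 / Philippon 1999 on abc vs. measures of linear independence of logarithms — here for
the tree's own `hLW`.)  `langWaldschmidt4_of_abc`: `ABC ⟹ LW₄(κ)` for every `κ > 1`; `langWaldschmidt4_iff_of_abc`: **under `ABC`,
`LW₄(κ) ⟺ 1 < κ` for every `κ ≠ 1`** (floor p141178 + this) — PINNED at `1` like `UniformLjunggren` at `K = 1`, `HallLang1728` at `κ = 2`,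
`TridentHallLang` at `5/4`, `PolySzpiro` at `6`, the `φ = 0` axis at `θ = 2`.  So S⁺5 is sandwiched `ABC ⟹ hLW ⟹ crux`: not refutable
short of `¬ABC`, and the dial table has NO conjectural ceiling left — every typed statement on this crux sits between a landed
unconditional floor and a landed `ABC ⟹` ceiling.  Open at S⁺5 only: `LW₄(1)` with a FIXED constant (sub-polynomial).

### (13c) Attacks tried this cycle and dismissed (no new unconditional floor; for the record)
(i)–(iii) The `A = 1` loss of the crux dial (open edge (6e)(i)): TWO-SIDED Lucas lifting (squareful `u = x_m` via `x_n² ∣ x_{n·x_n·k}`, `n` even,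
`k` odd, together with Matiyasevich's `y_j² ∣ y_{j y_j}`) pays for every bought square exactly in `log c` — gain `≤ 0.29·log c/log log c`, best
ONE-sided; Stewart–Tijdeman's pigeonhole has NO tower analogue (tower cost `pm(n) ≥ n^{1/4}`, equality iff biquadrate: all of `a, b, c` must be
near-biquadrates, so the `A = 1` gain question IS the `(θ, φ)` diagram near its boundary, gain `≍ Z^{2−θ−φ}`); `p`-adic accumulation in the
Pell–Bezout coefficients `4t² − 1`, `16t² + 12` gives gain `(log c)^{3/4}` only.  Verdict on (6e)(i): the floor `log c/(log log c)^{1+}` (p127558)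
is where constructions stop (bare `log c` ⟺ free squares in Lucas sequences, i.e. Wall–Sun–Sun-type primes for `2 + √3`).
(iv) Hypothesis mutation of the core matrix `UBQ₂` (complements `ubq_false_without_height`, p125878): `0 < w` IS load-bearing —
junk witness `(v, w, Y, Z) = (1, 0, 1, Z)`: `gcd(1·1, 0·Z) = 1`, value `|0 − 1| = 1 ≤ Z^φ` (`ubq₂_false_without_w_pos` below); `0 < v` and
`0 < Y` are NOT (then the value is `wZ⁴ ≥ Z⁴`); the coprimality `gcd(vY, wZ) = 1` yields no cheap enemy when dropped (a common `p ∣ v`,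
`p ∣ Z` turns the form into the mixed-degree `wp³Z₁⁴ − v₁Y⁴ = a/p`; a common `p ∣ Y, Z` multiplies the value by `p⁴`) — presumably
dispensable up to exponents like the crux's own coprimality (p127991); nothing landed.  (v) The per-form endpoint `η = 2` (open edge
(6e)(iii)) is DECIDED for the quadratic-degenerate forms `w/v = □`: for `(v, w) = (1, 4)`, `4Z⁴ − Y⁴ = (2Z² − Y²)(2Z² + Y²)` with
`2Z² ≠ Y²`, so `|4Z⁴ − Y⁴| ≥ 2Z² + Y² > Z²` for EVERY `Z ≥ 1` (`form14_value_gt_sq` below: the endpoint statement `Z² < |4Z⁴ − Y⁴|` is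
TRUE with threshold `1`), while along Pell `Y² = 2Z² + 1` the value is exactly `4Z² + 1` (`form14_pell_value`): no constant `c > 4` works.
For genuinely quartic `w/v` the endpoint stays open (partial quotients of `⁴√(w/v)`).  (vi) the asymmetric-dessin census: run in § Cycle 14 (empty over `ℚ`).

### (13d) DIAL TABLE — rows changed by cycle 13: moved to `DIALS.md` (v25; v28 drops the copy kept here).  Verdict unchanged: no kill short of `¬ABC`
(p74157); after 13 cycles every typed statement is sandwiched between a LANDED floor and a LANDED `ABC ⟹` ceiling.

### (13e) Open edges after cycle 13 — superseded by § (15e) ((12e)(xii) `LW₄(1)` is DECIDED there: false). -/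

section cycle13
open Summit.ABC.ABC.Theorems.TowerFourSubLiouville.Negative

/-- **(13a) LANDED p143568**, restated BY NAME: `ABC ⟹` the three-exponent saving below the torus Mason–Stothers plane; the whole
half-plane `θ + φ < 2`; its unconditional sharpness; the axis `φ = 0` pinned at `2`; the diagonal `η < 1`; the Thue rung at `η = 1`. -/
example := @ubq₃_of_abc
example := @ubq₂_of_abc_sharp
example := @ubq₂_halfPlane_le_two
example := @ubq₃_halfSpace_le_two
example := @ubq₂_axis_iff_of_abc
example := @ubq_of_abc_sharp
example := @movingRoth4_of_abc_of_lt
example := @movingThue4_of_abc_one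
example := @ubq₃_of_abc_unit_v

/-- **(13b) LANDED p143831**, restated BY NAME: `ABC ⟹ hLW`; the S⁺5 dial pinned at `κ = 1` under `ABC`. -/
example := @hLW_of_abc
example := @langWaldschmidt4_iff_of_abc

/-- **(13c)(iv)** In the core matrix `UBQ₂` the hypothesis `0 < w` is load-bearing: with it dropped, the junk quadruple
`(v, w, Y, Z) = (1, 0, 1, Z)` (coprime: `gcd(1, 0) = 1`; value `|0·Z⁴ − 1·1⁴| = 1`) refutes the saving for every `θ, φ ≥ 0`. -/
theorem ubq₂_false_without_w_pos (θ φ : ℝ) (hθ : 0 ≤ θ) (hφ : 0 ≤ φ) :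
    ¬ ∃ Z₀ : ℕ, ∀ v w Y Z : ℕ, Z₀ ≤ Z → 0 < v → 0 < Y → Nat.Coprime (v * Y) (w * Z) →
      ((max v w : ℕ) : ℝ) ≤ (Z : ℝ) ^ θ → w * Z ^ 4 ≠ v * Y ^ 4 →
      (Z : ℝ) ^ φ < |((w * Z ^ 4 : ℕ) : ℝ) - ((v * Y ^ 4 : ℕ) : ℝ)| := by
  rintro ⟨Z₀, h⟩
  set Z : ℕ := max Z₀ 1 with hZ
  have hZ1 : (1 : ℝ) ≤ (Z : ℝ) := by exact_mod_cast le_max_right Z₀ 1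
  have hcop : Nat.Coprime (1 * 1) (0 * Z) := by simp
  have hmax : ((max 1 0 : ℕ) : ℝ) ≤ (Z : ℝ) ^ θ := by
    rw [show ((max 1 0 : ℕ) : ℝ) = 1 by norm_num]; exact Real.one_le_rpow hZ1 hθ
  have hne : 0 * Z ^ 4 ≠ 1 * 1 ^ 4 := by simp
  have key := h 1 0 1 Z (le_max_left _ _) one_pos one_pos hcop hmax hne
  have habs : |((0 * Z ^ 4 : ℕ) : ℝ) - ((1 * 1 ^ 4 : ℕ) : ℝ)| = 1 := by push_cast; norm_num
  rw [habs] at key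
  linarith [Real.one_le_rpow hZ1 hφ]

/-- **(13c)(v)** `2Z² ≠ Y²` for `Z ≥ 1` (irrationality of `√2`). -/
theorem two_mul_sq_ne_sq {Y Z : ℕ} (hZ : 0 < Z) : 2 * Z ^ 2 ≠ Y ^ 2 := by
  intro h
  have hZR : (0 : ℝ) < Z := by exact_mod_cast hZ
  have hq : ((Y : ℝ) / Z) ^ 2 = 2 := by
    have : (2 : ℝ) * (Z : ℝ) ^ 2 = (Y : ℝ) ^ 2 := by exact_mod_cast h
    field_simp; linarith
  have hsqrt : Real.sqrt 2 = (Y : ℝ) / Z := by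
    rw [← hq, Real.sqrt_sq (by positivity)]
  exact irrational_sqrt_two ⟨(Y : ℚ) / Z, by rw [hsqrt]; push_cast; rfl⟩

/-- **(13c)(v)** The per-form endpoint `η = 2` is TRUE for the quadratic-degenerate form `(v, w) = (1, 4)`, for EVERY `Z ≥ 1`:
`|4Z⁴ − Y⁴| = |2Z² − Y²|·(2Z² + Y²) ≥ 2Z² + Y² > Z²`. -/
theorem form14_value_gt_sq (Y Z : ℕ) (hZ : 0 < Z) : (Z : ℝ) ^ (2 : ℝ) < |((4 * Z ^ 4 : ℕ) : ℝ) - ((1 * Y ^ 4 : ℕ) : ℝ)| := by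
  have hne : (2 * (Z : ℤ) ^ 2 - (Y : ℤ) ^ 2) ≠ 0 := by
    intro h0
    apply two_mul_sq_ne_sq (Y := Y) hZ
    have : (2 * (Z : ℤ) ^ 2) = (Y : ℤ) ^ 2 := by linarith
    exact_mod_cast this
  have h1 : (1 : ℤ) ≤ |2 * (Z : ℤ) ^ 2 - (Y : ℤ) ^ 2| := Int.one_le_abs hne
  have hfac : ((4 * Z ^ 4 : ℕ) : ℤ) - ((1 * Y ^ 4 : ℕ) : ℤ) = (2 * (Z : ℤ) ^ 2 - (Y : ℤ) ^ 2) * (2 * (Z : ℤ) ^ 2 + (Y : ℤ) ^ 2) := by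
    push_cast; ring
  have hZ1 : (1 : ℤ) ≤ Z := by exact_mod_cast hZ
  have hZ2 : (1 : ℤ) ≤ (Z : ℤ) ^ 2 := by nlinarith
  have hint : (Z : ℤ) ^ 2 < |((4 * Z ^ 4 : ℕ) : ℤ) - ((1 * Y ^ 4 : ℕ) : ℤ)| := by
    rw [hfac, abs_mul, abs_of_pos (by positivity : (0 : ℤ) < 2 * (Z : ℤ) ^ 2 + (Y : ℤ) ^ 2)]
    nlinarith [sq_nonneg (Y : ℤ), h1]
  have hcast : (((4 * Z ^ 4 : ℕ) : ℤ) : ℝ) - (((1 * Y ^ 4 : ℕ) : ℤ) : ℝ) = ((4 * Z ^ 4 : ℕ) : ℝ) - ((1 * Y ^ 4 : ℕ) : ℝ) := by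
    push_cast; ring
  rw [show (Z : ℝ) ^ (2 : ℝ) = (Z : ℝ) ^ (2 : ℕ) by rw [← Real.rpow_natCast]; norm_num, ← hcast, ← Int.cast_sub, ← Int.cast_abs]
  exact_mod_cast hint

/-- **(13c)(v)** … and with any constant `> 4` it fails infinitely often: along Pell `Y² = 2Z² + 1` (`pell2_exists_ge`, p138228)
the value is exactly `4Z² + 1`. -/
theorem form14_pell_value (N : ℕ) : ∃ Y Z : ℕ, N ≤ Z ∧ 1 ≤ Z ∧ ((1 * Y ^ 4 : ℕ) : ℤ) - ((4 * Z ^ 4 : ℕ) : ℤ) = 4 * Z ^ 2 + 1 := by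
  obtain ⟨Y, Z, h, hN, hZ⟩ := pell2_exists_ge N
  refine ⟨Y, Z, hN, hZ, ?_⟩
  have h' : ((Y : ℤ)) ^ 2 = 2 * (Z : ℤ) ^ 2 + 1 := by exact_mod_cast h
  push_cast
  have : ((Y : ℤ)) ^ 4 = (2 * (Z : ℤ) ^ 2 + 1) ^ 2 := by rw [← h']; ring
  rw [this]; ring

end cycle13

/-! ## Cycle 14 (refuter-cdisprove-stmt-ABC-1649-g14-0, 2026-08-17): the identity census made RIGOROUS (good reduction mod `p`) and pushed
one width further — full write-up in `Cruxes/TowerFourSubLiouville/Negative-notes/census-c14.md` (method, completeness argument, tables)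

The only way left to move an UNCONDITIONAL entry of the dial table (§ (13d)) is a rational tight identity `wZ⁴ − vY⁴ = a` at a corner strictly
between the staircase `(0,2)–(1,2)–(1,3/2)–(2,3/2)–(2,0)` and the line `θ + φ = 2` — flagged open in (11e)(viii)–(x), (12e), (13c)(vi); earlier
censuses (cycles 3–5, 10–11) were numerical and symmetric-only.  This cycle decides such questions ARITHMETICALLY:
* (14a) METHOD.  A tight identity is a genus-0 Belyi map of degree `N` (`ℙ¹`-shape `(z;d,e)`, `d+e = 2z+1`: `N = 4z+d`; torus shape `(z;d,e)`,
  `d+e = 2z`: `N = 2d+8z`, usable on a Pell conic iff defined over `ℚ` with the two special points over `1` rational-and-symmetric (case S, the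
  only case visible to cycles 10–11) or conjugate over a REAL quadratic field with twisted descent `σ(f)(ε) = f(n/ε)` (case T)).  For `p > N`
  the monodromy group (`⊆ S_N`) has order prime to `p`, so by Grothendieck–Beckmann the map has good reduction at `p` with the same passport:
  every usable identity is an `𝔽_p`-point of a normal-form scheme (`ε`-form, special points `0, ∞`; for case T with `D` a non-residue the
  `x`-form with special pair `±√n`).  Census = enumerate ALL `(Z, Y)` over `𝔽_p` modulo the gauge group (the cofactors `W, V` are LINEAR
  unknowns), keep tight solutions, lift each `p`-adically (Newton; a solution ramified at `p` or colliding conjugate dessins give a singular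
  Jacobian — none occurred), pass to weight-`0` invariants, recognise their field by `p`-adic LLL (degree `≤ 4`, height `< 10⁸`
  certain), verify recognised classes EXACTLY over `ℚ(√D)`, test the twist.  Validation: re-derives cycle 4's width-1 torus census exactly
  (the `A₆` dessin = `QUADRATIC(−3) + TWIST(n = −2)`, the pointless conic `u² + 3t² = −2`), cycle 11's rational symmetric `(1;2,0)` dessins
  (Pell–Bezout in `ε`-form is the integer identity `ring`-checked below; plus `n = −5/12`), and finds a TWISTED `(1;2,0)` member over `ℚ(√15)`
  invisible to the symmetric ansatz (`W·Zt⁴ − V·Yt⁴ = (1750 − 450√15)ε⁶`, `Zt = ε²+1`, `Yt = ε² − η̄`, `η = 4+√15`; descends to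
  `u² − 15t² = 1`; corner `(2,0)`, known); on `ℙ¹` it re-derives `(1;1,2)`, `padeFamily₁`, `bezoutFamily₃`, `padeFamily₂` as RATIONAL and
  `(2;3,2)` as CUBIC.  C enumerator cross-checked class-for-class against an independent Python enumeration (`p = 5, 7, 11, 13`, all modes).
* (14b) RESULT (`ℙ¹`, width `3`, all shapes, `p = 23 > 19 ≥ N`, complete, all lifts regular): `(3;1,6)` ONE class, RATIONAL — the Dirichlet-edge
  Padé identity `ring`-checked below, corner `(1/3, 2)` ON `φ = 2` (the shapes `(z;1,2z)` are rational for every `z` and add nothing); `(3;2,5)`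
  cubic; `(3;3,4)` two and `(3;4,3)` one class of degree `> 4`; `(3;5,2)`, `(3;0,7)` no `𝔽₂₃`-point; `(3;6,1)` four, `(3;7,0)` one class of
  degree `> 4`.  **No rational tight `ℙ¹` identity of width `3` off `φ = 2`: the `4/3`-shapes `(3;3,4)`, `(3;4,3)` and the lobe candidates
  `(3;2,5)`, `(3;5,2)` are EMPTY over `ℚ`** (cycles 4/5/11: numerically, symmetric parts).
* (14c) RESULT (TORUS, width `2`, all three tight shapes, `p = 23 > 22 ≥ N`; kit j023745 — 24 cores, 30 min: `6371 + 6108` gauge classes of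
  `Z`, `1.63·10⁹ + 1.73·10⁹` pairs `(Z, Y)` in the split / inert forms; hedge jobs j023882–5 re-derive the `(2;2,2)` part identically;
  cofactor spaces of dimension `≥ 3` (inert form only) hold no tight solution — their members are `(G·W₀, G·V₀)` with `deg W₀, V₀ ≤ 2d−2`
  (LEMMA in CENSUS-c14.md; mechanical re-run j024196 queued); all lifts regular (no ramified or colliding class); every class
  re-certified at precision `23¹⁰⁰` with adaptive LLL bounds — a normal form over `ℚ` or a quadratic field of height `< 10²⁷` would have been
  recognised).  `𝔽₂₃`-classes (split | inert):  `(2;1,3)`, corner `(1/2, 3/2)`: `0 | 1` (degree `> 4`);  **`(2;2,2)`, corner `(1,1)`: `19 | 7`**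
  — split: apparent degree `4` (twenty of 27 hits) or `> 4`, none quadratic; inert: one class is the `ε ↦ ε²` pullback of cycle 4's `A₆` dessin
  (`QUADRATIC(−3) + TWIST(n² = −2)`, the pointless conic again, unusable), six of degree `> 4`;  `(2;3,1)`, corner `(3/2, 1/2)`: `0 | 1`
  (degree `> 4`).  **There is NO rational torus identity of width `2`, in either descent type (S or T): in particular the `(1,1)`-shape
  `(2;2,2)` — a rational member of which would have PINNED the uniform dial of the crux-equivalent core at exactly `1` — is EMPTY over `ℚ`,
  and so are the two lobe shapes.**  (Width `1`: cycle 4; now both widths are theorems of arithmetic rather than numerics.)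
* (14d) RESULT (`ℙ¹`, width `4`, shapes `(4; d, 9−d)`: `d ≤ 6` at `p = 23` (`N ≤ 22`), `d = 7` at `p = 29` (kit j023887); complete; all lifts
  regular): `(4;1,8)` ONE class, RATIONAL (Dirichlet edge `(1/4, 2)`, as predicted — consistency check); `(4;2,7)` `(1/2,7/4)`: 3 classes
  (cubic; degree `> 4`); `(4;3,6)` `(3/4,3/2)`: none; **`(4;4,5)` `(1,5/4)`: one class, degree `> 4`; `(4;5,4)` `(5/4,1)`: three classes, degree
  `> 4`**; `(4;6,3)` `(3/2,3/4)`: two classes, degree `> 4`; `(4;7,2)` `(7/4,1/2)`: two classes, degree `> 4`.  **No rational tight `ℙ¹`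
  identity of width `4` off `φ = 2`: the `5/4`-diagonal shapes and all four lobe candidates are EMPTY over `ℚ`.**
* (14e) CONSEQUENCES.  Identity enemies — `ℙ¹` through width `4` and torus (Pell-boosted) through width `2`, ALL tight shapes, symmetric AND
  asymmetric dessins, with a completeness proof — add NO corner to the two-exponent diagram beyond the landed `(0,2)`, `(1,3/2)`, `(2,0)`:
  the uniform ceiling of the core stays `3/2` (`padeFamily₂`, p106450), no lobe appears between the staircase and the line `θ + φ = 2`, and
  the dial table of § (13d) is UNCHANGED (its unconditional column cannot be moved by identities below these widths).  By-products: the twisted `ℚ(√15)` member of the Pell–Bezout shape (corner `(2,0)`), the Dirichlet-edge family `(z;1,2z)`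
  rational for every `z` (hypergeometric Padé, Thue–Siegel), and the certification of cycles 4/5/11's numerical censuses.  OPEN EDGE (xiv), replacing (11e)(viii)–(x): the next shapes that could lower the uniform ceiling are `ℙ¹` width `5`
  (`(5;5,6)`, `(5;6,5)`, diagonal `6/5`, `N ≤ 27`, `p = 29`: `29⁹` pairs) and torus width `3` (`(3;3,3)` at `(1,1)`, `(3;2,4)`/`(3;4,2)` at
  `4/3`, `N ≤ 32`, `p = 37`: `37¹¹` pairs) — beyond exhaustive enumeration of `(Z, Y)`; a structural shortcut (Padé-type linear
  algebra for `(Y, W, V)` given `Z`, or braid orbits on the Hurwitz space first) would be needed.  Verdict unchanged: no kill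
  short of `¬ABC` (`Negative.Framing.towerFourSubLiouville_of_abc`, p74157); nothing landable this cycle (census facts are not Lean
  statements); for provers nothing changes — the crux needs ONE `η > 0`, `ABC` gives every `η < 1`, identities nothing below `3/2`.
-/

section cycle14

/-- **(14a)** Pell–Bezout in `ε`-normal form (special points `0, ∞`): an INTEGER identity whose values at `ε = u + t√2`, `u² − 2t² = 1`, are the
family of `Negative.TorusBezoutCorner` (p138228); the pipeline's `RATIONAL + TWIST(n² = 1)` class of shape `(1;2,0)`. -/
example (e : ℤ) : (e ^ 4 - 4 * e ^ 2 + 1) * (e ^ 2 + 1) ^ 4 - (e ^ 4 + 4 * e ^ 2 + 1) * (e ^ 2 - 1) ^ 4 = -32 * e ^ 6 := by ring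

/-- **(14b)** The only rational tight `ℙ¹` identity of width `3`: shape `(3;1,6)`, corner `(1/3, 2)` on the Dirichlet edge (hypergeometric Padé
approximant to `((s+12)/(s−12))^{1/4}`); found by the mod-23 census and reconstructed exactly from its 23-adic lift. -/
example (s : ℤ) : (s + 12) * (5 * s ^ 3 - 15 * s ^ 2 - 414 * s + 567) ^ 4 - (s - 12) * (5 * s ^ 3 + 15 * s ^ 2 - 414 * s - 567) ^ 4
    = 52488 * (17875 * s ^ 6 - 3099525 * s ^ 4 + 134668170 * s ^ 2 + 47258883) := by ring

end cycle14

/-! ## Cycle 15 (refuter-cdisprove-stmt-ABC-1649-g15-0, 2026-08-17): the last conjecturally-pinned entry is DECIDED — in `hLW` the `ε` is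
NECESSARY: `LW₄(κ)` is FALSE for every `κ ≤ 1` (LANDED `Negative.LangWaldschmidtEpsilon`, p151827)

Context.  After cycles 12–14 the S⁺5 row read: `LW₄(κ)` false `κ < 1` (p141178) | `ABC ⟹` true `κ > 1` (p143831) | "`LW₄(1)` with a FIXED
constant open, ⟺ enemies with `|wZ⁴ − vY⁴|(v³w)^{1/4} = o(Z²)`" ((12e)(xii), (13b), (13e)).  That equivalence looked only at the DICTIONARY
instances `b = (1,4,−1,−4)`; the typed `hLW` (hypothesis of `stub_cruxOfLangWaldschmidt`, p111401) quantifies over ALL `|bᵢ| ≤ 4`.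
### (15a) LANDED p151827: `not_langWaldschmidt4_of_le_one` — NO `C > 0` has `C(∏ aᵢ)^{−κ} ≤ |∑ bᵢ log aᵢ|` (`κ ≤ 1`; matrix verbatim)
Instance `a = (X, Y, D, 1)`, `b = (3, −2, −1, 0)`: `Λ = log(X³/(DY²)) ∈ (0, 1/(DY²)]` when `X³ = DY² + 1`, so `Λ·∏ aᵢ ≤ X/Y`; and
`hallPell_family`: **`∀ N ∃ X Y D > 0, X³ = D·Y² + 1 ∧ N·X ≤ Y`** — from `x² − 3y² = 1` put `P = (2x+3y)y`, `Q = x² + 3xy + 3y²`, then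
`Q² = 3P² + 3P + 1` (`hallPell_algebra`; `(2Q)² − 3(2P+1)² = 1`) and `(3P+1)³ − 1 = 9PQ²`; at Pell index `t = M·y_M` Matiyasevich's
`y_M² ∣ y_t` (`Pell.ysq_dvd_yy`, the lemma behind `not_towerIneq4OneNoEps`) makes `P = e²P'`, `e = y_M ≥ M`, whence `X = 3P+1`, `D = 9P'`,
`Y = eQ ≥ (e/3)X`.  A FREE SQUARE in the `D`-slot — the slot through which Lang–Waldschmidt yields Hall's conjecture — paid for only
logarithmically (`e ≍ log A/log log A`, `A = ∏ aᵢ`; so `|Λ| ≲ log log A/(A log A)`, consistent with `ABC ⟹ LW₄(1+ε)`).  Corollaries: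
`not_langWaldschmidt4_one` (`κ = 1`), `not_hLW_matrix_of_nonpos` (`hLW` at any `ε ≤ 0` is false: `0 < ε` cannot become `0 ≤ ε`),
`one_lt_of_langWaldschmidt4` (an admissible exponent is `> 1`), and **`langWaldschmidt4_iff_of_abc'`: under `ABC`, `LW₄(κ) ⟺ 1 < κ` for EVERY
real `κ`** (p143831 needed `κ ≠ 1`).  S⁺5 is decided at its pin like S⁺4 (`PolySzpiro` at `6`, Szpiro's `ε` necessary, p141951) and the crux
dial at `A = 1` (`ε` necessary, p72698).  Nothing changes for the edge p111401 (it consumes `κ = 6/5 ∈ (1, 2)`).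
### (15b) The dictionary-restricted `LW₄(1)` (only `b = (1,4,−1,−4)`): NUMERICALLY false too, by `q`-adic accumulation — not landed
On a value-`1` Pell–Bezout member (`(16t²+12)t⁴ − (4t²−1)u⁴ = 1`, `u² = 2t² + 1`) a fourth power `q⁴ ∣ v = 4t² − 1` is absorbed into `Y`:
`(v/q⁴, w, qu, t)` is again a coprime value-`1` enemy with the SAME `Λ` and `∏ aᵢ` divided by `q³`.  Accumulation occurs (seat numerics,
folder NOTES.md): `5^j ∣ 2t_m − 1` first at `m = 4, 17, 17, 17, 767, 1108` (`j = 1…6`), `23^j ∣ 2t_m − 1` at `m = 2, 167, 3962, 50514, 1121210`,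
likewise `q = 19, 43, 47, 139, 163` (not `q = 3`): the closure of `⟨3+2√2⟩` in the norm-one torus `T(ℤ_q) ≅ ℤ/6 × ℤ₅` (`q = 5`) is everything.
So `|Λ|·∏ aᵢ ≍ q^{−3j} → 0` along `m ≍ q^{j}`, i.e. gain `≍ (log A)^{3/4}` — enemies strictly but SUB-POLYNOMIALLY below the torus Mason–Stothers
plane (consistent with `ubq₃_of_abc`, p143568).  Explicit member `m = 17` (`5⁴ ∥ 2t − 1`) `norm_num`-checked below: `|Λ|·∏ aᵢ ≈ 0.045`
against the Pell–Bezout constant `4√2 ≈ 5.66`.  A proof of `∀ j ∃ m, 5^j ∣ 2t_m − 1` is Hensel lifting in `ℤ[√2,√3]/5^j` (the factors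
`2u² − 3 = N(u√2 + √3)` are twisted norms, no Lucas factorisation — unlike `y_M² ∣ y_{M y_M}`); not attempted.  The same accumulation in
`w/4 = 4t² + 3 = 2u² + 1` (`19 ∣` at `t = 2`) would give value-`1` enemies with `max(v, w/q⁴) ≤ (qt)²`, i.e. decide the boundary point
`θ = 2` of the axis `φ = 0` (`ubq₂_axis_iff_of_abc` excludes exactly `θ = 2`): open, same obstruction.
### (15c) `q`-ADIC TWISTS decide the boundary values of the two-exponent diagram (LANDED p152685, p153421, p153437)
The typed matrices `UBQ₂(θ, φ)` / `UBQ η` carry the constant `1` (`max(v,w) ≤ Z^θ`, `Z^φ < |wZ⁴ − vY⁴|`), so an identity family decides a BOUNDARY point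
only if its constants are `≤ 1` — Pell–Bezout has `16`, the `(1;1,2)` identity `20`, padeFamily₂ `2` and `948.7`.  LEVER: an arithmetic fourth power
`q⁴ ∣` (a coefficient) on a residue class of the parameter moves into the fourth-power variable (`w' = w/q⁴`, `Z' = qZ`): exponents unchanged, height
constant divided by `q^{4+θ}`, value constant by `q^φ`; coprimality survives because `w'Z' ∣ wZ`.  Three modules:
* `Negative.AxisBoundary` (p152685) — the `d = 3` twist of Bezout: `(2u²+1)(u²−1)² − (2u²−3)u⁴ = 1` with `u² − 1 = 3s²` has `2u² + 1 = 3(2s²+1)` and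
  `3 ∣ 2s² + 1` iff `3 ∤ s`, so `3⁴ ∣ w`: **`((2s²+1)/3)·(3s)⁴ − (6s²−1)·u⁴ = 1`**, value `1` at height `max(v,w) = (2/3)Z² − 1` (members `1·3⁴ − 5·2⁴`,
  `11·12⁴ − 95·7⁴`, `2091·168⁴ − 18815·97⁴ = 1`; `3 ∤ s` along the three-step recursion `(u,s) ↦ (26u+45s, 15u+26s)`).  Hence `¬UBQ₂(θ, φ)` for ALL `θ ≥ 2`,
  `φ ≥ 0` (closed lobe; p138228 had `θ > 2`), **the axis point `(2,0)` is false and `UBQ₂(θ,0) ⟺ θ < 2` for EVERY `θ ≥ 0` under `ABC`** (p143568 excluded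
  `θ = 2`), the three-exponent corner `(2,2,0)` ON the torus Mason–Stothers plane is false, and the Thue/Roth rungs and the unit slice are false AT `η = 2`.
* `Negative.StaircaseCorner` (p153421) — the `(1;1,2)` identity on `s ≡ −2 (mod 5⁴)` ∩ `s ≡ 3 (mod 6)`, i.e. the integer identity
  `(6j+5)(37500j+31225)⁴ = (3750j+3121)(7500j+6247)⁴ + 80(3750j+3123)² + 4`: height `v ≤ Z'/10`, value `≈ 0.8·Z'²` — corner `(1, 2)` false
  (`¬UBQ₂` for `θ ≥ 1`, `φ ≥ 2`); anchored at `(p,q) = (1,5)` (`625w' = v + 4`), so Dc2's ON-piece is false AT `η = 2` for `B ≥ 5`.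
* `Negative.PadeTwistThreeHalves` (p153437) — padeFamily₂ (`w(k) = 20(s+1)² + 1`, `s = 42k+1`; `3 ∣ w`, `3⁴ ∣ w ⟺ 27 ∣ k`; simple roots mod every `p` with
  `(−5/p) = 1`) twisted by `q = 3·41 = 123` (`123^{3/2} ≈ 1364 > 948.7`): `123⁴ ∣ w(k)` on `k = 3114423 + 76295547j` (Hensel at `41`, CRT), `w' = w/123⁴`,
  `Z' = 123Z`, `v ≤ Z'`, `a² ≤ Z'³` (degree-6 slack polynomial with non-negative coefficients, `ring`).  Hence **`UBQ(3/2)` is FALSE — the uniform ceiling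
  `3/2` of p106450 is NOT attained** (`not_ubq_threeHalves`; `UBQ η` false for all `η ≥ 3/2`; a witness has `η < 3/2`), the corner `(1, 3/2)` is false and
  the lobe `{θ ≥ 1, φ ≥ 3/2}` closed.  FALSE region after cycle 15: **`{θ ≥ 2, φ ≥ 0} ∪ {θ ≥ 1, φ ≥ 3/2} ∪ {θ > 0, φ > 2}`** (`ubq₂_false_of_corner₉`);
  staircase corners `(1,2)`, `(1,3/2)`, `(2,3/2)`, `(2,0)` FALSE, `(0,2)` TRUE (column `θ = 0`).
* `Negative.DirichletEdgeTwist` (p154214) — the `z = 2` Dirichlet-edge identity `(s+4)(s²−s−5)⁴ − (s−4)(s²+s−5)⁴ = 168s⁴ − 1800s² + 5000` (corner `(1/2,2)`,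
  value constant `168`) twisted by `15⁴ ∣ s + 4` on `s = 708750u + 151871` (`15² = 225 > 168`; Bezout constants `8, 7, 7, 10`): `¬UBQ₂` for `θ ≥ 1/2`, `φ ≥ 2`.
  FINAL FALSE region of cycle 15: **`{θ ≥ 2, φ ≥ 0} ∪ {θ ≥ 1, φ ≥ 3/2} ∪ {θ ≥ 1/2, φ ≥ 2} ∪ {θ > 0, φ > 2}`** (`ubq₂_false_of_corner₁₀`); open boundary
  `{0 < θ < 1/2, φ = 2}` only (the `z ≥ 3` edge identities twisted the same way give `θ ≥ 1/z`; `z = 3` needs `q ≥ 6125`).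
### (15d) DIAL TABLE rows changed (DIALS.md is the table): S⁺5 `LW₄(κ)`: FALSE every `κ ≤ 1` | `ABC`: TRUE every `κ > 1` — decided.  Core `UBQ η`: FALSE
every `η ≥ 3/2`.  `UBQ₂`: closed lobes as above; axis `φ = 0`: FALSE `θ ≥ 2`, `ABC`-TRUE `θ < 2` — decided.  S⁺2/S⁺3 rungs, Dc1, Dc2 (`B ≥ 5`): FALSE at `η = 2`.
After 15 cycles every row whose pin is a single number is decided on BOTH sides of the pin (`A = 1` needs `ε`; `s = 6`; `κ_LW = 1`; `θ = 2`; `η = 2`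
on slices and rungs; `η = 3/2` uniform), except the transfer pins with a fixed constant ((9d)(v')).
### (15e) Open edges after cycle 15 (none bears on the truth of the crux; verdict unchanged: no kill short of `¬ABC`, p74157)
(6e)(i) bare `log c` loss at `A = 1`; (12e)(xi) dictionary `PolySzpiro` floor `5`; (13e)(xiii) the band between `θ + φ = 2` and the staircase
(undetermined even under `ABC`); (xiv) `ℙ¹` width 5 / torus width 3 censuses; (xv) dictionary `LW₄(1)` and "value `1` at height `≤ cZ²` for every `c`" —
both ⟸ `q`-adic ACCUMULATION along Pell (numerically yes, (15b); Hensel in `ℤ[√2,√3]`); (xvi) the boundary segment `{0 < θ < 1/2, φ = 2}` (`z ≥ 3` edge twists); (xvii) the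
quantitative loss at `κ_LW = 1` (the family gives `|Λ| ≲ log log A/(A log A)`); (9d)(v').  FOR PROVERS: unchanged — the crux needs ONE `η > 0` in `UBQ`
(now known: `η < 3/2` for any witness); `ABC` gives every `η < 1`; every conjectural input typed so far is consumed strictly inside its open range. -/

section cycle15
open Summit.ABC.ABC.Theorems.TowerFourSubLiouville.Negative

/-- **(15a) LANDED p151827**, restated BY NAME: `LW₄(κ)` false for `κ ≤ 1`; `κ = 1`; `hLW` at `ε ≤ 0`; the full dial under `ABC`;
the Hall–Pell family and its algebra. -/
example := @not_langWaldschmidt4_of_le_one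
example := @not_langWaldschmidt4_one
example := @not_hLW_matrix_of_nonpos
example := @langWaldschmidt4_iff_of_abc'
example := @one_lt_of_langWaldschmidt4
example := @hallPell_family
example := @hallPell_algebra

/-- **(15a)** The `κ = 1` endpoint in the shape of the dial rows of § (12b)/(13b): no fixed constant works at exponent `−1`. -/
example : ¬ ∃ C : ℝ, 0 < C ∧ ∀ a : Fin 4 → ℕ, ∀ b : Fin 4 → ℤ, (∀ i, 0 < a i) → (∀ i, |b i| ≤ 4) →
      (∑ i, (b i : ℝ) * Real.log (a i : ℝ)) ≠ 0 →
      C * (((∏ i, a i : ℕ) : ℝ)) ^ (-(1 : ℝ)) ≤ |∑ i, (b i : ℝ) * Real.log (a i : ℝ)| :=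
  not_langWaldschmidt4_one

/-- **(15a)** First members of the Hall–Pell family `X³ = D·Y² + 1` (`P = 7, 104, …`): `22³ = 63·13² + 1`, `313³ = 936·181² + 1`
(`313 = 3·104 + 1`, `104 = 26·4 = x₃y₂`… here with `e = 1`); the free square enters at Pell index `M·y_M`. -/
example : (22 : ℕ) ^ 3 = 63 * 13 ^ 2 + 1 ∧ (313 : ℕ) ^ 3 = 936 * 181 ^ 2 + 1 := by norm_num

/-- **(15b)** The explicit `5`-adic member: Pell index `m = 17` of `u² − 2t² = 1`, `5⁴ ∥ 2t − 1`, fourth power absorbed into `Y`: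
a coprime value-`1` binomial-quartic enemy `wZ⁴ − v'Y'⁴ = 1` with `v' = (4t²−1)/5⁴`, `Y' = 5u` — `|Λ|·∏ aᵢ ≈ 0.045`. -/
example : (5168247530883 : ℕ) ^ 2 = 2 * 3654502875938 ^ 2 + 1 ∧
    (213686260323825808310077516 : ℕ) * 3654502875938 ^ 4
      = 85474504129530323324031 * 25841237654415 ^ 4 + 1 ∧
    (213686260323825808310077516 : ℕ) = 16 * 3654502875938 ^ 2 + 12 ∧
    (85474504129530323324031 : ℕ) * 5 ^ 4 = 4 * 3654502875938 ^ 2 - 1 ∧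
    (25841237654415 : ℕ) = 5 * 5168247530883 := by norm_num

/-- **(15c) LANDED p152685 / p153421 / p153437**, restated BY NAME: the closed lobes, the axis decided under `ABC`, `UBQ(3/2)` false,
the corners, the slices and rungs at `η = 2`, the three families. -/
example := @not_ubq₂_of_two_le
example := @not_ubq₂_two_zero
example := @ubq₂_axis_iff_of_abc'
example := @not_ubq₃_of_two_two_zero_le
example := @movingThue4_budget_lt_two
example := @movingRoth4_budget_lt_two
example := @not_ubqOn_unitSlice_of_two_le
example := @exists_pell3Bezout
example := @not_ubq₂_one_two
example := @not_ubqOn_anchoredSlice_of_two_le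
example := @exists_anchoredFamily5
example := @not_ubq_threeHalves
example := @not_ubq_of_threeHalves_le
example := @lt_threeHalves_of_ubq
example := @not_ubq₂_one_threeHalves
example := @ubq₂_false_of_corner₉
example := @exists_padeTwist
example := @not_ubq₂_half_two
example := @ubq₂_false_of_corner₁₀
example := @exists_dirichletEdge₂Twist

/-- **(15c)** The `d = 3` Bezout identity behind the axis point, over `ℤ` (no Pell needed): with `u² = 3s² + 1` it reads
`27(2s²+1)s⁴ − (6s²−1)u⁴ = 1`, and `3 ∣ 2s² + 1` whenever `3 ∤ s`. -/
example (u s : ℤ) (h : u ^ 2 = 3 * s ^ 2 + 1) : 27 * (2 * s ^ 2 + 1) * s ^ 4 - (6 * s ^ 2 - 1) * u ^ 4 = 1 := by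
  have : u ^ 4 = (3 * s ^ 2 + 1) ^ 2 := by rw [← h]; ring
  rw [this]; ring

/-- **(15c)** The `z = 2` Dirichlet-edge identity (corner `(1/2, 2)`; twisted and LANDED as `Negative.DirichletEdgeTwist`, p154214). -/
example (s : ℤ) : (s + 4) * (s ^ 2 - s - 5) ^ 4 - (s - 4) * (s ^ 2 + s - 5) ^ 4 = 168 * s ^ 4 - 1800 * s ^ 2 + 5000 := by ring

end cycle15


/-! ## Cycle 16 (refuter-cdisprove-stmt-ABC-1649-g16-0, 2026-08-17): the critical line `θ + φ = 2` carries FALSE points besides `(2, 0)` —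
the Padé STEP from the value-`1` corner (LANDED `Negative.CriticalLineStep` p157288, `Negative.CriticalLineTwoSevenths` p157619,
`Negative.CriticalLineTwoThirteenths` p157983)

### (16a) Mechanism
The Dirichlet-edge identities are the diagonal Padé approximants of `(1 + x)^{1/4}`; homogenised and read at a SOLUTION `wZ₀⁴ = vY₀⁴ + a`,
`N := vY₀⁴`, instead of at `1/1`: `(N+a)(8N+3a)⁴ − N(8N+5a)⁴ = a³(320N² + 320aN + 81a²)` (`padeStep₁_identity`) and
`(N+a)(S²−Sa−5a²)⁴ − N(S²+Sa−5a²)⁴ = a⁵(21S⁴ − 225S²a² + 625a⁴)`, `S = 8N + 4a` (`padeStep₂_identity`) — a new solution with the SAME `(v, w)`,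
`Z ≈ (8N)^z Z₀`, value`/Z² ≈ 5a³/Z₀²` resp. `21a⁵/Z₀²`, `→ 0` along any base family with `a = 1`.  Base = the value-`1` Pell–Bezout family of p152685
(`81w₀s⁴ = vu⁴ + 1`, `v = 6s² − 1`, `3w₀ = 2s² + 1`, `u² = 3s² + 1`, heights `(2/3)Z₀²`): exponents `(θ, φ) = (2/(6z+1), 12z/(6z+1))` — ON the torus
Mason–Stothers line `θ + φ = 2` (torus-tight identities of width `6z + 1`, beyond every census), accumulating at the TRUE point `(0, 2)`.
`3`-adics: `z = 1`: `N ≡ −1 (mod 81)` ⟹ `3 ∥ 8N + 5`; divided by `3⁴`: `w₀(s(8N+3))⁴ − v(u(8N+5)/3)⁴ = 320Nw₀s⁴ + 1` (`s = 1`: `643⁴ = 5·430⁴ + 25601`);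
`z = 2`: `3 ∥ S² − S − 5` on the `Z`-side, nothing moves.  Obstruction primes of the steps: `3` (`z = 1`), `7` (`z = 2`), `3, 5, 7, 11, 13` (`z = 3`).
CONSTANTS (the matrices carry `1`): `z = 1`: `a⁷ ≤ Z¹²` exact but `v⁷ ≤ Z²` off by `3/2` — repaired by the TWIST `3⁴ ∣ w₀ ⟺ 3⁵ ∣ 2s² + 1 ⟺` Pell index
`≡ 121, 122 (mod 243)` (unit `(2+√3)²⁴³ ≡ −1 (mod 3⁵)`): `exists_lineFamily₁` (`w = w₀/81`, `Z = 3s(8N+3)`, coprime, `w ≤ v`, `v⁷ ≤ Z²`, `a⁷ ≤ Z¹²`).  `z = 2`: `v¹³ ≤ Z²` exact, `a ≤ Z²` from `s ≥ 4`, but `a ≈ 18·Z^{24/13}` (`192²⁴a¹³ ≤ 403681¹³96⁴Z²⁴`;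
`exists_lineFamily₂` on Pell indices `≡ 1 (mod 24)`, `s ≡ 1 (mod 105)`); the exact corner `(2/13, 24/13)` needs `q⁴ ∣ w₀`, `q ≥ 5` (`11⁴`: Pell index `3328`).
### (16b) LANDED
`not_ubq₂_of_twoSevenths_le` (**`UBQ₂(θ, φ)` FALSE for `θ ≥ 2/7`, `φ ≥ 12/7`**), `not_ubq₂_twoSevenths_twelveSevenths` (**the LINE POINT `(2/7, 12/7)`**),
`ubq₂_row_iff_of_abc₁`/`ubq₂_col_iff_of_abc₁` (`ABC`: `UBQ₂(θ, 12/7) ⟺ θ < 2/7`, `UBQ₂(2/7, φ) ⟺ φ < 12/7`);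
`not_ubq₂_of_twoThirteenths_le` (FALSE for `θ ≥ 2/13`, `φ > 24/13`), `not_ubq₂_twoThirteenths_two` (edge point `(2/13, 2)`); **`ubq₂_false_of_corner₁₁`:
FALSE region `{θ≥2, φ≥0} ∪ {θ≥1, φ≥3/2} ∪ {θ≥2/7, φ≥12/7} ∪ {θ≥2/13, φ>24/13} ∪ {θ>0, φ>2}`**; open boundary of the Dirichlet edge `{0 < θ < 2/13, φ = 2}`;
the `ABC`-open band ((13e)(xiii)) loses both lobes.
### (16c) Correction of § (11d): anchoring DOES go below `Z²` once the anchor denominators grow (`q = Z₀`); iterating diverges (values cube):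
a base `(θ₀, φ₀)` lands at `(θ₀/(5+θ₀), (3φ₀+8+2θ₀)/(5+θ₀))` — on the line only from `(2, 0)`, never on the open side.
### (16d) Open edges after cycle 16 — superseded by § (17c) ((xvi') `z = 3` DONE in § Cycle 17: the prime `7` is not an obstruction, it is divided out). -/

section cycle16
open Summit.ABC.ABC.Theorems.TowerFourSubLiouville.Negative

/-- **(16a/b) LANDED p157288 / p157619 / p157983**, restated BY NAME. -/
example := @padeStep₁_identity
example := @padeStep₂_identity
example := @padeStep₁_compose
example := @padeStep₂_compose
example := @exists_pell3_unit243
example := @pell3_twist243_exists_ge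
example := @exists_lineFamily₁
example := @not_ubq₂_of_twoSevenths_le
example := @not_ubq₂_twoSevenths_twelveSevenths
example := @ubq₂_row_iff_of_abc₁
example := @ubq₂_col_iff_of_abc₁
example := @exists_lineFamily₂
example := @not_ubq₂_of_twoThirteenths_le
example := @not_ubq₂_twoThirteenths_two
example := @ubq₂_false_of_corner₁₁

/-- (16a) The first member of the untwisted `z = 1` step (`s = 1`: `u = 2`, `v = 5`, `w₀ = 1`, `N = 80`, `Z = 8·80+3`, `Y = 2·645/3`), and the step at `a = 1`. -/
example : (1 : ℕ) * 643 ^ 4 = 5 * 430 ^ 4 + 25601 ∧ (25601 : ℕ) = 320 * 80 + 1 ∧ Nat.gcd (5 * 430) 643 = 1 := by norm_num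
example (N : ℤ) : (N + 1) * (8 * N + 3) ^ 4 - N * (8 * N + 5) ^ 4 = 320 * N ^ 2 + 320 * N + 81 := by ring

end cycle16


/-! ## Cycle 17 (refuter-cdisprove-stmt-ABC-1649-g17-0, 2026-08-17): the `z = 3` Padé step — the obstruction prime DIVIDED OUT — gives the lobe
`{θ ≥ 2/19, φ > 36/19}` at the line point `(2/19, 36/19)` (LANDED `Negative.PadeTableThree` p161229, `Negative.CriticalLineTwoNineteenths` p161550)

### (17a) Mechanism
The step polynomials are the diagonal Padé approximants of `(1+x)^{1/4}`: `A_z = N^z·₂F₁(−z, −z+1/4; −2z; −a/N)`, `B_z = N^z·₂F₁(−z, −z−1/4; −2z; −a/N)`,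
`(N+a)A_z⁴ − NB_z⁴ = a^{2z+1}E_z`, `deg E_z = 2z` (verified `z ≤ 6`, every `E_z > 0`; `z = 3`: `A₃ = 2560N³ + 3520N²a + 1232Na² + 77a³`,
`B₃ = 2560N³ + 4160N²a + 1872Na² + 195a³`, `padeStep₃_identity`), tied by the table's three-term recurrence (`A₂ = 4(2N+1)A₁ − 5`, `A₃ = 20(2N+1)A₂ − 21A₁`,
`padeTable_recurrence`) and CONSTANT Casoratians `A₁B₂ − B₁A₂ = 10`, `A₂B₃ − B₂A₃ = 210` (`padeTable_casoratian`; `z ≤ 6`: `2, 10, 210, 6006, 14586,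
277134`) — so `gcd(A_z(N), B_z(N))` is uniformly bounded and the only coprimality obstructions are the primes of `A_z(0)B_z(0)A_z(−1)B_z(−1)` met by `vu`
resp. `ws` (`z = 3`: `A₃(0) = 7·11`, `B₃(0) = 3·5·13`).  On the `d = 3` base the prime `7` divides `A₃(N)` AND `B₃(N)` for EVERY member (`N ≡ 3 (mod 7)`);
(16d) read this as an obstruction — it is not: a common prime of the two step polynomials divides the VALUE to the fourth power and is divided out
(`N = 7q + 3`, `A₃ = 7Â(q)`, `B₃ = 7B̂(q)`, `E₃ = 7⁴Ê(q)`, `padeStep₃_div7`), improving the value constant by `7⁴` at no cost in height.  Family (class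
`s ≡ 1 (mod 1155)`, unit `(2+√3)¹²⁰ ≡ 1 (mod 1155)`, `pell3_good1155_exists_ge`): `(v, w, Y, Z, a) = (6s²−1, (2s²+1)/3, u·B̂(q), 3s·Â(q), Ê(q))`,
`Â = 125440q³ + 185920q² + 91472q + 14939`, `B̂ = 125440q³ + 190400q² + 95952q + 16053`; `gcd(vY, wZ) = 1` (`hat_coprime`: Casoratian`/7 = 30`,
`2, 5 ∤ Â`, `3 ∤ B̂`; `gcd(vu, Â)`, `gcd(B̂, 3ws) ∣ 77`, `7, 11 ∤ vuws`); certificates `v¹⁹ ≤ Z²` (EXACT: `Z ≥ 81285120s¹⁹`, `v¹⁹ ≤ 6¹⁹s³⁸`) and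
`376320³⁶·7⁶·a¹⁹ ≤ 96⁶·7824636949041¹⁹·Z³⁶` (`36/19` exact, constant `≈ 36`).  First member (`s = 1`, `q = 11`): `571434273⁴ − 5·382141130⁴ =
1593199545338433841`.  The `d = 2` base (p138228) also works (no division, Pell(2) indices `≢ 0 (mod 3)`) but its height constant `16Z₀²` only
gives the open `θ > 2/19`.
### (17b) LANDED
`not_ubq₂_of_enemyFamily` / `not_ubq₂_of_enemyFamily_exact` (ANY family with integer certificates `v^q ≤ Z^p`, `c₁a^t ≤ c₂Z^r` ⟹ `UBQ₂` FALSE for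
`θ ≥ p/q`, `φ > r/t` resp. `≥ r/t` — the real-exponent boilerplate once and for all; `(2/7, 12/7)` re-derived in one line), `exists_lineFamily₃`,
**`not_ubq₂_of_twoNineteenths_le`: `UBQ₂(θ, φ)` FALSE for every `θ ≥ 2/19`, `φ > 36/19`**, `not_ubq₂_twoNineteenths_two` (edge point `(2/19, 2)`),
`le_thirtySixNineteenths_of_ubq₂`, **`ubq₂_false_of_corner₁₂`: FALSE region
`{θ≥2, φ≥0} ∪ {θ≥1, φ≥3/2} ∪ {θ≥2/7, φ≥12/7} ∪ {θ≥2/13, φ>24/13} ∪ {θ≥2/19, φ>36/19} ∪ {θ>0, φ>2}`**; open boundary of the Dirichlet edge: `{0 < θ < 2/19, φ = 2}`.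
### (17c) Open edges after cycle 17 (verdict unchanged: no kill short of `¬ABC`, p74157)
(xvi'') every further `z` is now MECHANICAL (polynomials from the ₂F₁ formula, seat `py/padegen.py`; obstruction primes from `A_z(0)`, `B_z(0)`; common primes
divided out; `exists_lineFamily_z` + `not_ubq₂_of_enemyFamily`) and adds the lobe at `(2/(6z+1), 12z/(6z+1))` (`z = 4`: `A₄ = 28672N⁴ + 53760N³ + 31680N² +
6160N + 231`, corner `(2/25, 48/25)`); the GENERAL `z` (edge segment `→ ∅`, i.e. `UBQ₂(θ, 2)` false for every `θ > 0`; the staircase of lobes accumulating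
at the TRUE point `(0, 2)`) needs the Padé property of the ₂F₁ pair for all `z` (a balanced terminating ₃F₂ — Pfaff–Saalschütz): a formalisation task, not a
search; (xvii) exact corners `(2/13, 24/13)`, `(2/19, 36/19)` (`q⁴ ∣ w` twists, `q ≥ 5`); (xviii) the band strictly inside and the diagonal point `(1, 1)` —
heuristically FALSE with only logarithmic divergence (`Σ Z^{θ+φ−3} = Σ 1/Z`), no identity lever on either side (CENSUS-c14); (6e)(i) bare `log c` (same
logarithmic regime); (xiv) censuses.  FOR PROVERS: unchanged — one `η > 0` in `UBQ`; every enemy found has `θ ≤ 2/7 < 12/7 ≤ φ`, far from the diagonal. -/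

section cycle17
open Summit.ABC.ABC.Theorems.TowerFourSubLiouville.Negative

/-- **(17a/b) LANDED p161229 / p161550**, restated BY NAME. -/
example := @padeStep₃_identity
example := @padeStep₃_compose
example := @padeTable_recurrence
example := @padeTable_casoratian
example := @padeStep₃_div7
example := @not_ubq₂_of_enemyFamily
example := @not_ubq₂_of_enemyFamily_exact
example := @pell3_good1155_exists_ge
example := @hat_coprime
example := @exists_lineFamily₃
example := @not_ubq₂_of_twoNineteenths_le
example := @not_ubq₂_twoNineteenths_two
example := @le_thirtySixNineteenths_of_ubq₂
example := @ubq₂_false_of_corner₁₂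

/-- (17a) The first member of the `z = 3` line family (`s = 1`: `u = 2`, `v = 5`, `w = 1`, `N = 80 = 7·11 + 3`, `q = 11`), coprime. -/
example : (1 : ℕ) * 571434273 ^ 4 = 5 * 382141130 ^ 4 + 1593199545338433841 ∧
    (571434273 : ℕ) = 3 * 1 * (125440 * 11 ^ 3 + 185920 * 11 ^ 2 + 91472 * 11 + 14939) ∧
    (382141130 : ℕ) = 2 * (125440 * 11 ^ 3 + 190400 * 11 ^ 2 + 95952 * 11 + 16053) ∧
    Nat.gcd (5 * 382141130) (1 * 571434273) = 1 := by
  norm_num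

end cycle17



end Summit.ABC.ABC.Cruxes.TowerFourSubLiouville.Disproof
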